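import Summits.ResolutionOfSingularities.ResolutionOfSingularities.Theses.Valuative
import Summits.ResolutionOfSingularities.ResolutionOfSingularities.Theses.CyclicCovers
import Literature.AlgebraicGeometry.Resolution.ResolutionLU
import Literature.AlgebraicGeometry.Resolution.ZariskiPatchingAllDimensions
import Literature.AlgebraicGeometry.Resolution.NonReducedNoResolution
import Literature.AlgebraicGeometry.Resolution.AffineModelObstructions
import Literature.AlgebraicGeometry.Resolution.AbsoluteIntegralClosureNoResolution
import Literature.AlgebraicGeometry.Resolution.LocalUniformizationEssFiniteType
import Literature.AlgebraicGeometry.Resolution.LocalUniformizationClosedPoints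
import Literature.AlgebraicGeometry.Resolution.AbhyankarEtaleAscentProofs
import Literature.AlgebraicGeometry.Resolution.FiniteExtensionUniformizationProofs
import Literature.AlgebraicGeometry.Resolution.RegularLocalRingsNormal
import Literature.AlgebraicGeometry.Resolution.SmoothUniformizationProofs
import Literature.AlgebraicGeometry.Resolution.ValuedFunctionFieldsLemmas
import Literature.AlgebraicGeometry.Resolution.NormalizationFractions
import Literature.AlgebraicGeometry.Resolution.QuasiExcellentSchemes
import Literature.AlgebraicGeometry.Resolution.ResolutionOfComponents
import Literature.AlgebraicGeometry.Resolution.ResolutionProjectiveReduction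
import Literature.AlgebraicGeometry.Resolution.RegularCentreBlowupSeqExtension
import Literature.AlgebraicGeometry.Resolution.ProjectiveSpaceRegular
import Literature.AlgebraicGeometry.Resolution.AlterationsStrong
import Literature.AlgebraicGeometry.Resolution.ProperModelsPatching
import Literature.AlgebraicGeometry.Resolution.ProperModelsModification
import Literature.AlgebraicGeometry.Resolution.ZariskiPatchingProperModels
import Literature.AlgebraicGeometry.Resolution.AlterationsResolution
import Literature.AlgebraicGeometry.Resolution.ResolutionGlue
import Literature.AlgebraicGeometry.Resolution.GeneralLU
import Literature.AlgebraicGeometry.Resolution.BlowupsIntegral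
import Literature.AlgebraicGeometry.Resolution.BlowupsFlatBaseChange
import Literature.AlgebraicGeometry.Resolution.ProperModelsPatchingGluing
import Literature.AlgebraicGeometry.Resolution.GraphClosureCompactification
import Literature.AlgebraicGeometry.Resolution.PrincipalizationToResolution
import Literature.AlgebraicGeometry.Morphisms.NagataCompactification
import Literature.AlgebraicGeometry.Resolution.ProperModelsRegModel
import Literature.AlgebraicGeometry.Resolution.ProjectiveModelsCharts
import Literature.AlgebraicGeometry.Resolution.CanonicalResolutionProofs

/-!
# Disproof of `PatchingRel` (stmt-ResolutionOfSingularities-0642) — standing disprover's work file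

Crux (route `Valuative` rank 3 = route `CyclicCovers` rank 6, same term):
`PatchingRel : ∀ p prime, LUrel_p → ResolutionInChar.{0} p`, where `LUrel_p` is RELATIVE Zariski
local uniformization in characteristic `p` (every finitely generated `R ⊆ O` of a finitely
generated `K/k`, `char k = p`, is dominated by a finitely generated `A`, `R ≤ A ⊆ O`,
`Frac A = K`, `A` regular at the centre of `O`).

## Findings (gens 1–3, 2026-08-15/16; gen-1 findings re-derived in §1–§2 from the tree files it landed)

* §0 `patchingRel_iff`, `cyclicCovers_patchingRel_iff` — the two route copies are one term.
* §1 WHY IT RESISTS (proved): `not_patchingRel_iff` — `¬ PatchingRel ↔ ∃ p prime, LUrel_p ∧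
  ¬ ResolutionInChar p`; the converse `Res_p → LUrel_p` is the tree theorem
  `lurel_of_resolutionInChar`, and `summit_iff : ResolutionOfSingularities ↔ (∀ p, LUrel_p) ∧
  PatchingRel`. A kill must PROVE local uniformization in some characteristic `p` (open in
  dimension `≥ 4`) AND refute resolution there. No cheap, degenerate or finite-model route exists:
  every junk instance of the antecedent (trivial valuation, `K = k`, `trdeg ≤ 1`, `R = ⊥`) is true
  and the consequent is the summit slice.
* §2 LOAD-BEARING ANALYSIS OF THE ANTECEDENT (each clause dropped in turn, as theorems):
  (H1) `p.Prime` — not load-bearing (`patchingRelAllChar_iff`, modulo the named fact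
  `Hironaka1964` for `p = 0`; composite `p` is vacuous on both sides);
  (H2) `k ⊆ O` — redundant (`lurelNoConst_iff`);
  (H3) `(⊤ : IntermediateField k K).FG` — load-bearing FOR THE ANTECEDENT: dropped, the antecedent
  is false (`not_lurel_without_fg`, tree) and the crux becomes VACUOUSLY TRUE
  (`patchingRelNoFG_holds`) — a trap, not a proof;
  (H4) NEW `IsFractionRing A K` — redundant (`lurelNoFrac_iff`: enlarge `R` by an affine model
  first);
  (H5) relativity `R ≤ A` — dropping it gives the absolute crux `Patching` (stmt-0561), which
  IMPLIES `PatchingRel` (`patchingRel_of_patching`); both reduce to the same open core (§4);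
  (H6) regularity at the centre — THE content: dropped, the antecedent is trivially true
  (`lurelNoReg_holds`) and the crux collapses to the summit (`patchingRelNoReg_iff_summit`);
  (H7) NEW the antecedent is FREE on valuation rings essentially of finite type over `k`
  (`lurel_of_essFiniteType`: `O` itself is then a localisation of a finitely generated model and
  is regular) — the content of `LUrel_p` sits entirely at valuation rings that are NOT essentially
  of finite type (non-divisorial: positive defect / rank > 1 / non-Abhyankar).
* §3 CONSEQUENT MUTATIONS (natural strengthenings refuted):
  (C1) `IsReduced` dropped — false (`not_resolutionInChar_without_isReduced`, tree, gen 1), so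
  `patchingRelNoReduced_iff : … ↔ ∀ p prime, ¬ LUrel_p`;
  (C2) NEW `LocallyOfFiniteType` dropped — FALSE (`not_resolutionInChar_without_locallyOfFiniteType`,
  landed this generation as `AbsoluteIntegralClosureNoResolution.lean`: `Spec 𝔽_p[X]⁺` has no
  resolution because a root-closed domain is Noetherian at the generic point only), so
  `patchingRelNoFT_iff : … ↔ ∀ p prime, ¬ LUrel_p`;
  (C3) "one affine chart suffices" — false (`not_forall_exists_uniform_affineModel`, tree, gen 1:
  the `ℙ¹` phenomenon; patching is intrinsic);
  (C4) `QuasiCompact` dropped — believed equivalent (disjoint unions), `IsSeparated` dropped —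
  needs functorial resolution to glue; neither refutable, not formalised.
* §4 OPEN CORE (pointers, proved reductions in the tree): `patchingRel_of_twoModelPatching` —
  two-model patching of projective models in char `p` (Piltant 2013 Prop. 5.1 shape, `P = P_reg`)
  in dimension `≥ 4` is exactly what the crux needs beyond its antecedent
  (`resolutionInChar_of_twoModelPatching_of_relLU`); dimension `≤ 3` is LU-free via
  `CossartPiltant2019`.
* §5 Regimes tried in gen 2 and why each fails to bite (docstring).
* GEN 3 (2026-08-16):
  (H8) NEW `lurelZeroDim_iff`, `lurelMin_iff`, `patchingRelZeroDim_iff` (§2) — LU at CLOSED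
  POINTS of the Zariski–Riemann space (zero-dimensional valuation rings / valuation rings minimal
  over `R`) is EQUIVALENT to the full antecedent (landed: `LocalUniformizationClosedPoints.lean`,
  p71899: Serre descent of regular centres to coarsenings + closed point below any `O` + Zariski's
  lemma); with (H7) the content of `LUrel_p` sits at zero-dimensional valuations not essentially
  of finite type, i.e. everywhere in `trdeg ≥ 2` except at Abhyankar places (Knaf–Kuhlmann 2005);
  (H8c) NEW `lurel_free_at_abhyankarPlace`, `lurelPerfectHard_iff` — over PERFECT ground fields the
  antecedent is FREE at Abhyankar places (landed: `LocalUniformizationAbhyankarPlaces.lean`,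
  p72405, glue over the tree's proved Knaf–Kuhlmann 2005 Thm 1.1) and is EQUIVALENT to its hard
  core: LU at zero-dimensional NON-Abhyankar valuation rings (Kuhlmann's defect / rank-deficient
  places).
  §6 TARGETS — the registered skeleton `sandwiched-gluing` (5 stubs) and its atom SAND⁺:
  (T1) `resolutionInChar_of_sandNoReg` (drop the regular roof ⇒ the atom is the strong summit),
  (T2) `resolutionInChar_of_sandNoBir` (drop birationality ⇒ idem), (T3) `sand_of_strong` (atom ⇐
  strong summit: consistent, irrefutable short of a counterexample to strong resolution); typing
  traps to check once the skeleton text is published (Nagata: separated + finite type + qcqs;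
  FibreStrongResolution: excellence via `EssFiniteType`; ProperPatching: proper vs projective).
  §7 regimes tried in gen 3.

* GEN 4 (2026-08-16, this generation):
  §8 NO SLACK IN THE LINE'S UPPER CUTS (all proved, over the lead's landed `ProperModel`
  infrastructure): (N1)–(N3) each of `ProperModel.TwoModelPatching p`, `RegLeification p`,
  `LocalRegLeification p` FOLLOWS from `ResolutionInChar p` (resolve the join / the source: a
  regular model is `RegLe` over anything) — landing as
  `Literature/…/ProperModelsPatchingOfResolution.lean`, ACCEPTED p74278; (N4)/(N4′)
  `RegLeification ⇔ TwoModelPatching` outright (join twice / uniqueness of domination); hence (N5)–(N7) THE CRUX IS EQUIVALENT TO EACH OF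
  `∀ p prime, LUrel_p → TwoModelPatching_p`, `∀ p prime, LUrel_p → RegLeification_p` and (modulo
  the line's stub S2) `∀ p prime, LUrel_p → LocalRegLeification_p`, and
  `Res_p ↔ TwoModelPatching_p ∧ LUrel_p` (N8): the reduction to two-model patching loses
  nothing, so none of the line's stubs S1–S5 can be refuted without refuting the summit slice;
  the ONLY place where the line asks for more than the crux gives back is the atom SAND⁺
  (strong = iso-over-`Reg` resolution of the sandwiched class; `Strong_p ⇒ SAND⁺_p` by (T3), but
  `Res_p ⇒ SAND⁺_p` is not formal: weak ⇒ strong needs elimination of indeterminacies over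
  `Reg V`, i.e. principalization on regular varieties, open in dimension `≥ 4`).
  (H9) `not_lurelNoRFG` (§2): finite generation of the PRESCRIBED algebra `R` is load-bearing for
  the antecedent exactly like (H3) (`R = K` at the trivial valuation of `𝔽_p(X)` would make
  `𝔽_p(X)` a finitely generated `𝔽_p`-algebra, contradicting Zariski's lemma), so the crux with
  that antecedent is again VACUOUSLY true (`patchingRelNoRFG_holds`) — a second trap; landed as
  `Theorems/PatchingRel/Negative/LUrelWithoutRFG.lean` (`not_lurel_without_rfg`, ACCEPTED p74682).
  (T4) NEW `sandDimLe3_of_cossartPiltant` (§6): the atom holds for `dim V ≤ 3` in every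
  characteristic modulo the named facts `CossartPiltant2019General` + `Stacks07QW_field` (its open
  content is exactly `dim V ≥ 4`).
  §6: the atom SAND⁺ is now the Literature definition `SandwichedStrongResolution`
  (`ProperModelsPatching.lean`, definitionally the gen-3 copy), so (T1)–(T3) apply to the
  registered stub `stub_sandwichedStrongResolution` verbatim. §9: regimes tried in gen 4.

* GEN 5 (2026-08-16, this generation):
  §10 (H11) `lurel_free_trdeg_le_three`, `lurelTrdegGe4_iff`, `resDimGe4_iff`,
  `patchingRel_iff_highDim` — modulo the named fact `CossartPiltant2019` BOTH ends of the crux are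
  free up to dimension three, so the crux is EQUIVALENT to its slice "LU in transcendence degree
  `≥ 4` ⇒ resolution in dimension `≥ 4`" (the dimension-`≤ 3` theorems give no leverage).
  §11 (T5) `sand_blowup`, (T5′) `sand_principalization_shape` — WHY THE ATOM RESISTS: SAND⁺
  contains the strong resolution of every blow-up of a regular variety (hence Piltant's Axiom 4
  on regular varieties in all dimensions); the chart `x₁ᵖ t = g(x₂,…,x_{n+1})` of
  `Bl_{(x₁ᵖ, g)} 𝔸ⁿ⁺¹` carries the Frobenius-twisted pencil of the purely inseparable germ
  `wᵖ = g` — in dimension 4 the atom must strongly resolve fourfolds fibred in arbitrary Zariski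
  threefold germs (beyond Cossart–Piltant 2019), and in dimension `n + 1` it dominates, germ by
  germ, the local crux `LuAlphaPTorsor` of dimension `n`. The sandwiched class is globally
  special (ruled exceptional divisors) but locally wild. (T6)
  `sandwichedStrongResolution_of_not_proper`, `sandNoProper_iff` — `IsProper η` is NOT
  load-bearing (modulo Nagata): the atom ⇔ its form for separated finite-type birational `η`
  (contrast (T1)/(T2)); landing as `Literature/…/SandwichedNonProper.lean`.
  (T5b) `ker_chartEval`, `ker_chartEval_twistedPencil` — the chart presentation
  `R[b/a] ≅ R[X]/(aX − b)` for a regular pair (Stacks 0BIQ, PROVED by degree induction; landing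
  as `Literature/…/BlowupChartPair.lean`), making the twisted-pencil chart claim formal at ring
  level.
  §13 (N10) `res_iff_tmp_and_oneRegModel` — `Res_p ⟺ TwoModelPatching_p ∧ OneRegModel_p`
  (Zariski's "one nonsingular model per function field"; no LU anywhere), (N11)
  `oneRegModel_of_lurel_of_tmp` — given patching, LU is consumed exactly once, to manufacture
  the regular model; landing as `Literature/…/ProperModelsRegModel.lean`.
  §12 Piltant 2013 read at page level: the axiomatic patching theorem is a transcendence-degree-3
  framework (Axiom 3, Lemma 5.3, Step 4 are surface theory); Axiom 5 is ABSOLUTE WEAK LU, so the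
  planner's question "does patching consume embedded LU?" is answered NO — embeddedness enters
  only through Axiom 4 (principalization in the regular model); keep the crux as typed.
  Regimes tried and literature (searchd rc 75; zbMATH sweep 2020–26: Teissier 2023 names the
  patching step as his open Problem C; Temkin 2024: dimension 3 "the deepest case established").
  LANDED this generation: `Theorems/PatchingRel/Negative/HighDimSlice.lean` (p76190 ACCEPTED:
  `lurel_trdeg_le_three`, `lurelTrdegGe4_iff`, `resDimGe4_iff`, `patchingRel_iff_highDim`);
  `Literature/AlgebraicGeometry/Resolution/SandwichedBlowups.lean` (p76727 ACCEPTED: (T5)/(T5′) as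
  `sandwichedStrongResolution_blowup` / `sandwichedStrongResolution_principalization`).
  PROPOSED (verdicts pending at 04:15Z): p78569 `Literature/…/SandwichedNonProper.lean` (T6),
  p78576 `Literature/…/ProperModelsRegModel.lean` (N10/N11, `ProperModel.RegModel`),
  p78577 `Literature/…/BlowupChartPair.lean` (T5b, Stacks 0BIQ for pairs).

* GEN 6 (2026-08-16, this generation): §14 THE RESHAPED ATOM. The gen-1 lead replaces the
  strong atom SAND⁺ by the WEAK atom SANDʷ (weak resolution of varieties with sandwiched
  singular locus) + S3′ (`SANDʷ ⇒ LocalRegLeification`, no gluing). Proved here (rc0, 0 sorry):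
  (W1) `Res_p ⇒ SANDʷ_p` (irrefutable short of `¬ Res_p`); (W2a–c) each of SANDʷ's three
  structural hypotheses dropped ALONE gives `Res_p` verbatim (load-bearing for the cut, not for
  truth); (W3) **costume theorem `Nagata → TwoModelPatching_p → SANDʷ_p`** (no LU: patch the
  compactifications of `X` and of the regular base `U`; ~170 lines over the `ProperModel` API);
  (N12) `LocalRegLeification_p ↔ TwoModelPatching_p ↔ RegLeification_p` mod Nagata; hence (W4)
  **`SANDʷ_p ↔ TwoModelPatching_p` mod Nagata + S3′** — the new atom IS Piltant's two-model
  patching problem (open in dim `≥ 4` since Zariski 1944) in geometric dress; SAND⁺ ⇒ SANDʷ;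
  the reshaped line has no slack (`PatchingRel ↔ ∀ p, LUrel_p → SANDʷ_p`,
  `Res_p ↔ SANDʷ_p ∧ LUrel_p`) and no gain over §13 (`Res_p ↔ SANDʷ_p ∧ RegModel_p`); (W5) its
  dim-`≤ 3` case is the weak fact `CossartPiltant2019` verbatim; (W6) THE LEAD'S STUB S3′
  `SANDʷ_p → LocalRegLeification_p` PROVED here (no gluing), so (W6′) `SANDʷ_p ↔
  TwoModelPatching_p` modulo Nagata ALONE. PROPOSED this generation:
  `Literature/AlgebraicGeometry/Resolution/SandwichedWeakPatching.lean` (def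
  `SandwichedWeakResolution`, `ProperModel.ofChart`, `exists_integral_compactification`,
  `sandwichedWeakResolution_of_twoModelPatching`, `ProperModel.localRegLeification_iff_twoModelPatching`,
  `ProperModel.localRegLeification_of_sandwichedWeakResolution` (= S3′),
  `sandwichedWeakResolution_iff_twoModelPatching` (mod Nagata alone),
  `…_of_sandwichedStrongResolution`) and
  `Theorems/PatchingRel/Negative/SandwichedWeakMutations.lean` ((W2a–c),
  `resolutionInChar_of_proper`).

Verdict (gen 6): RESISTS; not misstated; the reshaped atom SANDʷ is irrefutable short of
`¬ Res_p` (W1) and is EXACTLY Piltant's two-model patching modulo Nagata (W3 + W6); its stub S3′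
is a theorem (W6); a kill of the crux still needs `LU_p ∧ ¬ Res_p` (§1).

Verdict (gen 5): RESISTS; not misstated; `¬ crux` is summit-hard (§1, now sharpened to the
dimension-`≥ 4` slice, §10); the line's atom is irrefutable short of a counterexample to strong
resolution and is locally as hard as resolution of twisted families of `α_p`-torsor germs (§11).

Verdict (gen 4): RESISTS; not misstated; `¬ crux` is summit-hard (§1) and the picked line is
tight above its atom (§8).

Verdict (gen 3): RESISTS; not misstated (no missing side condition found after (H1)–(H8),
(C1)–(C4)); `¬ crux` is summit-hard; the picked line's atom is consistent with the strong summit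
and both of its structural hypotheses are load-bearing.
-/

set_option linter.dupNamespace false

namespace Summit.ResolutionOfSingularities.ResolutionOfSingularities.Cruxes.PatchingRel.Disproof

open Literature.AlgebraicGeometry.Resolution
open Summit.ResolutionOfSingularities.ResolutionOfSingularities.Theses
open CategoryTheory

universe u

/-! ## §0 The crux, unfolded -/

/-- `LUrel_p`: relative Zariski local uniformization in characteristic `p` (the antecedent of the
crux, verbatim). -/
def LUrel (p : ℕ) : Prop :=
  ∀ (k K : Type) [Field k] [CharP k p] [Field K] [Algebra k K], (⊤ : IntermediateField k K).FG →
    ∀ O : ValuationSubring K, (∀ c : k, algebraMap k K c ∈ O) → ∀ R : Subalgebra k K, R.FG →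
      R.toSubring ≤ O.toSubring → ∃ (A : Subalgebra k K) (h : A.toSubring ≤ O.toSubring),
        R ≤ A ∧ A.FG ∧ IsFractionRing A K ∧ IsRegularLocalRing (Localization.AtPrime
          (Ideal.comap (Subring.inclusion h) (IsLocalRing.maximalIdeal O)))

/-- The crux is `∀ p prime, LUrel_p → ResolutionInChar p` (definitional). -/
theorem patchingRel_iff :
    Valuative.PatchingRel ↔ ∀ p : ℕ, p.Prime → LUrel p → ResolutionInChar.{0} p := Iff.rfl

/-- The `CyclicCovers` copy of the crux is the same term. -/
theorem cyclicCovers_patchingRel_iff : CyclicCovers.PatchingRel ↔ Valuative.PatchingRel := Iff.rfl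

/-! ## §1 Logical position: why the crux resists refutation -/

/-- `Res_p → LUrel_p` (tree theorem `lurel_of_resolutionInChar`, folklore via the valuative
criterion): the converse of the crux holds, so the crux makes `LUrel_p ↔ Res_p`. -/
theorem lurel_of_res (p : ℕ) (hp : p.Prime) (h : ResolutionInChar.{0} p) : LUrel p :=
  lurel_of_resolutionInChar p hp h

/-- **Why it resists**: a refutation of the crux is exactly a prime `p` at which local
uniformization HOLDS and resolution FAILS. -/
theorem not_patchingRel_iff :
    ¬ Valuative.PatchingRel ↔ ∃ p : ℕ, p.Prime ∧ LUrel p ∧ ¬ ResolutionInChar.{0} p := by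
  constructor
  · intro h
    by_contra h'
    exact h fun p hp hLU => by_contra fun hR => h' ⟨p, hp, hLU, hR⟩
  · rintro ⟨p, hp, hLU, hR⟩ h
    exact hR (h p hp hLU)

/-- The summit is `(∀ p prime, LUrel_p) ∧ PatchingRel`: the crux is the exact complement of local
uniformization inside the summit. -/
theorem summit_iff :
    _root_.ResolutionOfSingularities ↔ (∀ p : ℕ, p.Prime → LUrel p) ∧ Valuative.PatchingRel :=
  ⟨fun h => ⟨fun p hp => lurel_of_res p hp (h p hp), fun p hp _ => h p hp⟩,
    fun ⟨hLU, hP⟩ p hp => hP p hp (hLU p hp)⟩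

/-- In particular the crux follows from the summit (it is not stronger than the problem). -/
theorem patchingRel_of_summit (h : _root_.ResolutionOfSingularities) : Valuative.PatchingRel :=
  (summit_iff.mp h).2

/-- Under local uniformization (believed in every characteristic; a theorem in dimension `≤ 3`)
the crux IS the summit: nothing weaker than resolution in characteristic `p` discharges it. -/
theorem patchingRel_iff_summit_of_lurel (hLU : ∀ p : ℕ, p.Prime → LUrel p) :
    Valuative.PatchingRel ↔ _root_.ResolutionOfSingularities :=
  ⟨fun h => summit_iff.mpr ⟨hLU, h⟩, patchingRel_of_summit⟩

/-! ## §2 Load-bearing analysis of the antecedent -/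

/-- (H1) The crux over ALL characteristics `p : ℕ` (primality dropped). -/
def PatchingRelAllChar : Prop := ∀ p : ℕ, LUrel p → ResolutionInChar.{0} p

/-- (H1) `p.Prime` is not load-bearing: composite non-zero `p` admits no field of characteristic
`p` (both sides vacuous), and `p = 0` is Hironaka's theorem (named fact `Hironaka1964`). -/
theorem patchingRelAllChar_iff (h0 : Hironaka1964.{0}) :
    PatchingRelAllChar ↔ Valuative.PatchingRel := by
  refine ⟨fun h p _ => h p, fun h p hLU => ?_⟩
  by_cases hp : p.Prime
  · exact h p hp hLU
  · rcases Nat.eq_zero_or_pos p with rfl | hpos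
    · exact h0
    · intro k _ _ X f _ _ _ _
      exfalso
      rcases CharP.char_is_prime_or_zero k p with h' | h'
      · exact hp h'
      · omega

/-- (H2) The antecedent with the hypothesis `k ⊆ O` dropped. -/
def LUrelNoConst (p : ℕ) : Prop :=
  ∀ (k K : Type) [Field k] [CharP k p] [Field K] [Algebra k K], (⊤ : IntermediateField k K).FG →
    ∀ O : ValuationSubring K, ∀ R : Subalgebra k K, R.FG →
      R.toSubring ≤ O.toSubring → ∃ (A : Subalgebra k K) (h : A.toSubring ≤ O.toSubring),
        R ≤ A ∧ A.FG ∧ IsFractionRing A K ∧ IsRegularLocalRing (Localization.AtPrime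
          (Ideal.comap (Subring.inclusion h) (IsLocalRing.maximalIdeal O)))

/-- (H2) `k ⊆ O` is redundant: it follows from `R ⊆ O` since `R` is a `k`-subalgebra. -/
theorem lurelNoConst_iff (p : ℕ) : LUrelNoConst p ↔ LUrel p :=
  ⟨fun h k K _ _ _ _ hfg O _ R hR hRO => h k K hfg O R hR hRO,
    fun h k K _ _ _ _ hfg O R hR hRO => h k K hfg O (fun c => hRO (R.algebraMap_mem c)) R hR hRO⟩

/-- (H3) The antecedent with finite generation of `K/k` dropped. -/
def LUrelNoFG (p : ℕ) : Prop :=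
  ∀ (k K : Type) [Field k] [CharP k p] [Field K] [Algebra k K],
    ∀ O : ValuationSubring K, (∀ c : k, algebraMap k K c ∈ O) → ∀ R : Subalgebra k K, R.FG →
      R.toSubring ≤ O.toSubring → ∃ (A : Subalgebra k K) (h : A.toSubring ≤ O.toSubring),
        R ≤ A ∧ A.FG ∧ IsFractionRing A K ∧ IsRegularLocalRing (Localization.AtPrime
          (Ideal.comap (Subring.inclusion h) (IsLocalRing.maximalIdeal O)))

/-- (H3) Without finite generation the antecedent is FALSE (`𝔽_p^alg / 𝔽_p` has no affine
model; tree theorem `not_lurel_without_fg`, gen 1) … -/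
theorem not_lurelNoFG (p : ℕ) (hp : p.Prime) : ¬ LUrelNoFG p := by
  haveI : Fact p.Prime := ⟨hp⟩
  exact not_lurel_without_fg p

/-- (H3) … so the crux with that antecedent is VACUOUSLY true — a trap: it proves nothing about
resolution. -/
theorem patchingRelNoFG_holds : ∀ p : ℕ, p.Prime → LUrelNoFG p → ResolutionInChar.{0} p :=
  fun p hp h => absurd h (not_lurelNoFG p hp)

/-- (H4) The antecedent with `IsFractionRing A K` dropped from its conclusion. -/
def LUrelNoFrac (p : ℕ) : Prop :=
  ∀ (k K : Type) [Field k] [CharP k p] [Field K] [Algebra k K], (⊤ : IntermediateField k K).FG →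
    ∀ O : ValuationSubring K, (∀ c : k, algebraMap k K c ∈ O) → ∀ R : Subalgebra k K, R.FG →
      R.toSubring ≤ O.toSubring → ∃ (A : Subalgebra k K) (h : A.toSubring ≤ O.toSubring),
        R ≤ A ∧ A.FG ∧ IsRegularLocalRing (Localization.AtPrime
          (Ideal.comap (Subring.inclusion h) (IsLocalRing.maximalIdeal O)))

/-- (H4) **`IsFractionRing A K` is redundant** in the antecedent: enlarge the prescribed `R` by an
affine model `A₀ ⊆ O` of `K` (`exists_affineModel`) before uniformizing; any `A ⊇ R ⊔ A₀` has
fraction field `K` (`isFractionRing_of_le`). So provers may ignore that conjunct when USING the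
antecedent and need not establish it when PROVING instances. -/
theorem lurelNoFrac_iff (p : ℕ) : LUrelNoFrac p ↔ LUrel p := by
  refine ⟨fun h k K _ _ _ _ hKfg O hO R hRfg hRO => ?_,
    fun h k K _ _ _ _ hKfg O hO R hRfg hRO => ?_⟩
  · obtain ⟨A₀, hA₀O, hA₀fg, hA₀fr⟩ := exists_affineModel k K hKfg O hO
    have hR'O : (R ⊔ A₀).toSubring ≤ O.toSubring := by
      let Oalg : Subalgebra k K := { O.toSubring with algebraMap_mem' := hO }
      change R ⊔ A₀ ≤ Oalg
      exact sup_le (fun x hx => hRO hx) (fun x hx => hA₀O hx)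
    have hR'fr : IsFractionRing ↥(R ⊔ A₀) K := isFractionRing_of_le le_sup_right hA₀fr
    obtain ⟨A, hA, hle, hAfg, hreg⟩ := h k K hKfg O hO (R ⊔ A₀) (hRfg.sup hA₀fg) hR'O
    exact ⟨A, hA, le_sup_left.trans hle, hAfg, isFractionRing_of_le hle hR'fr, hreg⟩
  · obtain ⟨A, hA, hle, hAfg, -, hreg⟩ := h k K hKfg O hO R hRfg hRO
    exact ⟨A, hA, hle, hAfg, hreg⟩

/-- (H5) Dropping relativity (`R ≤ A`) gives the ABSOLUTE antecedent `LU_p` of the superseded crux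
`Patching` (stmt-0561); `LUrel_p → LU_p` (take `R = ⊥`), so `Patching → PatchingRel`: the
absolute crux is the STRONGER statement, and both reduce to two-model patching (§4;
`resolutionInChar_of_twoModelPatching_of_lu` for the absolute one). -/
theorem patchingRel_of_patching (h : Valuative.Patching) : Valuative.PatchingRel := by
  intro p hp hLU
  refine h p hp fun k K _ _ _ _ hKfg O hO => ?_
  obtain ⟨A, hA, -, hAfg, hfr, hreg⟩ := hLU k K hKfg O hO ⊥ Subalgebra.fg_bot
    (fun x hx => by
      obtain ⟨c, rfl⟩ := Algebra.mem_bot.mp hx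
      exact hO c)
  exact ⟨A, hA, hAfg, hfr, hreg⟩

/-- (H6) The antecedent with REGULARITY AT THE CENTRE dropped. -/
def LUrelNoReg (p : ℕ) : Prop :=
  ∀ (k K : Type) [Field k] [CharP k p] [Field K] [Algebra k K], (⊤ : IntermediateField k K).FG →
    ∀ O : ValuationSubring K, (∀ c : k, algebraMap k K c ∈ O) → ∀ R : Subalgebra k K, R.FG →
      R.toSubring ≤ O.toSubring → ∃ (A : Subalgebra k K) (_ : A.toSubring ≤ O.toSubring),
        R ≤ A ∧ A.FG ∧ IsFractionRing A K

/-- (H6) Without regularity the antecedent is a triviality (`A = R ⊔ A₀`, `A₀` an affine model of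
`K` inside `O`) … -/
theorem lurelNoReg_holds (p : ℕ) : LUrelNoReg p := by
  intro k K _ _ _ _ hKfg O hO R hRfg hRO
  obtain ⟨A₀, hA₀O, hA₀fg, hA₀fr⟩ := exists_affineModel k K hKfg O hO
  have hR'O : (R ⊔ A₀).toSubring ≤ O.toSubring := by
    let Oalg : Subalgebra k K := { O.toSubring with algebraMap_mem' := hO }
    change R ⊔ A₀ ≤ Oalg
    exact sup_le (fun x hx => hRO hx) (fun x hx => hA₀O hx)
  exact ⟨R ⊔ A₀, hR'O, le_sup_left, hRfg.sup hA₀fg, isFractionRing_of_le le_sup_right hA₀fr⟩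

/-- (H6) … so the crux with regularity dropped from its antecedent IS the summit: regularity at
the centre is the entire content of the hypothesis. -/
theorem patchingRelNoReg_iff_summit :
    (∀ p : ℕ, p.Prime → LUrelNoReg p → ResolutionInChar.{0} p) ↔ _root_.ResolutionOfSingularities :=
  ⟨fun h p hp => h p hp (lurelNoReg_holds p), fun h p hp _ => h p hp⟩

/-- (H7) **The antecedent is free on valuation rings essentially of finite type** (tree theorem
`lurel_of_essFiniteType`, landed this generation as `LocalUniformizationEssFiniteType.lean`). If
`O` is a localisation of a finitely generated `k`-subalgebra `B ⊆ O` (every element of `O` is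
`b · s⁻¹` with `b, s ∈ B`, `s` a unit of `O` — e.g. `O` DIVISORIAL, or `O = K`), then for every
finitely generated `R ⊆ O` the algebra `A := R ⊔ B` answers `LUrel_p` at `O`: `A` localised at
the centre is `O` itself, a Noetherian valuation ring, hence a discrete valuation ring or a field,
hence regular. So every use of `LUrel_p` at such `O` is provable outright, in every dimension and
characteristic: THE HYPOTHESIS HAS CONTENT ONLY AT VALUATION RINGS THAT ARE NOT ESSENTIALLY OF
FINITE TYPE over `k` (rank `> 1`, non-Abhyankar, or carrying defect) — a proof of the crux that
feeds its hypothesis only divisorial valuations is a proof of `ResolutionInChar p` from nothing. -/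
theorem lurel_free_at_essFiniteType {k K : Type} [Field k] [Field K] [Algebra k K]
    (O : ValuationSubring K) (B : Subalgebra k K) (hBfg : B.FG) (hBO : B.toSubring ≤ O.toSubring)
    (hloc : ∀ x : K, x ∈ O → ∃ b ∈ B, ∃ s ∈ B, s ≠ 0 ∧ s⁻¹ ∈ O ∧ x = b * s⁻¹)
    (R : Subalgebra k K) (hRfg : R.FG) (hRO : R.toSubring ≤ O.toSubring) :
    ∃ (A : Subalgebra k K) (h : A.toSubring ≤ O.toSubring), R ≤ A ∧ A.FG ∧
      IsRegularLocalRing (Localization.AtPrime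
        (Ideal.comap (Subring.inclusion h) (IsLocalRing.maximalIdeal O))) := by
  obtain ⟨A, h, hRA, -, hAfg, hreg⟩ := lurel_of_essFiniteType O B hBfg hBO hloc R hRfg hRO
  exact ⟨A, h, hRA, hAfg, hreg⟩

/-- (H7′) In particular the TRIVIAL valuation `O = K` (the junk model every refuter tries first)
is an instance of (H7) with `B` any affine model of `K`: `LUrel_p` holds at `O = ⊤` with all
conjuncts, uniformly in `p` and the dimension. -/
theorem lurel_at_top {k K : Type} [Field k] [Field K] [Algebra k K]
    (hKfg : (⊤ : IntermediateField k K).FG) (R : Subalgebra k K) (hRfg : R.FG) :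
    ∃ (A : Subalgebra k K) (h : A.toSubring ≤ (⊤ : ValuationSubring K).toSubring), R ≤ A ∧ A.FG ∧
      IsFractionRing A K ∧ IsRegularLocalRing (Localization.AtPrime
        (Ideal.comap (Subring.inclusion h)
          (IsLocalRing.maximalIdeal (⊤ : ValuationSubring K)))) := by
  obtain ⟨A₀, -, hA₀fg, hA₀fr⟩ :=
    exists_affineModel k K hKfg ⊤ (fun c => ValuationSubring.mem_top _)
  have hloc : ∀ x : K, x ∈ (⊤ : ValuationSubring K) → ∃ b ∈ A₀, ∃ s ∈ A₀, s ≠ 0 ∧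
      s⁻¹ ∈ (⊤ : ValuationSubring K) ∧ x = b * s⁻¹ := by
    intro x _
    obtain ⟨a, s, hs, rfl⟩ := IsFractionRing.div_surjective (A := A₀) x
    refine ⟨a, a.2, s, s.2, ?_, ValuationSubring.mem_top _, by rw [div_eq_mul_inv]; rfl⟩
    intro h0
    exact nonZeroDivisors.ne_zero hs (Subtype.ext h0)
  obtain ⟨A, h, hRA, hA₀A, hAfg, hreg⟩ := lurel_of_essFiniteType ⊤ A₀ hA₀fg
    (fun _ _ => ValuationSubring.mem_top _) hloc R hRfg (fun _ _ => ValuationSubring.mem_top _)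
  exact ⟨A, h, hRA, hAfg, isFractionRing_of_le hA₀A hA₀fr, hreg⟩


/-- (H8) The antecedent restricted to valuation rings MINIMAL over the prescribed `R` (the closed
points of the Zariski–Riemann space `Zar(K/R)`: no valuation ring `O' < O` contains `R`). -/
def LUrelMin (p : ℕ) : Prop :=
  ∀ (k K : Type) [Field k] [CharP k p] [Field K] [Algebra k K], (⊤ : IntermediateField k K).FG →
    ∀ O : ValuationSubring K, (∀ c : k, algebraMap k K c ∈ O) → ∀ R : Subalgebra k K, R.FG →
      R.toSubring ≤ O.toSubring →
      (∀ O' : ValuationSubring K, O' ≤ O → R.toSubring ≤ O'.toSubring → O' = O) →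
      ∃ (A : Subalgebra k K) (h : A.toSubring ≤ O.toSubring),
        R ≤ A ∧ A.FG ∧ IsFractionRing A K ∧ IsRegularLocalRing (Localization.AtPrime
          (Ideal.comap (Subring.inclusion h) (IsLocalRing.maximalIdeal O)))

/-- (H8) The antecedent restricted to ZERO-DIMENSIONAL valuation rings (residue field algebraic
over `k`: every `x ∈ O` is a root modulo `𝔪_O` of a non-zero polynomial over `k`) — the closed
points of `Zar(K/k)`, i.e. exactly Cossart–Piltant's (LU) valuations ("`k_v | k` algebraic"). -/
def LUrelZeroDim (p : ℕ) : Prop :=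
  ∀ (k K : Type) [Field k] [CharP k p] [Field K] [Algebra k K], (⊤ : IntermediateField k K).FG →
    ∀ O : ValuationSubring K, (∀ c : k, algebraMap k K c ∈ O) →
      (∀ x ∈ O, ∃ f : Polynomial k, f ≠ 0 ∧ Polynomial.aeval x f ∈ O.nonunits) →
      ∀ R : Subalgebra k K, R.FG → R.toSubring ≤ O.toSubring →
      ∃ (A : Subalgebra k K) (h : A.toSubring ≤ O.toSubring),
        R ≤ A ∧ A.FG ∧ IsFractionRing A K ∧ IsRegularLocalRing (Localization.AtPrime
          (Ideal.comap (Subring.inclusion h) (IsLocalRing.maximalIdeal O)))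

/-- (H8) **NEW (gen 3): LU at closed points of `Zar(K/R)` suffices** — `LUrelMin_p ↔ LUrel_p`:
refine `O` to a valuation ring `O' ≤ O` minimal over `R` (it exists by quasi-compactness of the
Zariski–Riemann space, tree `exists_minimal_valuationSubring_le`), uniformize there, and observe
that regularity at the centre DESCENDS to the coarsening `O` because the centre of `O` on `A` is
a sub-prime of the centre of `O'` (Serre; tree `isRegularLocalRing_centre_of_le`, landed this
generation as `LocalUniformizationClosedPoints.lean`). -/
theorem lurelMin_iff (p : ℕ) : LUrelMin p ↔ LUrel p := by
  refine ⟨fun h k K _ _ _ _ hKfg O hO R hRfg hRO => ?_,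
    fun h k K _ _ _ _ hKfg O hO R hRfg hRO _ => h k K hKfg O hO R hRfg hRO⟩
  obtain ⟨O', hO'O, hRO', hmin⟩ := exists_minimal_valuationSubring_le R O hRO
  obtain ⟨A, hA, hRA, hAfg, hfr, hreg⟩ :=
    h k K hKfg O' (fun c => hRO' (R.algebraMap_mem c)) R hRfg hRO' hmin
  exact ⟨A, fun x hx => hO'O (hA hx), hRA, hAfg, hfr,
    isRegularLocalRing_centre_of_le A hO'O hA _ hreg⟩

/-- (H8) **NEW (gen 3): LU at ZERO-DIMENSIONAL valuations suffices** — `LUrelZeroDim_p ↔ LUrel_p`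
(a valuation ring minimal over the finitely generated `k`-algebra `R` has residue field integral
over the image of `R`, which is then a field finite over `k` by Zariski's lemma: tree
`exists_aeval_mem_nonunits_of_minimal`). So the antecedent has content only at the closed points
of the Zariski–Riemann space; with (H7) (free at valuation rings essentially of finite type),
only at zero-dimensional valuation rings that are NOT essentially of finite type over `k` — for
zero-dimensional `O` "essentially of finite type" forces `O` to be a DVR or `K`, i.e.
`trdeg_k K ≤ 1`: in transcendence degree `≥ 2` every closed point of `Zar(K/k)` carries content
(e.g. the `k((t))`-arcs `x ↦ t, y ↦ ξ(t)` with `ξ` transcendental: rank one, discrete,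
zero-dimensional, rational rank `1 < 2`, the classical non-Abhyankar places where defect lives in
characteristic `p`), except the Abhyankar ones, uniformized by Knaf–Kuhlmann 2005 Thm. 1.1 (tree
`KnafKuhlmann2005_Thm11_holds`, smooth models at Abhyankar places with separable residue
extension — automatic for zero-dimensional places over perfect `k`). -/
theorem lurelZeroDim_iff (p : ℕ) : LUrelZeroDim p ↔ LUrel p := by
  refine ⟨fun h k K _ _ _ _ hKfg O hO R hRfg hRO => ?_,
    fun h k K _ _ _ _ hKfg O hO _ R hRfg hRO => h k K hKfg O hO R hRfg hRO⟩
  obtain ⟨O', hO'O, hRO', hmin⟩ := exists_minimal_valuationSubring_le R O hRO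
  obtain ⟨A, hA, hRA, hAfg, hfr, hreg⟩ := h k K hKfg O' (fun c => hRO' (R.algebraMap_mem c))
    (exists_aeval_mem_nonunits_of_minimal R hRfg O' hRO' hmin) R hRfg hRO'
  exact ⟨A, fun x hx => hO'O (hA hx), hRA, hAfg, hfr,
    isRegularLocalRing_centre_of_le A hO'O hA _ hreg⟩

/-- (H8) Hence the crux with the zero-dimensional antecedent is THE SAME statement (neither a
weakening nor a strengthening): provers may feed the hypothesis only closed points of the
Zariski–Riemann space — which is what the tree's finiteness theorem
`ZariskiRiemannSpace.exists_finite_resolvingSystem` consumes — and conversely nothing is gained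
for a refutation by looking at positive-dimensional valuations. -/
theorem patchingRelZeroDim_iff :
    (∀ p : ℕ, p.Prime → LUrelZeroDim p → ResolutionInChar.{0} p) ↔ Valuative.PatchingRel :=
  ⟨fun h p hp hLU => h p hp ((lurelZeroDim_iff p).mpr hLU),
    fun h p hp hLU => h p hp ((lurelZeroDim_iff p).mp hLU)⟩

/-- (H8) … and likewise with the `R`-minimal antecedent. -/
theorem patchingRelMin_iff :
    (∀ p : ℕ, p.Prime → LUrelMin p → ResolutionInChar.{0} p) ↔ Valuative.PatchingRel :=
  ⟨fun h p hp hLU => h p hp ((lurelMin_iff p).mpr hLU),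
    fun h p hp hLU => h p hp ((lurelMin_iff p).mp hLU)⟩


/-- (H8c) **NEW (gen 3): the antecedent is FREE at ABHYANKAR places** (equality in Abhyankar's
inequality, `IsAbhyankarPlace`; Knaf–Kuhlmann 2005 Thm. 1.1 + Cor. 2.2, PROVED in the tree as
`KnafKuhlmann2005_Thm11_holds` / `KnafKuhlmann2005_Cor22_holds` from the Generalized Stability
Theorem; re-read in the crux's vocabulary and landed this generation as
`LocalUniformizationAbhyankarPlaces.lean`, p72405): over a PERFECT ground field, at every
Abhyankar place `O` of `K/k` every finitely generated `R ⊆ O` is dominated by a finitely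
generated `A ⊆ O` with `Frac A = K`, regular at the centre. (For imperfect `k` the same holds
when `κ(O) | k` is separably generated: tree `relLU_at_abhyankarPlace`.) -/
theorem lurel_free_at_abhyankarPlace {k K : Type} [Field k] [PerfectField k] [Field K]
    [Algebra k K] (hKfg : (⊤ : IntermediateField k K).FG) (O : ValuationSubring K)
    (hO : ∀ c : k, algebraMap k K c ∈ O)
    (hAbh : IsAbhyankarPlace O (algebraMap k K).fieldRange ⊤)
    (R : Subalgebra k K) (hRfg : R.FG) (hRO : R.toSubring ≤ O.toSubring) :
    ∃ (A : Subalgebra k K) (h : A.toSubring ≤ O.toSubring), R ≤ A ∧ A.FG ∧ IsFractionRing A K ∧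
      IsRegularLocalRing (Localization.AtPrime
        (Ideal.comap (Subring.inclusion h) (IsLocalRing.maximalIdeal O))) := by
  -- proof = tree `relLU_at_abhyankarPlace_of_perfectField` (inlined so that this work file
  -- elaborates before the farm snapshot contains the newly landed module)
  classical
  set K₀ : Subfield K := (algebraMap k K).fieldRange with hK₀
  haveI : PerfectField K₀ := PerfectField.of_ringEquiv (algebraMap k K).rangeRestrictFieldEquiv
  have hK₀O : (K₀ : Set K) ⊆ O := by
    rintro x ⟨c, rfl⟩
    exact hO c
  have hfg : FGOver K₀ (⊤ : Subfield K) := by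
    obtain ⟨s, hs⟩ := hKfg
    refine ⟨s, ?_⟩
    have h1 : (IntermediateField.adjoin k (s : Set K)).toSubfield =
        Subfield.closure (Set.range (algebraMap k K) ∪ (s : Set K)) := rfl
    rw [RingHom.coe_fieldRange, ← h1, hs]
    rfl
  obtain ⟨t, ht⟩ := hRfg
  have htR : (t : Set K) ⊆ R := ht ▸ Algebra.subset_adjoin
  have hZ : ∀ z ∈ t, z ∈ O ∧ z ∈ (⊤ : Subfield K) := fun z hz => ⟨hRO (htR hz), trivial⟩
  obtain ⟨-, hresfg⟩ := KnafKuhlmann2005_Cor22_holds K O K₀ ⊤ le_top hfg hAbh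
  haveI : PerfectField (resField O K₀) := perfectField_resField hK₀O
  have hsep : SeparablyGeneratedOver (resField O K₀) (resField O ⊤) :=
    separablyGeneratedOver_of_perfectField hresfg
  have hSU : IsSmoothlyUniformizableIn K₀ O (⊤ : Subfield K) (t : Set K) :=
    KnafKuhlmann2005_Thm11_holds K O K₀ ⊤ le_top hfg hK₀O hAbh hsep t hZ
  obtain ⟨B, hBO, -, hBfg, hBsm, -, htB, hfrac⟩ :=
    exists_normal_smooth_model Grothendieck1967_17_5_8_holds Matsumura1987_19_4_holds hSU
  haveI := hBsm
  haveI : Algebra.FiniteType K₀ B := (Subalgebra.fg_iff_finiteType B).mp hBfg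
  let A : Subalgebra k K :=
    { B.toSubring.toSubsemiring with
      algebraMap_mem' := fun c => B.algebraMap_mem (⟨algebraMap k K c, c, rfl⟩ : K₀) }
  refine ⟨A, hBO, ?_, ?_, ?_, ?_⟩
  · rw [← ht]
    exact Algebra.adjoin_le fun z hz => htB hz
  · obtain ⟨t₂, ht₂⟩ := hBfg
    refine ⟨t₂, le_antisymm (Algebra.adjoin_le fun x hx => ?_) fun x hx => ?_⟩
    · change x ∈ B
      rw [← ht₂]
      exact Algebra.subset_adjoin hx
    · let T : Subalgebra K₀ K :=
        { (Algebra.adjoin k (t₂ : Set K)).toSubring.toSubsemiring with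
          algebraMap_mem' := fun c => by
            obtain ⟨c', hc'⟩ := c.2
            change (c : K) ∈ Algebra.adjoin k (t₂ : Set K)
            rw [← hc']
            exact (Algebra.adjoin k (t₂ : Set K)).algebraMap_mem c' }
      have hBT : B ≤ T := by
        rw [← ht₂]
        exact Algebra.adjoin_le fun y hy => (Algebra.subset_adjoin hy : y ∈ Algebra.adjoin k _)
      exact hBT hx
  · exact isFractionRing_of_forall_exists_div A.toSubring fun z => hfrac z trivial
  · exact Grothendieck1967_17_5_8.of_field Grothendieck1967_17_5_8_holds K₀ B
      (centre B O hBO) (isSmoothAt_of_formallySmooth _)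

/-- (H8c) The antecedent over PERFECT ground fields of characteristic `p` (a slice of `LUrel_p`). -/
def LUrelPerfect (p : ℕ) : Prop :=
  ∀ (k K : Type) [Field k] [CharP k p] [PerfectField k] [Field K] [Algebra k K],
    (⊤ : IntermediateField k K).FG →
    ∀ O : ValuationSubring K, (∀ c : k, algebraMap k K c ∈ O) → ∀ R : Subalgebra k K, R.FG →
      R.toSubring ≤ O.toSubring → ∃ (A : Subalgebra k K) (h : A.toSubring ≤ O.toSubring),
        R ≤ A ∧ A.FG ∧ IsFractionRing A K ∧ IsRegularLocalRing (Localization.AtPrime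
          (Ideal.comap (Subring.inclusion h) (IsLocalRing.maximalIdeal O)))

/-- (H8c) The HARD CORE of the antecedent over perfect ground fields: LU demanded only at
valuation rings that are ZERO-DIMENSIONAL (closed points of `Zar(K/k)`) and NOT Abhyankar places
(positive defect in Abhyankar's inequality: `trdeg K/k > rr(vK) + trdeg κ(O)/k`). -/
def LUrelPerfectHard (p : ℕ) : Prop :=
  ∀ (k K : Type) [Field k] [CharP k p] [PerfectField k] [Field K] [Algebra k K],
    (⊤ : IntermediateField k K).FG →
    ∀ O : ValuationSubring K, (∀ c : k, algebraMap k K c ∈ O) →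
      (∀ x ∈ O, ∃ f : Polynomial k, f ≠ 0 ∧ Polynomial.aeval x f ∈ O.nonunits) →
      ¬ IsAbhyankarPlace O (algebraMap k K).fieldRange ⊤ →
      ∀ R : Subalgebra k K, R.FG → R.toSubring ≤ O.toSubring →
      ∃ (A : Subalgebra k K) (h : A.toSubring ≤ O.toSubring),
        R ≤ A ∧ A.FG ∧ IsFractionRing A K ∧ IsRegularLocalRing (Localization.AtPrime
          (Ideal.comap (Subring.inclusion h) (IsLocalRing.maximalIdeal O)))

/-- (H8c) **Over perfect ground fields the antecedent is equivalent to its hard core**: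
`LUrelPerfectHard_p ↔ LUrelPerfect_p` — refine to a closed point below `O` ((H8)); if it is an
Abhyankar place it is uniformized for free (Knaf–Kuhlmann), otherwise by hypothesis; descend by
Serre. So a proof of the crux may assume its hypothesis is being fed exactly Kuhlmann's defect /
rank-deficient zero-dimensional valuations, and a refutation would have to prove LU precisely
there. -/
theorem lurelPerfectHard_iff (p : ℕ) : LUrelPerfectHard p ↔ LUrelPerfect p := by
  refine ⟨fun h k K _ _ _ _ _ hKfg O hO R hRfg hRO => ?_,
    fun h k K _ _ _ _ _ hKfg O hO _ _ R hRfg hRO => h k K hKfg O hO R hRfg hRO⟩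
  obtain ⟨O', hO'O, hRO', hmin⟩ := exists_minimal_valuationSubring_le R O hRO
  have hO' : ∀ c : k, algebraMap k K c ∈ O' := fun c => hRO' (R.algebraMap_mem c)
  by_cases hAbh : IsAbhyankarPlace O' (algebraMap k K).fieldRange ⊤
  · obtain ⟨A, hA, hRA, hAfg, hfr, hreg⟩ :=
      lurel_free_at_abhyankarPlace hKfg O' hO' hAbh R hRfg hRO'
    exact ⟨A, fun x hx => hO'O (hA hx), hRA, hAfg, hfr,
      isRegularLocalRing_centre_of_le A hO'O hA _ hreg⟩
  · obtain ⟨A, hA, hRA, hAfg, hfr, hreg⟩ := h k K hKfg O' hO'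
      (exists_aeval_mem_nonunits_of_minimal R hRfg O' hRO' hmin) hAbh R hRfg hRO'
    exact ⟨A, fun x hx => hO'O (hA hx), hRA, hAfg, hfr,
      isRegularLocalRing_centre_of_le A hO'O hA _ hreg⟩

/-- (H8c) `LUrel_p` contains its perfect-field slice. -/
theorem lurelPerfect_of_lurel (p : ℕ) (h : LUrel p) : LUrelPerfect p :=
  fun k K _ _ _ _ _ hKfg O hO R hRfg hRO => h k K hKfg O hO R hRfg hRO

/-- (H8c) Hence the crux restricted to perfect ground fields in its antecedent —
`∀ p prime, LUrelPerfectHard_p → ResolutionInChar p` — is a STRONGER statement than the crux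
(weaker antecedent: LU only over perfect `k`, only at the hard core); the crux itself follows
from it. (Whether LU over perfect fields implies LU over all fields of characteristic `p` is not
known to be formal: imperfect ground fields are where Temkin's inseparable local uniformization
lives.) -/
theorem patchingRel_of_perfectHard
    (h : ∀ p : ℕ, p.Prime → LUrelPerfectHard p → ResolutionInChar.{0} p) : Valuative.PatchingRel :=
  fun p hp hLU => h p hp ((lurelPerfectHard_iff p).mpr (lurelPerfect_of_lurel p hLU))

/-- (H9) The antecedent with finite generation of the PRESCRIBED algebra `R` dropped (any
`k`-subalgebra `R ⊆ O` must be dominated by a finitely generated regular `A ⊆ O`). -/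
def LUrelNoRFG (p : ℕ) : Prop :=
  ∀ (k K : Type) [Field k] [CharP k p] [Field K] [Algebra k K], (⊤ : IntermediateField k K).FG →
    ∀ O : ValuationSubring K, (∀ c : k, algebraMap k K c ∈ O) → ∀ R : Subalgebra k K,
      R.toSubring ≤ O.toSubring → ∃ (A : Subalgebra k K) (h : A.toSubring ≤ O.toSubring),
        R ≤ A ∧ A.FG ∧ IsFractionRing A K ∧ IsRegularLocalRing (Localization.AtPrime
          (Ideal.comap (Subring.inclusion h) (IsLocalRing.maximalIdeal O)))

/-- (H9) **NEW (gen 4): `R.FG` is load-bearing for the antecedent** — without it the antecedent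
is FALSE in every prime characteristic: at the trivial valuation `O = K` of `K = 𝔽_p(X)` take
`R = K`; a finitely generated `A ⊇ K` makes `K` a finitely generated `𝔽_p`-algebra, hence finite
over `𝔽_p` (Zariski's lemma, `finite_of_finite_type_of_isJacobsonRing`), contradicting the
transcendence of `X` … -/
theorem not_lurelNoRFG (p : ℕ) (hp : p.Prime) : ¬ LUrelNoRFG p := by
  intro h
  haveI : Fact p.Prime := ⟨hp⟩
  obtain ⟨A, -, hle, hAfg, -, -⟩ := h (ZMod p) (FractionRing (Polynomial (ZMod p)))
    (IntermediateField.fg_top_iff.mpr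
      (Algebra.EssFiniteType.comp (ZMod p) (Polynomial (ZMod p)) _))
    ⊤ (fun _ => ValuationSubring.mem_top _) ⊤ (fun _ _ => ValuationSubring.mem_top _)
  have htop : (⊤ : Subalgebra (ZMod p) (FractionRing (Polynomial (ZMod p)))).FG := by
    rwa [← eq_top_iff.mpr hle]
  haveI : Algebra.FiniteType (ZMod p) (FractionRing (Polynomial (ZMod p))) := ⟨htop⟩
  haveI : Module.Finite (ZMod p) (FractionRing (Polynomial (ZMod p))) :=
    finite_of_finite_type_of_isJacobsonRing (ZMod p) _
  have hT : Transcendental (ZMod p)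
      (algebraMap (Polynomial (ZMod p)) (FractionRing (Polynomial (ZMod p))) Polynomial.X) :=
    (transcendental_algebraMap_iff (IsFractionRing.injective (Polynomial (ZMod p)) _)).mpr
      (Polynomial.transcendental_X (ZMod p))
  exact hT (Algebra.IsAlgebraic.isAlgebraic _)

/-- (H9) … so, exactly as for (H3), the crux with that antecedent is VACUOUSLY true — a second
trap: both finiteness hypotheses of the antecedent (`K/k` finitely generated, `R` finitely
generated) are what make it satisfiable at all. -/
theorem patchingRelNoRFG_holds : ∀ p : ℕ, p.Prime → LUrelNoRFG p → ResolutionInChar.{0} p :=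
  fun p hp h => absurd h (not_lurelNoRFG p hp)

/-! ## §3 Consequent mutations: natural strengthenings refuted -/

/-- (C1) `ResolutionInChar p` with `IsReduced X` dropped. -/
def ResNoReduced (p : ℕ) : Prop :=
  ∀ (k : Type) [Field k] [CharP k p] (X : AlgebraicGeometry.Scheme.{0})
    (f : X ⟶ AlgebraicGeometry.Spec (.of k)), AlgebraicGeometry.IsSeparated f →
      AlgebraicGeometry.LocallyOfFiniteType f → AlgebraicGeometry.QuasiCompact f →
        Scheme.HasResolution X

/-- (C1) `ResNoReduced p` is false for every prime (`Spec 𝔽_p[ε]`; tree, gen 1) … -/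
theorem not_resNoReduced (p : ℕ) (hp : p.Prime) : ¬ ResNoReduced p := by
  haveI : Fact p.Prime := ⟨hp⟩
  exact not_resolutionInChar_without_isReduced p

/-- (C1) … so the crux with the non-reduced consequent is equivalent to the failure of local
uniformization in EVERY prime characteristic: refutable exactly when some `LUrel_p` is provable
(e.g. it is refuted in "dimension ≤ 3 form"; as typed, `LUrel_p` for all dimensions is open). -/
theorem patchingRelNoReduced_iff :
    (∀ p : ℕ, p.Prime → LUrel p → ResNoReduced p) ↔ ∀ p : ℕ, p.Prime → ¬ LUrel p :=
  ⟨fun h p hp hLU => not_resNoReduced p hp (h p hp hLU), fun h p hp hLU => absurd hLU (h p hp)⟩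

/-- (C2) `ResolutionInChar p` with `LocallyOfFiniteType f` dropped. -/
def ResNoFT (p : ℕ) : Prop :=
  ∀ (k : Type) [Field k] [CharP k p] (X : AlgebraicGeometry.Scheme.{0})
    (f : X ⟶ AlgebraicGeometry.Spec (.of k)), AlgebraicGeometry.IsSeparated f →
      AlgebraicGeometry.QuasiCompact f → AlgebraicGeometry.IsReduced X → Scheme.HasResolution X

/-- (C2) **NEW (gen 2): `ResNoFT p` is false for every prime** — `Spec 𝔽_p[X]⁺ → Spec 𝔽_p`
(absolute integral closure of the affine line: affine, reduced, not Noetherian) has no resolution,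
because in a root-closed domain every prime with Noetherian localisation is zero while the generic
point is not open (`AbsoluteIntegralClosureNoResolution.lean`, landed this generation) … -/
theorem not_resNoFT (p : ℕ) (hp : p.Prime) : ¬ ResNoFT p := by
  haveI : Fact p.Prime := ⟨hp⟩
  exact not_resolutionInChar_without_locallyOfFiniteType p

/-- (C2) … so, as for (C1), the crux with the finite-type-free consequent is equivalent to
`∀ p prime, ¬ LUrel_p`. Finite type of `X → Spec k` is load-bearing in any proof of the crux (it
is what makes the local rings Noetherian and the Riemann–Zariski space of the function field the
right parameter space). -/
theorem patchingRelNoFT_iff :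
    (∀ p : ℕ, p.Prime → LUrel p → ResNoFT p) ↔ ∀ p : ℕ, p.Prime → ¬ LUrel p :=
  ⟨fun h p hp hLU => not_resNoFT p hp (h p hp hLU), fun h p hp hLU => absurd hLU (h p hp)⟩

/-- (C3) "One affine chart": no finitely generated model of a function field of positive
transcendence degree lies in every valuation ring (`ℙ¹` phenomenon, tree, gen 1), so the LU
outputs must be GLUED — the patching step cannot be typed away. -/
theorem no_uniform_affineModel (p : ℕ) (hp : p.Prime) :
    ¬ ∀ (k K : Type) [Field k] [CharP k p] [Field K] [Algebra k K],
      (⊤ : IntermediateField k K).FG → ∃ A : Subalgebra k K, A.FG ∧ IsFractionRing A K ∧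
        ∀ O : ValuationSubring K, (∀ c : k, algebraMap k K c ∈ O) → A.toSubring ≤ O.toSubring := by
  haveI : Fact p.Prime := ⟨hp⟩
  exact not_forall_exists_uniform_affineModel p

/-! ## §4 The open core (proved reductions in the tree) -/

/-- **What the crux needs beyond its antecedent**: two-model patching of projective models over
fields of characteristic `p` (Zariski 1944 Fundamental Theorem / Piltant 2013 Prop. 5.1 with
`P = P_reg`, known in dimension `≤ 3`, open in dimension `≥ 4`) implies `PatchingRel` at `p`
(tree theorem `resolutionInChar_of_twoModelPatching_of_relLU`, gen 1: Zariski's compactness and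
resolving-system argument is dimension-free). -/
theorem patchingRel_of_twoModelPatching
    (hZ : ∀ (p : ℕ), p.Prime → ∀ (k : Type) [Field k] [CharP k p] (K : Type) [Field K]
      [Algebra k K] [Algebra.EssFiniteType k K], ∀ M₁ M₂ : ProjModel k K,
        ∃ (N : ProjModel k K) (φ₁ : N.Hom M₁) (φ₂ : N.Hom M₂), φ₁.RegLe ∧ φ₂.RegLe) :
    Valuative.PatchingRel :=
  fun p hp hLU => resolutionInChar_of_twoModelPatching_of_relLU (hZ p hp) hLU

/-! ## §5 Regimes tried (gen 2) and why nothing bites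

* Degenerate instances of the crux's antecedent (`O = K`, `K = k`, `trdeg_k K ≤ 1`, `R = ⊥`,
  `O` essentially of finite type (H7)): all TRUE, uniformly in `p` and dimension — they feed the
  implication nothing false, and the consequent is the summit slice, so no degenerate instance of
  the IMPLICATION is refutable.
* Junk models of the consequent: `X = ∅`, `dim X = 0`, `X` regular — resolved by the identity;
  non-reduced (C1) and non-finite-type (C2) `X` are excluded by the hypotheses the statement
  carries, and those exclusions are exactly right (both mutations are false).
* Finite / decidable shadows: none — the statement has no finite models (every field of
  characteristic `p` and every function field is infinite; `Scheme` is not a finite structure).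
* Literature negatives: no printed obstruction to Zariski patching in dimension `≥ 4` exists; the
  implication is recorded as OPEN, not false (Piltant 2013 p. 2; Cutkosky–Mourtada 2019 §1 p. 3;
  Temkin 2013 §1.2). `ledger negatives --problem ResolutionOfSingularities`: no entry touches
  0642.
* Barrier catalogue (`Literature/Barriers/ResolutionOfSingularities/`): `DimensionFourFrontier`
  isolates `ZariskiPatchingUpToDim 4` as a missing INPUT, not a refutation; the other barriers
  (residual order, kangaroo, Narasimhan, local monomialization fails, quasi-excellence necessary)
  concern inductive LU/resolution STRATEGIES, not the implication LU ⇒ Res.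
-/


/-! ## §6 Targets (gen 3): the registered skeleton `sandwiched-gluing` and its atom SAND⁺

Skeleton `Lines/sandwiched-gluing.lean` (sha `39befad7…`, planner-cruxplan-…-sandwiched-gluing-0,
2026-08-15T23:55Z) registers five stubs on the crux item:

* `stub_resolutionInChar_of_properPatching : ∀ p, p.Prime → ProperPatching p → LUrel p → ResolutionInChar p`
* `stub_properPatching_of_sandwiched : ∀ p, NagataCompactification → SandwichedStrongResolution p → ProperPatching p`
* `stub_nagataCompactification : NagataCompactification`
* `stub_sandwiched_of_fibre : ∀ p, NagataCompactification → (∀ n, FibreStrongResolution p n) → SandwichedStrongResolution p`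
* `stub_fibreStrongResolution : ∀ p, p.Prime → ∀ n, FibreStrongResolution p n`  (the residual atom)

RESHAPED SKELETON (lead `prover-line-stmt-ResolutionOfSingularities-0642-0`, PICKED.md 00:07Z, stubs
registered 2026-08-16T00:32Z — the five planner stubs above are now INACTIVE):

* `stub_resolutionInChar_of_properPatching : ∀ p, p.Prime → ProperModel.TwoModelPatching p → LUrel p → ResolutionInChar p`
  (Zariski's resolving-system argument with PROPER models; the tree has it for `ProjModel`:
  `resolutionInChar_of_twoModelPatching_of_relLU`; by (H8)/(H8c) it may be fed closed,
  non-Abhyankar points only);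
* `stub_regLeification_of_local : ∀ p, ProperExtension → ProperModel.LocalRegLeification p → ProperModel.RegLeification p`;
* `stub_localRegLeification_of_sandwiched : ∀ p, OpenGluing → SandwichedStrongResolution p → ProperModel.LocalRegLeification p`;
* `stub_openGluing : OpenGluing` (gluing two schemes along an isomorphism of opens; must NOT
  assert separatedness of the glued scheme — the line gets it from properness over `X₂''`);
* `stub_properExtension_of_nagata : NagataCompactification → ProperExtension`, where
  `ProperExtension := ∀ k K (P : ProperModel k K) (U : P.X.Opens) (Y : Scheme) [IsIntegral Y]
  (g : Y ⟶ U) [IsProper g], IsBirational g → ∃ (P' : ProperModel k K) (φ : P'.Hom P)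
  (i : Y ⟶ P'.X), IsOpenImmersion i ∧ IsPullback i g φ.f U.ι` (Nagata-compactify `Y → P.X`,
  take the closure; `Y = φ⁻¹(U)` by the clopen argument: `Y → U` proper, `φ` separated, `P'.X`
  irreducible — TRUE as read, provided `ProperModel.Hom` does not demand more than a dominant
  proper `k`-morphism compatible with the function-field identifications);
* `stub_nagataCompactification : NagataCompactification`;
* `stub_sandwichedStrongResolution : ∀ p, p.Prime → SandwichedStrongResolution p` (the residual
  atom; (T1)–(T3) below apply verbatim).

A parallel `drefute` seat (refuter-drefute-stmt-ResolutionOfSingularities-0642-0, advisory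
00:24Z) owns the stub-TYPING attack (Nagata absolute form, OpenGluing separatedness, the
`IsProper g` clause of the extension, `ProperModel` bodies); this file keeps the crux-level and
atom-level analysis. STATUS OF THE ATTACK. The skeleton FILE is not yet published under `Cruxes/PatchingRel/Lines/`
(only its stub signatures are on the item), so the definitions of `ProperPatching`,
`NagataCompactification` and `FibreStrongResolution` could not be read this cycle; the atom
`SandwichedStrongResolution` is the one of `Cruxes/PatchingRel/Ideator1Sketch.lean`, restated
verbatim below (definitionally equal, so the lead may `exact` the theorems of this section).
Findings, as theorems:

* (T1) `resolutionInChar_of_sandNoReg` — drop the REGULARITY OF THE ROOF `U` from SAND⁺ and the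
  atom becomes strong resolution of every integral variety (`U = V`, `η = 𝟙`), hence implies
  `ResolutionInChar p` outright: the roof's regularity is exactly what separates the line's
  residual atom from the (strong) summit.
* (T2) `resolutionInChar_of_sandNoBir` — drop BIRATIONALITY of `η` and the atom resolves every
  integral proper `k`-scheme (`U = Spec k`), hence again implies `ResolutionInChar p` (projective
  closures of Chow covers, tree `ResolutionOverUpToDim.of_projective`).
* (T3) `sand_of_strong` — SAND⁺(p) follows from strong resolution (iso over `Reg`) of integral
  varieties in characteristic `p`: the atom is CONSISTENT modulo the strong summit and therefore
  not refutable by anything short of a counterexample to strong resolution; none is known in any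
  dimension or characteristic (Cossart–Piltant 2019 Thm 1.1 (ii) gives it for `dim ≤ 3`).
* Stub-level notes (no Lean possible before the skeleton text is visible):
  - `stub_nagataCompactification`: TRUE as a theorem only with ALL of: base qcqs, morphism
    SEPARATED and OF FINITE TYPE (Nagata 1962/63; Conrad 2007; Stacks 0F41). A statement missing
    "separated" is false (the affine line with doubled origin has no open immersion into a proper,
    hence separated, `k`-scheme); missing "finite type" is false (`Spec k(t) → Spec k`: an open
    subscheme of a scheme of finite type over `k` is of finite type, and `k(t)` is not a finitely
    generated `k`-algebra by Zariski's lemma). To be checked against the typed `NagataCompactification`.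
  - `stub_fibreStrongResolution`: in the `regular-roof` typing (`S` regular local, `Algebra.EssFiniteType k S`,
    `T → Spec S` proper birational, `T` integral, regular off the closed fibre; conclusion iso over
    `Reg T` with `Reg T` OPEN) the hypothesis `EssFiniteType k S` is load-bearing through
    EXCELLENCE: over a regular local ring that is not quasi-excellent the regular locus of a
    finite `T` need not be open and resolutions need not exist (EGA IV 7.9.5; barrier
    `QuasiExcellenceNecessary`); `n ≤ 3` is `CossartPiltant2019General` (T is excellent of
    dimension `≤ dim S`); `n ≥ 4` is open and implied by strong resolution of excellent schemes —
    not refutable. `n = 0, 1, 2`: true (fields; Dedekind; Lipman 1978 for excellent surfaces).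
  - `stub_properPatching_of_sandwiched` / `stub_sandwiched_of_fibre`: implications between
    statements believed true — refutable only through a typing slip in `ProperPatching`
    (watch: proper vs projective models — the Ω-patch `N̄` is only PROPER (Nagata), and Chow's
    lemma does not preserve regular centres, so a `ProjModel`-typed `ProperPatching` would need an
    extra projectivization-preserving-`Reg` input that is not in print).
-/

/- The line's atom **SAND⁺(p)** is, since 2026-08-16T00:35Z, the Literature definition
`Literature.AlgebraicGeometry.Resolution.SandwichedStrongResolution` (`ProperModelsPatching.lean`,
landed by the lead; definitionally equal to the copy this file carried in gen 3 and to
`Cruxes/PatchingRel/Ideator1Sketch.lean`'s): strong resolution of integral schemes proper and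
birational over a regular integral separated `k`-scheme of finite type. The registered stub
`stub_sandwichedStrongResolution : ∀ p, p.Prime → SandwichedStrongResolution.{0} p` is that
constant, so (T1)–(T3) below apply to it verbatim. -/

/-- (T1) SAND⁺ with the regularity of the roof `U` dropped. -/
def SandNoReg (p : ℕ) : Prop :=
  ∀ (k : Type u) [Field k] [CharP k p] (U V : AlgebraicGeometry.Scheme.{u})
    (f : U ⟶ AlgebraicGeometry.Spec (.of k)) (η : V ⟶ U),
    AlgebraicGeometry.IsSeparated f → AlgebraicGeometry.LocallyOfFiniteType f →
    AlgebraicGeometry.QuasiCompact f → AlgebraicGeometry.IsIntegral U →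
    AlgebraicGeometry.IsIntegral V → AlgebraicGeometry.IsProper η → IsBirational η →
      ∃ (Y : AlgebraicGeometry.Scheme.{u}) (π : Y ⟶ V), IsResolution π ∧
        ∃ W : V.Opens, (W : Set V) = Scheme.regularLocus V ∧ CategoryTheory.IsIso (π ∣_ W)

/-- (T2) SAND⁺ with the birationality of `η` dropped. -/
def SandNoBir (p : ℕ) : Prop :=
  ∀ (k : Type u) [Field k] [CharP k p] (U V : AlgebraicGeometry.Scheme.{u})
    (f : U ⟶ AlgebraicGeometry.Spec (.of k)) (η : V ⟶ U),
    AlgebraicGeometry.IsSeparated f → AlgebraicGeometry.LocallyOfFiniteType f →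
    AlgebraicGeometry.QuasiCompact f → AlgebraicGeometry.IsIntegral U →
    Scheme.IsRegular U → AlgebraicGeometry.IsIntegral V → AlgebraicGeometry.IsProper η →
      ∃ (Y : AlgebraicGeometry.Scheme.{u}) (π : Y ⟶ V), IsResolution π ∧
        ∃ W : V.Opens, (W : Set V) = Scheme.regularLocus V ∧ CategoryTheory.IsIso (π ∣_ W)

/-- Strong resolution (iso over `Reg`) of integral separated `k`-schemes of finite type in
characteristic `p` — the strong form of the summit slice, integral case. -/
def StrongIntegralResolutionInChar (p : ℕ) : Prop :=
  ∀ (k : Type u) [Field k] [CharP k p] (X : AlgebraicGeometry.Scheme.{u})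
    (f : X ⟶ AlgebraicGeometry.Spec (.of k)),
    AlgebraicGeometry.IsSeparated f → AlgebraicGeometry.LocallyOfFiniteType f →
    AlgebraicGeometry.QuasiCompact f → AlgebraicGeometry.IsIntegral X →
      ∃ (Y : AlgebraicGeometry.Scheme.{u}) (π : Y ⟶ X), IsResolution π ∧
        ∃ W : X.Opens, (W : Set X) = Scheme.regularLocus X ∧ CategoryTheory.IsIso (π ∣_ W)

/-- (T1) Without the regularity of the roof, SAND⁺ IS strong resolution of all integral
varieties (`U = V`, `η = 𝟙`, birational by `isBirational_id`). -/
theorem strong_of_sandNoReg {p : ℕ} (h : SandNoReg.{u} p) :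
    StrongIntegralResolutionInChar.{u} p := by
  intro k _ _ X f hsep hft hqc hint
  exact h k X X f (𝟙 X) hsep hft hqc hint hint inferInstance (isBirational_id X)

/-- (T1) … hence implies the summit slice `ResolutionInChar p` (tree
`resolutionInChar_iff_integral`): **the roof's regularity is the load-bearing hypothesis of the
atom**. -/
theorem resolutionInChar_of_sandNoReg {p : ℕ} (h : SandNoReg.{u} p) : ResolutionInChar.{u} p := by
  rw [resolutionInChar_iff_integral]
  intro k _ _ X f hsep hft hqc hint
  obtain ⟨Y, π, hπ, -⟩ := strong_of_sandNoReg h k X f hsep hft hqc hint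
  exact ⟨Y, π, hπ⟩

/-- (T3) Conversely `SandNoReg` (a fortiori SAND⁺) follows from strong resolution of integral
varieties: `V` is integral, separated and of finite type over `k` through `η ≫ f`. -/
theorem sandNoReg_of_strong {p : ℕ} (h : StrongIntegralResolutionInChar.{u} p) : SandNoReg.{u} p := by
  intro k _ _ U V f η hsep hft hqc hU hV hη hbir
  haveI := hsep; haveI := hft; haveI := hqc; haveI := hη
  exact h k V (η ≫ f) inferInstance inferInstance inferInstance hV

/-- SAND⁺ is a special case of `SandNoReg`. -/
theorem sand_of_sandNoReg {p : ℕ} (h : SandNoReg.{u} p) : SandwichedStrongResolution.{u} p :=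
  fun k _ _ U V f η h1 h2 h3 h4 _ h6 h7 h8 => h k U V f η h1 h2 h3 h4 h6 h7 h8

/-- (T3) **SAND⁺ is implied by the strong summit** (consistency of the atom: it has the intended
models and is not refutable short of a counterexample to strong resolution in characteristic
`p`). -/
theorem sand_of_strong {p : ℕ} (h : StrongIntegralResolutionInChar.{u} p) :
    SandwichedStrongResolution.{u} p :=
  sand_of_sandNoReg (sandNoReg_of_strong h)

/-- (T2) Without birationality, SAND⁺ resolves (strongly) every integral PROPER `k`-scheme:
take the roof `U = Spec k` (regular: `Scheme.isRegular_Spec`). -/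
theorem strong_proper_of_sandNoBir {p : ℕ} (h : SandNoBir.{u} p) (k : Type u) [Field k]
    [CharP k p] (V : AlgebraicGeometry.Scheme.{u}) (g : V ⟶ AlgebraicGeometry.Spec (.of k))
    [AlgebraicGeometry.IsProper g] [AlgebraicGeometry.IsIntegral V] :
    ∃ (Y : AlgebraicGeometry.Scheme.{u}) (π : Y ⟶ V), IsResolution π ∧
      ∃ W : V.Opens, (W : Set V) = Scheme.regularLocus V ∧ CategoryTheory.IsIso (π ∣_ W) :=
  h k (AlgebraicGeometry.Spec (.of k)) V (𝟙 _) g inferInstance inferInstance inferInstance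
    inferInstance (Scheme.isRegular_Spec _) inferInstance inferInstance

/-- (T2) … hence implies `ResolutionInChar p` (every integral closed subscheme of `ℙⁿ_k` is
proper over `k`; `ResolutionOverUpToDim.of_projective` and finite dimensionality of schemes of
finite type): **birationality of `η` is load-bearing** in the same sense. -/
theorem resolutionInChar_of_sandNoBir {p : ℕ} (h : SandNoBir.{u} p) : ResolutionInChar.{u} p := by
  intro k _ _ X f hsep hft hqc hred
  haveI := hqc
  haveI : CompactSpace X := AlgebraicGeometry.QuasiCompact.compactSpace_of_compactSpace f
  obtain ⟨d, hd⟩ := exists_topologicalKrullDim_le_of_locallyOfFiniteType f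
  refine (ResolutionOverUpToDim.of_projective (k := k) (d := d) fun n Y ι hι hY _ => ?_)
    X f hsep hft hqc hred hd
  haveI := hι
  haveI := hY
  haveI : AlgebraicGeometry.IsProper (Literature.AlgebraicGeometry.Motives.projectiveSpace n k).hom :=
    Literature.AlgebraicGeometry.Motives.isProper_projectiveSpace n k
  obtain ⟨Y', π, hπ, -⟩ := strong_proper_of_sandNoBir h k Y
    (ι ≫ (Literature.AlgebraicGeometry.Motives.projectiveSpace n k).hom)
  exact ⟨Y', π, hπ⟩

/-- (T4) SAND⁺ restricted to sandwiched schemes `V` of dimension `≤ 3`. -/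
def SandDimLe3 (p : ℕ) : Prop :=
  ∀ (k : Type u) [Field k] [CharP k p] (U V : AlgebraicGeometry.Scheme.{u})
    (f : U ⟶ AlgebraicGeometry.Spec (.of k)) (η : V ⟶ U),
    AlgebraicGeometry.IsSeparated f → AlgebraicGeometry.LocallyOfFiniteType f →
    AlgebraicGeometry.QuasiCompact f → AlgebraicGeometry.IsIntegral U →
    Scheme.IsRegular U → AlgebraicGeometry.IsIntegral V → AlgebraicGeometry.IsProper η →
    IsBirational η → topologicalKrullDim V ≤ 3 →
      ∃ (Y : AlgebraicGeometry.Scheme.{u}) (π : Y ⟶ V), IsResolution π ∧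
        ∃ W : V.Opens, (W : Set V) = Scheme.regularLocus V ∧ CategoryTheory.IsIso (π ∣_ W)

/-- (T4) **NEW (gen 4): the atom holds in dimension `≤ 3` in EVERY characteristic**, modulo the
named facts `CossartPiltant2019General` (CP 2019 Thm 1.1 as printed: reduced separated
quasi-excellent Noetherian schemes of dimension `≤ 3` have a resolution which is an isomorphism
over `Reg`) and `Stacks07QW_field` (finite type algebras over a field are excellent): `V` is
separated, Noetherian, reduced and quasi-excellent because it is proper over `U`, itself separated
of finite type over `k`. So the registered stub `stub_sandwichedStrongResolution` is consistent in
the whole settled range (the roof's regularity and the birationality of `η` are not even used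
there) and its open content is exactly `dim V ≥ 4` — where, by (T1)/(T2), it cannot be weakened
structurally and, by (T3), it is implied by strong resolution. -/
theorem sandDimLe3_of_cossartPiltant (h : CossartPiltant2019General.{u}) (h07 : Stacks07QW_field.{u})
    (p : ℕ) : SandDimLe3.{u} p := by
  intro k _ _ U V f η hsep hft hqc _ _ _ hη _ hdim
  haveI := hsep; haveI := hft; haveI := hqc; haveI := hη
  haveI : V.IsSeparated := Scheme.isSeparated_of_isSeparated_over (η ≫ f)
  haveI : AlgebraicGeometry.IsNoetherian V := Scheme.isNoetherian_of_finiteType_over_field (η ≫ f)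
  exact h V (Scheme.isQuasiExcellent_of_locallyOfFiniteType h07 (η ≫ f)) hdim

/-- (T4) … in particular SAND⁺ itself follows in dimension `≤ 3` (the dimension hypothesis fed
from outside), uniformly in `p`. -/
theorem sand_of_dim_le_three (h : CossartPiltant2019General.{u}) (h07 : Stacks07QW_field.{u})
    {p : ℕ} (k : Type u) [Field k] [CharP k p] (U V : AlgebraicGeometry.Scheme.{u})
    (f : U ⟶ AlgebraicGeometry.Spec (.of k)) (η : V ⟶ U)
    [AlgebraicGeometry.IsSeparated f] [AlgebraicGeometry.LocallyOfFiniteType f]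
    [AlgebraicGeometry.QuasiCompact f] [AlgebraicGeometry.IsIntegral U]
    [AlgebraicGeometry.IsIntegral V] [AlgebraicGeometry.IsProper η]
    (hU : Scheme.IsRegular U) (hη : IsBirational η) (hdim : topologicalKrullDim V ≤ 3) :
    ∃ (Y : AlgebraicGeometry.Scheme.{u}) (π : Y ⟶ V), IsResolution π ∧
      ∃ W : V.Opens, (W : Set V) = Scheme.regularLocus V ∧ CategoryTheory.IsIso (π ∣_ W) :=
  sandDimLe3_of_cossartPiltant h h07 p k U V f η inferInstance inferInstance inferInstance
    inferInstance hU inferInstance inferInstance hη hdim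

/-! ## §7 Regimes tried (gen 3) and why nothing bites

* (H8) Weakening the antecedent to CLOSED POINTS of the Zariski–Riemann space (zero-dimensional
  valuations, or valuation rings minimal over `R`): an EQUIVALENT antecedent (`lurelZeroDim_iff`,
  `lurelMin_iff`), so the crux is unchanged (`patchingRelZeroDim_iff`) — no refutation, but the
  prover may restrict the resolving-system step to closed points, and the open content of
  `LUrel_p` is pinned to zero-dimensional non-Abhyankar valuations (Knaf–Kuhlmann 2005 settles
  the Abhyankar ones over perfect ground fields).
* The line's atom SAND⁺ (§6): both structural hypotheses (regular roof, birational `η`) are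
  load-bearing in the sense that dropping either turns the atom into the (strong) summit
  ((T1), (T2)); the atom itself is implied by the strong summit ((T3)) — irrefutable by
  construction short of a counterexample to strong resolution; sandwiched singularities form a
  PROPER subclass (cones over non-ruled varieties are not sandwiched: every exceptional prime
  divisor over a regular local ring is ruled, Abhyankar 1956), so (T1)'s collapse is not
  available inside the atom.
* Finite / decidable shadows of the atoms: none (schemes over infinite fields).
* Literature negatives for "weak but not strong resolution" of a sandwiched variety: none known
  in any dimension (search services were saturated during this cycle — `lit search` rc 75 — to
  be re-run).
-/

/-! ## §8 (gen 4) No slack in the line's upper cuts: the crux ⟺ (LU ⇒ two-model patching)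

The lead's reshaped skeleton (7 stubs, 2026-08-16T00:32Z) cuts the crux as
`LUrel_p ∧ TwoModelPatching_p ⇒ Res_p` (S1, now the tree theorem
`resolutionInChar_of_properTwoModelPatching_of_relLU`), `RegLeification ⇒ TwoModelPatching`
(join, twice), `ProperExtension ∧ LocalRegLeification ⇒ RegLeification` (S2),
`OpenGluing ∧ SAND⁺ ⇒ LocalRegLeification` (S3), `Nagata ⇒ ProperExtension` (S5), with the named
facts `NagataCompactification`, `OpenGluing` (S4, S6) and the atom SAND⁺ (S7). This section proves
that every statement ABOVE the atom is implied by the crux's consequent, so that (given `LUrel_p`)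
each is EQUIVALENT to `Res_p`: the cuts S1–S3 introduce no refutable slack, and the disprover's
only possible target in the line is the atom (§6, (T1)–(T3)) — or a typing slip in S2–S6, which
the parallel `drefute` seat owns (its advisory: none found; the typed `NagataCompactification` is
Conrad 2007 Thm 4.1 verbatim — qcqs base, separated finite-type morphism — and `OpenGluing` does
not assert separatedness of the glued scheme, so both junk witnesses of `DrefuteAdvisory.md` §(ii)
miss them).
-/

section NoSlack

open Literature.AlgebraicGeometry.Resolution.ProperModel

/-- (N0) A resolution of singularities of a proper model is a REGULAR proper model dominating it
(inlined from `Literature/…/ProperModelsPatchingOfResolution.lean`, landed this generation as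
p74278 — tree names `ProperModel.exists_hom_isRegular_of_hasResolution`,
`ProperModel.twoModelPatching_of_resolutionInChar`, `…regLeification_of_resolutionInChar`,
`…localRegLeification_of_resolutionInChar`, `…resolutionInChar_iff_twoModelPatching_and_relLU`,
`…twoModelPatching_iff_resolutionInChar_of_relLU` — inlined so that this work file elaborated
before the farm snapshot contained it). -/
theorem exists_hom_isRegular_of_hasResolution' {k K : Type u} [Field k] [Field K] [Algebra k K]
    (M : ProperModel k K) (h : Scheme.HasResolution M.X) :
    ∃ (N : ProperModel k K) (_ : N.Hom M), Scheme.IsRegular N.X := by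
  obtain ⟨Y, π, hπ⟩ := h
  haveI : AlgebraicGeometry.IsProper π := hπ.isProper
  haveI : AlgebraicGeometry.IsReduced Y := hπ.isRegular.isReduced
  haveI : AlgebraicGeometry.IsIntegral Y := hπ.isBirational.isIntegral
  obtain ⟨U, hU, hiso⟩ := M.exists_nonempty_isIso_morphismRestrict hπ.isBirational
  haveI := hiso
  exact ⟨ofModification M π U hU, ofModificationHom M π U hU, hπ.isRegular⟩

/-- (N0) Under `Res_p` every proper model over a field of characteristic `p` has a resolution. -/
theorem hasResolution_of_res {p : ℕ} (h : ResolutionInChar.{u} p) {k K : Type u} [Field k]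
    [CharP k p] [Field K] [Algebra k K] (M : ProperModel k K) : Scheme.HasResolution M.X :=
  h k M.X M.π inferInstance inferInstance inferInstance inferInstance

/-- (N1) **`Res_p ⇒ TwoModelPatching_p`**: resolve the join; a regular model is `RegLe` over
both factors. So S1's extra hypothesis is implied by the crux's consequent. -/
theorem twoModelPatching_of_res {p : ℕ} (h : ResolutionInChar.{u} p) :
    TwoModelPatching.{u} p := by
  intro k _ _ K _ _ _ M₁ M₂
  obtain ⟨N, φ, hN⟩ := exists_hom_isRegular_of_hasResolution' (join M₁ M₂)
    (hasResolution_of_res h _)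
  exact ⟨N, φ.comp (joinFst M₁ M₂), φ.comp (joinSnd M₁ M₂), fun y _ => hN y, fun y _ => hN y⟩

/-- (N2) **`Res_p ⇒ RegLeification_p`**: `ψ : M' → M` a resolution of `M`. -/
theorem regLeification_of_res {p : ℕ} (h : ResolutionInChar.{u} p) : RegLeification.{u} p := by
  intro k _ _ K _ _ _ M Y φ
  obtain ⟨M', ψ, hM'⟩ := exists_hom_isRegular_of_hasResolution' M (hasResolution_of_res h _)
  exact ⟨M', ψ, fun y _ => hM' y, fun y _ => hM' y⟩

/-- (N3) **`Res_p ⇒ LocalRegLeification_p`**: `O = M`, `N → M` a resolution. -/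
theorem localRegLeification_of_res {p : ℕ} (h : ResolutionInChar.{u} p) :
    LocalRegLeification.{u} p := by
  intro k _ _ K _ _ _ M Y φ
  obtain ⟨N, π, hπ⟩ := hasResolution_of_res h M
  haveI : AlgebraicGeometry.IsProper π := hπ.isProper
  haveI : AlgebraicGeometry.IsReduced N := hπ.isRegular.isReduced
  haveI : AlgebraicGeometry.IsIntegral N := hπ.isBirational.isIntegral
  let e : M.X ⟶ ((⊤ : M.X.Opens) : AlgebraicGeometry.Scheme.{u}) :=
    (AlgebraicGeometry.Scheme.topIso M.X).inv
  exact ⟨⊤, N, π ≫ e, inferInstance, inferInstance, hπ.isBirational.comp_iso e,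
    fun _ _ => trivial, fun _ _ => trivial, fun n _ => hπ.isRegular n, fun n _ => hπ.isRegular n⟩

/-- (N4) **`RegLeification_p ⇒ TwoModelPatching_p`** (RegLe-ify `J → M₁` on the join `J`, then
`M' → J → M₂`; the line's own glue, `Ideator1Sketch.twoModelPatching_of_regLeification` for
projective models — a local copy: the lead's companion file will carry the official one). -/
theorem twoModelPatching_of_regLeification' {p : ℕ} (h : RegLeification.{u} p) :
    TwoModelPatching.{u} p := by
  intro k _ _ K _ _ _ M₁ M₂
  obtain ⟨M', ψ₁, -, h₁⟩ := h k K (join M₁ M₂) M₁ (joinFst M₁ M₂)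
  obtain ⟨M'', ψ₂, hψ₂, h₂⟩ := h k K M' M₂ (ψ₁.comp (joinSnd M₁ M₂))
  exact ⟨M'', ψ₂.comp (ψ₁.comp (joinFst M₁ M₂)), ψ₂.comp (ψ₁.comp (joinSnd M₁ M₂)),
    hψ₂.comp h₁, h₂⟩

/-- (N4′) … and conversely **`TwoModelPatching_p ⇒ RegLeification_p`** (patch `M` with `Y`; the
second projection `N → Y` IS `ψ ≫ φ` by uniqueness of domination, `ProperModel.Hom.f_eq`), so the
two upper statements of the line are EQUIVALENT outright, in every characteristic and dimension
(again a local copy of the lead's announced companion lemma). -/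
theorem regLeification_of_twoModelPatching' {p : ℕ} (h : TwoModelPatching.{u} p) :
    RegLeification.{u} p := by
  intro k _ _ K _ _ _ M Y φ
  obtain ⟨N, φ₁, φ₂, h₁, h₂⟩ := h k K M Y
  refine ⟨N, φ₁, h₁, fun y hy => h₂ y ?_⟩
  have e : φ₂.f = (φ₁.comp φ).f := ProperModel.Hom.f_eq _ _
  rwa [e]

/-- (N4″) Hence `TwoModelPatching_p ↔ RegLeification_p`. -/
theorem twoModelPatching_iff_regLeification (p : ℕ) :
    TwoModelPatching.{u} p ↔ RegLeification.{u} p :=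
  ⟨regLeification_of_twoModelPatching', twoModelPatching_of_regLeification'⟩

/-- (N5) **The crux is equivalent to "LU ⇒ two-model patching of proper models"**:
`PatchingRel ↔ ∀ p prime, LUrel_p → TwoModelPatching_p` (`⇒` by (N1); `⇐` by Zariski's
programme with proper models, tree `resolutionInChar_of_properTwoModelPatching_of_relLU` = the
line's S1). A refutation of the crux is therefore exactly a prime `p` with `LUrel_p` and two
proper models of some `K/k`, `char k = p`, that no proper model dominates `RegLe`-ly. -/
theorem patchingRel_iff_lurel_imp_twoModelPatching :
    Valuative.PatchingRel ↔ ∀ p : ℕ, p.Prime → LUrel p → TwoModelPatching.{0} p :=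
  ⟨fun h p hp hLU => twoModelPatching_of_res (h p hp hLU),
    fun h p hp hLU => resolutionInChar_of_properTwoModelPatching_of_relLU (h p hp hLU) hLU⟩

/-- (N6) … and to "LU ⇒ RegLe-ification": `PatchingRel ↔ ∀ p prime, LUrel_p → RegLeification_p`. -/
theorem patchingRel_iff_lurel_imp_regLeification :
    Valuative.PatchingRel ↔ ∀ p : ℕ, p.Prime → LUrel p → RegLeification.{0} p :=
  ⟨fun h p hp hLU => regLeification_of_res (h p hp hLU),
    fun h p hp hLU => resolutionInChar_of_properTwoModelPatching_of_relLU
      (twoModelPatching_of_regLeification' (h p hp hLU)) hLU⟩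

/-- (N7) … and, modulo the line's stub S2 (`LocalRegLeification ⇒ RegLeification`, Nagata +
clopen bookkeeping, believed a theorem), to "LU ⇒ local RegLe-ification". -/
theorem patchingRel_iff_lurel_imp_localRegLeification
    (hS2 : ∀ p : ℕ, LocalRegLeification.{0} p → RegLeification.{0} p) :
    Valuative.PatchingRel ↔ ∀ p : ℕ, p.Prime → LUrel p → LocalRegLeification.{0} p :=
  ⟨fun h p hp hLU => localRegLeification_of_res (h p hp hLU),
    fun h p hp hLU => resolutionInChar_of_properTwoModelPatching_of_relLU
      (twoModelPatching_of_regLeification' (hS2 p (h p hp hLU))) hLU⟩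

/-- (N8) **`Res_p ↔ TwoModelPatching_p ∧ LUrel_p`** (with `lurel_of_res`): the open core and the
antecedent together are exactly the consequent — under local uniformization, two-model patching
in characteristic `p` is neither weaker nor stronger than resolution in characteristic `p`. -/
theorem res_iff_twoModelPatching_and_lurel (p : ℕ) (hp : p.Prime) :
    ResolutionInChar.{0} p ↔ TwoModelPatching.{0} p ∧ LUrel p :=
  ⟨fun h => ⟨twoModelPatching_of_res h, lurel_of_res p hp h⟩,
    fun h => resolutionInChar_of_properTwoModelPatching_of_relLU h.1 h.2⟩

/-- (N9) The atom's position: `Strong_p ⇒ SAND⁺_p` ((T3) `sand_of_strong`) and, through the line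
(S3 ∘ S2 ∘ join ∘ S1, given the named facts and `LUrel_p`), `SAND⁺_p ⇒ Res_p`; the converse
`Res_p ⇒ SAND⁺_p` is NOT available (a weak resolution of a sandwiched `V` need not be an
isomorphism over `Reg V`; making it one is elimination of indeterminacies over the regular locus,
i.e. principalization on regular varieties — Piltant's Axiom 4 — open in dimension `≥ 4`). What IS
formal is the degenerate direction: `Res_p` gives the atom WITHOUT its iso-over-`Reg` clause. -/
theorem sandWeak_of_res {p : ℕ} (h : ResolutionInChar.{u} p) (k : Type u) [Field k] [CharP k p]
    (U V : AlgebraicGeometry.Scheme.{u}) (f : U ⟶ AlgebraicGeometry.Spec (.of k)) (η : V ⟶ U)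
    [AlgebraicGeometry.IsSeparated f] [AlgebraicGeometry.LocallyOfFiniteType f]
    [AlgebraicGeometry.QuasiCompact f] [AlgebraicGeometry.IsIntegral V]
    [AlgebraicGeometry.IsProper η] : Scheme.HasResolution V :=
  h k V (η ≫ f) inferInstance inferInstance inferInstance inferInstance

end NoSlack

/-! ## §9 Regimes tried (gen 4) and why nothing bites

* The line's upper statements `TwoModelPatching_p`, `RegLeification_p`, `LocalRegLeification_p`
  (typed by the lead in `ProperModelsPatching.lean`): junk / degenerate instances — `K = k`
  (`ProperModel k k` is `Spec k`, everything regular), `M₁ = M₂`, `φ = id` (RegLe-ification of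
  the identity is the identity) — all TRUE; each statement is implied by `Res_p` (§8), so none is
  refutable short of `¬ Res_p`; and under `LUrel_p` each is EQUIVALENT to `Res_p` (N5)–(N8), so
  the line's reduction is loss-free above the atom.
* The named facts `NagataCompactification` (Conrad 2007, Thm 4.1 shape: qcqs base, separated +
  locally finite type + quasi-compact morphism; conclusion open immersion + proper + triangle) and
  `OpenGluing` (Stacks 01LH, two pieces, cocycle-free; conclusion does NOT claim separatedness):
  read symbol by symbol against the junk witnesses of the drefute advisory (doubled line,
  `Spec k(t)`, `Spec k ⊔ Spec k`, `ℙ¹/𝔸¹`): none applies — both facts are true as typed.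
  Degenerate covers (`V = ⊤, W = ⊥`, `V = ⊥`): the conclusions hold trivially (`N = Y`, resp.
  `N = S`).
* `ProperExtension` (S5's conclusion): `U = ∅` forces `Y = ∅`, excluded by `IsIntegral Y`; for
  `U ≠ ∅` the statement follows from Nagata + scheme-theoretic closure + the clopen lemma
  (`DrefuteAdvisory.md` (i)); its `IsProper g` hypothesis is load-bearing (witness `𝔸¹ ⊂ ℙ¹`,
  ibid. (ii).3) and present.
* (H9) dropping `R.FG` from the antecedent: antecedent false, crux vacuous (second trap).
* (C5) Restricting the CONSEQUENT to prime (or perfect, or finitely generated) ground fields gives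
  a formally WEAKER crux; the converse reduction "resolution over `𝔽_p` ⇒ resolution over every
  `k` of characteristic `p`" is formal only for `k` finitely generated over `𝔽_p` (a `k`-variety
  is then an `𝔽_p`-variety and regularity is absolute) and is NOT formal in general: regularity
  is destroyed by inseparable base change (`𝔽_p(t)[x]/(xᵖ − t)` is a field, its base change to
  `𝔽_p(t^{1/p})` is `k[x]/((x − t^{1/p})ᵖ)`), so limits over finitely generated subfields do not
  transport resolutions — this is the business of the sibling crux `DescentPerfectToAll`, not a
  refutation handle here (both sides of the mutated crux are believed true).
* (H10) Restricting the ANTECEDENT to prime / perfect ground fields gives a formally STRONGER crux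
  ((H8c) `patchingRel_of_perfectHard`); irrefutable for the same reason.
* Literature negatives (re-run of the gen-3 backlog): `lit search` (searchd) was again
  unavailable (rc 75, 3 attempts); `lit galaxy search` (substring discovery over all corpora:
  "sandwiched singularities" — 6 rows, all complex-surface / Nash-arc items; "Zariski's patching",
  "local uniformization implies resolution", "sandwiched singularities resolution positive
  characteristic" — 0 rows) surfaced nothing bearing on dimension `≥ 4` or characteristic `p`.
  The standing record (§5: no printed obstruction to Zariski patching in dimension `≥ 4`, Piltant
  2013 p. 2, Cutkosky–Mourtada 2019 p. 3, Temkin 2013 §1.2; no sandwiched variety with weak but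
  not strong resolution known in any characteristic) is unchanged; a refutation would in any case
  need a COUNTEREXAMPLE TO RESOLUTION in characteristic `p` (§1), of which none is claimed anywhere.
-/


/-! ## §10 (gen 5) The crux is its transcendence-degree-`≥ 4` slice

Both ends of the implication are FREE up to dimension three, modulo the named fact
`CossartPiltant2019` (Cossart–Piltant 2019, Thm. 1.1: weak resolution of reduced separated schemes
of finite type of dimension `≤ 3` over any field): the antecedent by the valuative criterion
(tree `CossartPiltant2019.relLocalUniformization`, after enlarging the prescribed `R` by an affine
model as in (H4)), the consequent verbatim (`hasResolution_of_dim_le_three`). Hence the crux is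
EQUIVALENT to "relative LU for function fields of transcendence degree `≥ 4` ⇒ resolution of
varieties of dimension `≥ 4`" — with (H7)/(H8)/(H8c): LU at zero-dimensional, non-Abhyankar
valuations of function fields of transcendence degree `≥ 4` ⇒ resolution in dimension `≥ 4`.
(Piltant 2013, p. 2: "All of these problems are open in dimension four or more"; p. 1: "the
Patching Theorem has never been extended to dimensions higher than three (without assuming
beforehand the existence of nonsingular projective models)".)
-/

/-- (H11) The antecedent demanded only for function fields of transcendence degree `≥ 4`
(`¬ trdeg_k K ≤ 3`). -/
def LUrelTrdegGe4 (p : ℕ) : Prop :=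
  ∀ (k K : Type) [Field k] [CharP k p] [Field K] [Algebra k K], (⊤ : IntermediateField k K).FG →
    ¬ Algebra.trdeg k K ≤ 3 →
    ∀ O : ValuationSubring K, (∀ c : k, algebraMap k K c ∈ O) → ∀ R : Subalgebra k K, R.FG →
      R.toSubring ≤ O.toSubring → ∃ (A : Subalgebra k K) (h : A.toSubring ≤ O.toSubring),
        R ≤ A ∧ A.FG ∧ IsFractionRing A K ∧ IsRegularLocalRing (Localization.AtPrime
          (Ideal.comap (Subring.inclusion h) (IsLocalRing.maximalIdeal O)))

/-- (H11) **The antecedent is FREE in transcendence degree `≤ 3`** (every characteristic, every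
ground field), modulo the named fact `CossartPiltant2019`: enlarge the prescribed `R` by an affine
model of `K` inside `O` and apply Cossart–Piltant's relative local uniformization
(`CossartPiltant2019.relLocalUniformization`, itself the valuative criterion applied to a
resolution of `Spec (R ⊔ A₀)`). So the content of `LUrel_p` sits entirely in transcendence degree
`≥ 4`. -/
theorem lurel_free_trdeg_le_three (h : CossartPiltant2019.{0}) {k K : Type} [Field k] [Field K]
    [Algebra k K] (hKfg : (⊤ : IntermediateField k K).FG) (hK : Algebra.trdeg k K ≤ 3)
    (O : ValuationSubring K) (hO : ∀ c : k, algebraMap k K c ∈ O) (R : Subalgebra k K)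
    (hRfg : R.FG) (hRO : R.toSubring ≤ O.toSubring) :
    ∃ (A : Subalgebra k K) (h : A.toSubring ≤ O.toSubring), R ≤ A ∧ A.FG ∧ IsFractionRing A K ∧
      IsRegularLocalRing (Localization.AtPrime
        (Ideal.comap (Subring.inclusion h) (IsLocalRing.maximalIdeal O))) := by
  obtain ⟨A₀, hA₀O, hA₀fg, hA₀fr⟩ := exists_affineModel k K hKfg O hO
  have hR'O : (R ⊔ A₀).toSubring ≤ O.toSubring := by
    let Oalg : Subalgebra k K := { O.toSubring with algebraMap_mem' := hO }
    change R ⊔ A₀ ≤ Oalg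
    exact sup_le (fun x hx => hRO hx) (fun x hx => hA₀O hx)
  have hR'fr : IsFractionRing ↥(R ⊔ A₀) K := isFractionRing_of_le le_sup_right hA₀fr
  obtain ⟨A, hA, hle, hAfg, hreg⟩ :=
    h.relLocalUniformization k K hK O (R ⊔ A₀) (hRfg.sup hA₀fg) hR'fr hR'O
  exact ⟨A, hA, le_sup_left.trans hle, hAfg, isFractionRing_of_le hle hR'fr, hreg⟩

/-- (H11) … hence `LUrelTrdegGe4_p ↔ LUrel_p` modulo `CossartPiltant2019`. -/
theorem lurelTrdegGe4_iff (h : CossartPiltant2019.{0}) (p : ℕ) : LUrelTrdegGe4 p ↔ LUrel p := by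
  refine ⟨fun H k K _ _ _ _ hKfg O hO R hRfg hRO => ?_,
    fun H k K _ _ _ _ hKfg _ O hO R hRfg hRO => H k K hKfg O hO R hRfg hRO⟩
  by_cases hK : Algebra.trdeg k K ≤ 3
  · exact lurel_free_trdeg_le_three h hKfg hK O hO R hRfg hRO
  · exact H k K hKfg hK O hO R hRfg hRO

/-- (H11) The consequent demanded only in dimension `≥ 4` (`¬ dim X ≤ 3`). -/
def ResDimGe4 (p : ℕ) : Prop :=
  ∀ (k : Type) [Field k] [CharP k p] (X : AlgebraicGeometry.Scheme.{0})
    (f : X ⟶ AlgebraicGeometry.Spec (.of k)), AlgebraicGeometry.IsSeparated f →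
      AlgebraicGeometry.LocallyOfFiniteType f → AlgebraicGeometry.QuasiCompact f →
        AlgebraicGeometry.IsReduced X → ¬ topologicalKrullDim X ≤ 3 → Scheme.HasResolution X

/-- (H11) `ResDimGe4_p ↔ Res_p` modulo `CossartPiltant2019` (dimension `≤ 3` is the named fact
verbatim, `hasResolution_of_dim_le_three`). -/
theorem resDimGe4_iff (h : CossartPiltant2019.{0}) (p : ℕ) : ResDimGe4 p ↔ ResolutionInChar.{0} p := by
  refine ⟨fun H k _ _ X f hsep hft hqc hred => ?_,
    fun H k _ _ X f hsep hft hqc hred _ => H k X f hsep hft hqc hred⟩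
  by_cases hd : topologicalKrullDim X ≤ 3
  · haveI := hsep; haveI := hft; haveI := hqc; haveI := hred
    exact hasResolution_of_dim_le_three h k X f hd
  · exact H k X f hsep hft hqc hred hd

/-- (H11) **The crux is its high-dimensional slice**: modulo `CossartPiltant2019`,
`PatchingRel ↔ ∀ p prime, LUrelTrdegGe4_p → ResDimGe4_p`. Every instance of the crux that can be
settled from the literature (transcendence degree / dimension `≤ 3`) is settled on BOTH sides at
once, so the dimension-`≤ 3` theorems give no leverage on the implication; a refutation needs LU
for some function field of transcendence degree `≥ 4` feeding a non-resolvable variety of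
dimension `≥ 4` (§1). -/
theorem patchingRel_iff_highDim (h : CossartPiltant2019.{0}) :
    Valuative.PatchingRel ↔ ∀ p : ℕ, p.Prime → LUrelTrdegGe4 p → ResDimGe4 p :=
  ⟨fun H p hp hLU => (resDimGe4_iff h p).mpr (H p hp ((lurelTrdegGe4_iff h p).mp hLU)),
    fun H p hp hLU => (resDimGe4_iff h p).mp (H p hp ((lurelTrdegGe4_iff h p).mpr hLU))⟩

/-! ## §11 (gen 5) Why the ATOM resists: the sandwiched class is locally wild in dimension `≥ 4`

The line's residual atom `SandwichedStrongResolution p` (strong resolution of integral `V`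
proper and birational over a regular `U`) looks like a statement about MILD singularities
(exceptional divisors over a regular `U` are ruled, Abhyankar 1956; sandwiched SURFACE
singularities are rational, Lipman/Spivakovsky). The following specialization records that it
is not: the atom contains the strong resolution of EVERY blowing up `Bl_J(U)` of every regular
variety `U` along every non-zero ideal sheaf `J` (`sand_blowup`; blow-ups exist, are integral and
birational unconditionally in the tree, and proper modulo the named fact `Stacks02NS`). For
`U = 𝔸ⁿ⁺¹ = Spec k[x₁, x', ]`, `x' = (x₂, …, x_{n+1})`, and `J = (x₁ᵖ, g(x'))` (a regular
sequence, `g ∉ k`), the chart `D₊(x₁ᵖ t)` of `Bl_J(𝔸ⁿ⁺¹) = V(x₁ᵖ T₁ − g T₀) ⊆ ℙ¹ × 𝔸ⁿ⁺¹` is the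
hypersurface

  `V₀ : x₁ᵖ · t = g(x₂, …, x_{n+1})` in `𝔸ⁿ⁺²`  (Stacks 0BIQ: `R[J/a] ≅ R[t]/(a t − b)` for an
  `H₁`-regular pair `(a, b)`),

whose germ at a point `(x₁ = 0, x'₀, t₀)` with `g(x'₀) = 0`, `t₀ ≠ 0` is
`x₁ᵖ (t₀ + s) = g(x')`: the FROBENIUS-TWISTED PENCIL of the purely inseparable `n`-fold germ
`wᵖ = g(x')` (all fibres `s = s₀` are `k`-isomorphic to `wᵖ = g` when `k` is perfect, but the
total space is not a product — `(t₀ + s)^{1/p} ∉ k⟦s⟧`). Its singular locus is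
`{x₁ = 0} × Sing(g) × 𝔸¹_t`, of dimension `dim Sing(g) + 1`. So:

* in dimension `n + 1 = 4` the atom already demands STRONG (iso over `Reg`) resolution of
  `4`-folds fibred in arbitrary purely inseparable (Zariski) threefold germs
  `wᵖ = g(x₂, x₃, x₄)` — the hardest case of Cossart–Piltant 2008/2009, one dimension up and in
  a twisted family; nothing in print covers it (Cossart–Piltant 2019 stops at dimension `3`;
  the germs are not toric/binomial unless `g` is a monomial);
* in dimension `n + 1`, the atom contains twisted pencils of exactly the germs `tᵖ = a` over
  regular `n`-dimensional bases whose LOCAL UNIFORMIZATION is the route's other crux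
  `LuAlphaPTorsor` (stmt-0641, open for `n ≥ 4`); more precisely, over `u := t ≠ 0` the chart
  `x₁ᵖ u = g(x')` IS the `α_p`-torsor `wᵖ = g(x')/u` over the regular `(n+1)`-fold `𝔸ⁿ × 𝔾_m`
  (singular locus `{w = 0} × Sing(g) × 𝔾_m`, fibres `u = u₀` the torsors `wᵖ = g/u₀ ≅ wᵖ = g`
  over `𝔸ⁿ`, total space not a product since `u^{1/p} ∉ k[u, u⁻¹]`): the global crux's atom in
  dimension `n + 1` demands STRONG RESOLUTION of one-parameter Frobenius-twisted families of the
  general `α_p`-torsor germ of dimension `n` — a fortiori their local uniformization, an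
  instance of the local crux in dimension `n + 1` with `a = g(x') u⁻¹`. The sandwiched
  hypothesis constrains the exceptional divisors, not the local rings.
* With `f = x₁` instead of `x₁ᵖ` one gets the compound family `u v = g(x')` (`cA`-type
  suspensions); by the blow-up computation `u = x u', v = x v' ⇒ u'v' = x^{d-2} ĝ` their strong
  resolution by `Reg`-preserving centres `{u = v = 0} × C` is EQUIVALENT to resolving the marked
  ideal `(g, 2)` on the regular `n`-fold by blowing up regular centres inside `{ord g ≥ 2}` —
  for `n = 3` within reach of embedded resolution of surfaces (CJS 2009) plus the combinatorial
  monomial step, so the `uv = g(x,y,z)` fourfolds are NOT a promising place to look for a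
  counterexample; the `x₁ᵖ t = g` fourfolds are where the atom is genuinely beyond the literature.

Consequences recorded as theorems: `sand_blowup` (the specialization) and
`sand_principalization_shape` (the atom yields Piltant's Axiom 4 — principalization, iso off the
cosupport — on REGULAR varieties of every dimension, in the weak form "a regular modification
through the blow-up": the clause making it more than weak resolution is again iso-over-`Reg`).
No refutation: every statement here is implied by strong resolution in characteristic `p` (T3).
-/

section SandBlowup

open AlgebraicGeometry

/-- (T5) **The atom resolves every blow-up of a regular variety**: under
`SandwichedStrongResolution p` (and properness of blow-ups, `Stacks02NS`), for every regular
integral separated `k`-scheme of finite type `U` (`char k = p`), every ideal sheaf `J ≠ ⊥` and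
every blowing up `π : V → U` of `U` along `J`, the scheme `V` has a resolution which is an
isomorphism over `Reg V`. In particular (docstring above) the atom in dimension `n + 1` contains
the strong resolution of the Frobenius-twisted pencils `x₁ᵖ t = g(x₂, …, x_{n+1})` of all purely
inseparable `n`-fold germs. -/
theorem sand_blowup {p : ℕ} (hS : SandwichedStrongResolution.{u} p) (h02 : Stacks02NS.{u})
    (k : Type u) [Field k] [CharP k p] (U : AlgebraicGeometry.Scheme.{u})
    (f : U ⟶ AlgebraicGeometry.Spec (.of k)) [AlgebraicGeometry.IsSeparated f]
    [AlgebraicGeometry.LocallyOfFiniteType f] [AlgebraicGeometry.QuasiCompact f]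
    [AlgebraicGeometry.IsIntegral U] (hU : Scheme.IsRegular U)
    (J : U.IdealSheafData) (hJ : J ≠ ⊥) {V : AlgebraicGeometry.Scheme.{u}} (π : V ⟶ U)
    (hπ : IsBlowup π J) :
    ∃ (Y : AlgebraicGeometry.Scheme.{u}) (ρ : Y ⟶ V), IsResolution ρ ∧
      ∃ W : V.Opens, (W : Set V) = Scheme.regularLocus V ∧ CategoryTheory.IsIso (ρ ∣_ W) := by
  haveI : AlgebraicGeometry.IsIntegral V := hπ.isIntegral hJ
  haveI : AlgebraicGeometry.IsNoetherian U := Scheme.isNoetherian_of_finiteType_over_field f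
  haveI : AlgebraicGeometry.IsProper π := h02.of_isLocallyNoetherian π J hπ
  exact hS k U V f π inferInstance inferInstance inferInstance inferInstance hU inferInstance
    inferInstance (hπ.isBirational' hJ)

/-- (T5′) **The atom yields Piltant's Axiom 4 on regular varieties, in every dimension** (shape:
a REGULAR modification `Y → U` factoring through the blowing up of `J` — so that `J·𝒪_Y` is
invertible — which is an isomorphism over the complement of the centre): compose the blow-up
with the strong resolution of (T5); over `U ∖ V(J)` the blow-up is an isomorphism onto an open of
the regular `U`, which therefore lies in `Reg V`, where `ρ` is an isomorphism. Principalization of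
ideals on regular varieties of dimension `≥ 4` in characteristic `p` with this isomorphism clause
is not in print (Piltant 2013, Axiom 4 and p. 2); WITHOUT the clause it follows from weak
resolution (resolve `Bl_J U`), so — as for the atom itself (N9) — the open content is exactly the
isomorphism locus. -/
theorem sand_principalization_shape {p : ℕ} (hS : SandwichedStrongResolution.{u} p)
    (h02 : Stacks02NS.{u}) (k : Type u) [Field k] [CharP k p] (U : AlgebraicGeometry.Scheme.{u})
    (f : U ⟶ AlgebraicGeometry.Spec (.of k)) [AlgebraicGeometry.IsSeparated f]
    [AlgebraicGeometry.LocallyOfFiniteType f] [AlgebraicGeometry.QuasiCompact f]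
    [AlgebraicGeometry.IsIntegral U] (hU : Scheme.IsRegular U)
    (J : U.IdealSheafData) (hJ : J ≠ ⊥) :
    ∃ (V Y : AlgebraicGeometry.Scheme.{u}) (π : V ⟶ U) (ρ : Y ⟶ V), IsBlowup π J ∧
      IsResolution ρ ∧ Scheme.IsRegular Y ∧ AlgebraicGeometry.IsProper (ρ ≫ π) ∧
      ∃ W : V.Opens, (W : Set V) = Scheme.regularLocus V ∧ CategoryTheory.IsIso (ρ ∣_ W) ∧
        π ⁻¹ᵁ (centreCompl J) ≤ W ∧ CategoryTheory.IsIso (π ∣_ centreCompl J) := by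
  obtain ⟨V, π, hπ⟩ := exists_isBlowup U J
  obtain ⟨Y, ρ, hρ, W, hW, hiso⟩ := sand_blowup hS h02 k U f hU J hJ π hπ
  haveI : AlgebraicGeometry.IsNoetherian U := Scheme.isNoetherian_of_finiteType_over_field f
  haveI : AlgebraicGeometry.IsProper π := h02.of_isLocallyNoetherian π J hπ
  haveI : AlgebraicGeometry.IsProper ρ := hρ.isProper
  haveI hc : CategoryTheory.IsIso (π ∣_ centreCompl J) := hπ.isIso_compl
  refine ⟨V, Y, π, ρ, hπ, hρ, hρ.isRegular, inferInstance, W, hW, hiso, ?_, hc⟩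
  -- over the complement of the centre the blow-up restricts to an isomorphism onto an open
  -- of the regular `U`, so its points are regular points of `V`
  intro v hv
  have hvW : v ∈ (W : Set V) := by
    rw [hW, mem_regularLocus_iff_of_isIso_morphismRestrict π (centreCompl J) v hv,
      hU.regularLocus_eq_univ]
    trivial
  exact hvW

end SandBlowup

/-! ### (T6) Properness of `η` is cosmetic: the atom ⇔ its non-proper form (modulo Nagata) -/

section SandNoProper

open AlgebraicGeometry Literature.AlgebraicGeometry.Morphisms

/-- (T6) Strong resolutions restrict to opens: if `π : Y → X` is a resolution which is an isomorphism
over an open `W` with `W = Reg X`, then for every open `O ⊆ X` the restriction `π⁻¹(O) → O` is a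
resolution which is an isomorphism over `O ∩ W = Reg O`. [folklore] -/
theorem strongResolution_restrict {Y X : Scheme.{u}} {π : Y ⟶ X} (hπ : IsResolution π)
    {W : X.Opens} (hW : (W : Set X) = Scheme.regularLocus X) (hiso : IsIso (π ∣_ W))
    (O : X.Opens) :
    ∃ (Y' : Scheme.{u}) (π' : Y' ⟶ (O : Scheme.{u})), IsResolution π' ∧
      ∃ W' : (O : Scheme.{u}).Opens, (W' : Set (O : Scheme.{u})) = Scheme.regularLocus (O : Scheme.{u}) ∧
        IsIso (π' ∣_ W') := by
  haveI := hπ.isProper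
  refine ⟨_, π ∣_ O, ⟨inferInstance, hπ.isBirational.morphismRestrict O,
    hπ.isRegular.of_isOpenImmersion (π ⁻¹ᵁ O).ι⟩, O.ι ⁻¹ᵁ W, ?_, ?_⟩
  · ext x
    change O.ι x ∈ (W : Set X) ↔ x ∈ Scheme.regularLocus (O : Scheme.{u})
    rw [hW, Scheme.mem_regularLocus, Scheme.mem_regularLocus, SandwichedGluing.mem_regularLocus_opens_iff]
    rfl
  · have hle : O.ι ''ᵁ (O.ι ⁻¹ᵁ W) ≤ W := by
      rw [Scheme.Hom.image_preimage_eq_opensRange_inf]; exact inf_le_right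
    have h2 : IsIso (π ∣_ O.ι ''ᵁ (O.ι ⁻¹ᵁ W)) := isIso_morphismRestrict_of_le π hiso hle
    exact ((MorphismProperty.isomorphisms Scheme).arrow_mk_iso_iff
      (morphismRestrictRestrict π O (O.ι ⁻¹ᵁ W))).mpr h2

/-- (T6) Strong resolutions transport along isomorphisms of the base. -/
theorem strongResolution_of_iso {X X₁ : Scheme.{u}} (e : X ≅ X₁)
    (h : ∃ (Y : Scheme.{u}) (π : Y ⟶ X₁), IsResolution π ∧
      ∃ W : X₁.Opens, (W : Set X₁) = Scheme.regularLocus X₁ ∧ IsIso (π ∣_ W)) :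
    ∃ (Y : Scheme.{u}) (π : Y ⟶ X), IsResolution π ∧
      ∃ W : X.Opens, (W : Set X) = Scheme.regularLocus X ∧ IsIso (π ∣_ W) := by
  obtain ⟨Y, π, hπ, W, hW, hiso⟩ := h
  haveI := hπ.isProper
  refine ⟨Y, π ≫ e.inv, ⟨inferInstance, hπ.isBirational.comp_iso e.inv, hπ.isRegular⟩,
    e.hom ⁻¹ᵁ W, ?_, ?_⟩
  · ext x
    change e.hom x ∈ (W : Set X₁) ↔ x ∈ Scheme.regularLocus X
    rw [hW, Scheme.mem_regularLocus, Scheme.mem_regularLocus]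
    exact ⟨fun h => IsRegularLocalRing.of_ringEquiv (asIso (e.hom.stalkMap x)).commRingCatIsoToRingEquiv,
      fun h => IsRegularLocalRing.of_ringEquiv (asIso (e.hom.stalkMap x)).commRingCatIsoToRingEquiv.symm⟩
  · rw [morphismRestrict_comp]
    have hWe : e.inv ⁻¹ᵁ (e.hom ⁻¹ᵁ W) = W := by
      rw [← Scheme.Hom.comp_preimage, e.inv_hom_id, Scheme.Hom.id_preimage]
    have h1 : IsIso (π ∣_ e.inv ⁻¹ᵁ (e.hom ⁻¹ᵁ W)) :=
      ((MorphismProperty.isomorphisms Scheme).arrow_mk_iso_iff (morphismRestrictEq π hWe)).mpr hiso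
    refine @IsIso.comp_isIso _ _ _ _ _ _ _ h1 ?_
    infer_instance

/-- (T6) **`IsProper η` is NOT load-bearing in the atom** (modulo the named fact
`NagataCompactification`): an integral `V` with a SEPARATED, FINITE TYPE, birational morphism
`η : V → U` to a regular integral separated `k`-scheme of finite type is an open of a sandwiched
scheme (Nagata-compactify `η`, take the closure of `V`; the closure is birational over `U` by the
clopen lemma over the iso-locus of `η`), so it has a resolution which is an isomorphism over
`Reg V`. Contrast (T1)/(T2): the regularity of the roof and the birationality of `η` ARE
load-bearing. (Landing as `Literature/…/SandwichedNonProper.lean`.) -/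
theorem sandwichedStrongResolution_of_not_proper {p : ℕ} (hS : SandwichedStrongResolution.{u} p)
    (hN : NagataCompactification.{u}) (k : Type u) [Field k] [CharP k p] (U V : Scheme.{u})
    (f : U ⟶ Spec (.of k)) (η : V ⟶ U) [IsSeparated f] [LocallyOfFiniteType f] [QuasiCompact f]
    [IsIntegral U] (hU : Scheme.IsRegular U) [IsIntegral V] [IsSeparated η]
    [LocallyOfFiniteType η] [QuasiCompact η] (hη : IsBirational η) :
    ∃ (Y : Scheme.{u}) (π : Y ⟶ V), IsResolution π ∧
      ∃ W : V.Opens, (W : Set V) = Scheme.regularLocus V ∧ IsIso (π ∣_ W) := by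
  haveI : CompactSpace U := QuasiCompact.compactSpace_of_compactSpace f
  haveI : U.IsSeparated := Scheme.isSeparated_of_isSeparated_over f
  -- Nagata compactification of `η`
  obtain ⟨Vc, j, gc, hj, hgc, hfac⟩ := hN V U η
  haveI := hj
  haveI := hgc
  -- closure of `V` in the compactification
  haveI : IsNoetherian U := Scheme.isNoetherian_of_finiteType_over_field f
  haveI : IsLocallyNoetherian Vc := LocallyOfFiniteType.isLocallyNoetherian gc
  obtain ⟨Z, c, s, hZ, hc, hsc, hs, hdense, -⟩ :=
    exists_graphClosure_compactification j (𝟙 Vc) j (Category.comp_id j)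
  haveI := hZ
  haveI := hc
  haveI := hs
  -- `ζ : Z → U` is proper and extends `η`
  have hη : η = s ≫ c ≫ gc := by rw [← Category.assoc, hsc, hfac]
  subst hη
  haveI : IsProper (c ≫ gc) := inferInstance
  generalize c ≫ gc = ζ at *
  -- birationality of `ζ`: over the iso-locus `U₀` of `η`, `s` is a proper open immersion into the
  -- irreducible `ζ⁻¹(U₀)`, hence an isomorphism
  have hbir : IsBirational ζ := by
    obtain ⟨U₀, hU₀, hpre, hiso⟩ := hη
    have hne : ((s ≫ ζ) ⁻¹ᵁ U₀ : Set V).Nonempty := by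
      haveI : Nonempty V := inferInstance
      exact hpre.nonempty
    obtain ⟨v, hv⟩ := hne
    have hζne : (ζ ⁻¹ᵁ U₀ : Set Z).Nonempty := ⟨s v, hv⟩
    haveI : Nonempty (ζ ⁻¹ᵁ U₀ : Scheme.{u}) := ⟨⟨s v, hv⟩⟩
    haveI : IsIntegral (ζ ⁻¹ᵁ U₀ : Scheme.{u}) := isIntegral_of_isOpenImmersion (ζ ⁻¹ᵁ U₀).ι
    haveI : Nonempty ((s ≫ ζ) ⁻¹ᵁ U₀ : Scheme.{u}) := ⟨⟨v, hv⟩⟩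
    -- the restriction of `s` over `ζ⁻¹(U₀)`
    let i : ((s ≫ ζ) ⁻¹ᵁ U₀ : Scheme.{u}) ⟶ (ζ ⁻¹ᵁ U₀ : Scheme.{u}) :=
      (Scheme.isoOfEq V (Scheme.Hom.comp_preimage s ζ U₀)).hom ≫ s ∣_ (ζ ⁻¹ᵁ U₀)
    haveI : IsOpenImmersion i := inferInstance
    have hi : i ≫ ζ ∣_ U₀ = (s ≫ ζ) ∣_ U₀ := by
      rw [← cancel_mono U₀.ι]
      simp only [i, Category.assoc, morphismRestrict_ι]
      rw [morphismRestrict_ι_assoc, Scheme.isoOfEq_hom_ι_assoc]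
    haveI : IsIso ((s ≫ ζ) ∣_ U₀) := hiso
    haveI : IsProper (i ≫ ζ ∣_ U₀) := by rw [hi]; infer_instance
    haveI : IsIso i := SandwichedGluing.isIso_of_isOpenImmersion_of_isProper_comp i (ζ ∣_ U₀)
    have hζiso : IsIso (ζ ∣_ U₀) := by
      have : ζ ∣_ U₀ = inv i ≫ (s ≫ ζ) ∣_ U₀ := by rw [← hi, IsIso.inv_hom_id_assoc]
      rw [this]; infer_instance
    exact ⟨U₀, hU₀, (ζ ⁻¹ᵁ U₀).2.dense hζne, hζiso⟩
  -- strong resolution of the sandwiched `Z`, restricted to the open `V ≅ s.opensRange`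
  obtain ⟨Y, πZ, hres, WZ, hWZ, hisoZ⟩ := hS k U Z f ζ inferInstance inferInstance inferInstance
    inferInstance hU inferInstance inferInstance hbir
  exact strongResolution_of_iso s.isoOpensRange (strongResolution_restrict hres hWZ hisoZ s.opensRange)


/-- (T6) The atom with `IsProper η` weakened to "separated, locally of finite type,
quasi-compact". -/
def SandNoProper (p : ℕ) : Prop :=
  ∀ (k : Type u) [Field k] [CharP k p] (U V : Scheme.{u}) (f : U ⟶ Spec (.of k)) (η : V ⟶ U),
    IsSeparated f → LocallyOfFiniteType f → QuasiCompact f → IsIntegral U →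
    Scheme.IsRegular U → IsIntegral V → IsSeparated η → LocallyOfFiniteType η → QuasiCompact η →
    IsBirational η →
      ∃ (Y : Scheme.{u}) (π : Y ⟶ V), IsResolution π ∧
        ∃ W : V.Opens, (W : Set V) = Scheme.regularLocus V ∧ IsIso (π ∣_ W)

/-- (T6) **`SandNoProper p ↔ SandwichedStrongResolution p`** modulo `NagataCompactification`:
the atom is really the statement "every integral variety with a separated finite-type birational
MORPHISM to a regular variety has a resolution which is an isomorphism over its regular locus" —
e.g. it applies directly to every hypersurface `f(x)·t = g(x)` over `𝔸ⁿ` with `f, g` coprime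
(integral, `t = g/f` birational onto `𝔸ⁿ`), such as the twisted pencils `x₁ᵖ t = g(x')` of §11,
with no blow-up bookkeeping. -/
theorem sandNoProper_iff (hN : NagataCompactification.{u}) (p : ℕ) :
    SandNoProper.{u} p ↔ SandwichedStrongResolution.{u} p := by
  refine ⟨fun h k _ _ U V f η h1 h2 h3 h4 hU h6 h7 h8 => ?_,
    fun h k _ _ U V f η h1 h2 h3 h4 hU h6 h7 h8 h9 h10 => ?_⟩
  · haveI := h7
    exact h k U V f η h1 h2 h3 h4 hU h6 inferInstance inferInstance inferInstance h8
  · haveI := h1; haveI := h2; haveI := h3; haveI := h4; haveI := h6; haveI := h7; haveI := h8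
    haveI := h9
    exact sandwichedStrongResolution_of_not_proper h hN k U V f η hU h10

end SandNoProper


/-! ### (T5b) The chart presentation, PROVED: `R[b/a] ≅ R[X]/(aX − b)` for a regular pair

Stacks 0BIQ for pairs, by degree induction (landing as `Literature/…/BlowupChartPair.lean`): this
makes the ring-level part of §11's claim formal — in `k[x₀, …, xₙ]` the pair `(x₀ᵖ, g)` (`g ≠ 0`
not involving `x₀`) is regular (`ker_chartEval_twistedPencil`), so the `x₀ᵖ`-chart ring
`k[x][g/x₀ᵖ]` of `Bl_{(x₀ᵖ, g)} 𝔸ⁿ⁺¹` is `k[x, T]/(x₀ᵖ T − g)`. (The scheme-level identification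
of `Spec k[x][g/x₀ᵖ]` with an open of the blow-up is the tree's named fact `AffineBlowupIsBlowup`.)
-/

section ChartPair

open Polynomial



variable {R : Type*} [CommRing R]

/-- The evaluation `R[X] → R[1/a]`, `X ↦ b/a`. -/
noncomputable def chartEval (a b : R) : R[X] →ₐ[R] Localization.Away a :=
  Polynomial.aeval (IsLocalization.mk' (Localization.Away a) b
    (⟨a, Submonoid.mem_powers a⟩ : Submonoid.powers a))

theorem chartEval_C (a b c : R) : chartEval a b (C c) = algebraMap R _ c := by
  simp [chartEval]

theorem chartEval_X_mul_a (a b : R) :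
    chartEval a b X * algebraMap R (Localization.Away a) a = algebraMap R _ b := by
  simp only [chartEval, Polynomial.aeval_X]
  exact IsLocalization.mk'_spec (Localization.Away a) b ⟨a, _⟩

theorem chartEval_rel (a b : R) : chartEval a b (C a * X - C b) = 0 := by
  rw [map_sub, map_mul, chartEval_C, chartEval_C, mul_comm, chartEval_X_mul_a, sub_self]

/-- Clearing denominators: `a ^ n * P(b/a) = Σᵢ cᵢ bⁱ a^(n-i)` for `natDegree P ≤ n`. -/
theorem pow_mul_chartEval (a b : R) (P : R[X]) (n : ℕ) (hn : P.natDegree ≤ n) :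
    algebraMap R (Localization.Away a) (a ^ n) * chartEval a b P =
      algebraMap R (Localization.Away a)
        (∑ i ∈ Finset.range (n + 1), P.coeff i * b ^ i * a ^ (n - i)) := by
  classical
  set L := Localization.Away a
  set u : L := chartEval a b X with hu
  have hua : u * algebraMap R L a = algebraMap R L b := chartEval_X_mul_a a b
  have hP : chartEval a b P = ∑ i ∈ Finset.range (n + 1), algebraMap R L (P.coeff i) * u ^ i := by
    have e : chartEval a b P = Polynomial.aeval u P := by
      rw [hu]; simp [chartEval]
    rw [e, Polynomial.aeval_eq_sum_range' (Nat.lt_succ_of_le hn)]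
    simp [Algebra.smul_def]
  rw [hP, Finset.mul_sum, map_sum]
  refine Finset.sum_congr rfl fun i hi => ?_
  have hi' : i ≤ n := Nat.lt_succ_iff.mp (Finset.mem_range.mp hi)
  have key : algebraMap R L (a ^ n) * u ^ i = algebraMap R L (b ^ i * a ^ (n - i)) := by
    have : a ^ n = a ^ i * a ^ (n - i) := by rw [← pow_add, Nat.add_sub_cancel' hi']
    rw [this, map_mul, map_mul, map_pow, map_pow, map_pow]
    have h2 : algebraMap R L a ^ i * u ^ i = algebraMap R L b ^ i := by
      rw [← mul_pow, mul_comm, hua]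
    calc algebraMap R L a ^ i * algebraMap R L a ^ (n - i) * u ^ i
        = (algebraMap R L a ^ i * u ^ i) * algebraMap R L a ^ (n - i) := by ring
      _ = algebraMap R L b ^ i * algebraMap R L a ^ (n - i) := by rw [h2]
  calc algebraMap R L (a ^ n) * (algebraMap R L (P.coeff i) * u ^ i)
      = algebraMap R L (P.coeff i) * (algebraMap R L (a ^ n) * u ^ i) := by ring
    _ = algebraMap R L (P.coeff i * b ^ i * a ^ (n - i)) := by
        rw [key, ← map_mul, mul_assoc]

/-- `b` regular modulo `a`, iterated on powers of `b`. -/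
theorem dvd_of_dvd_mul_pow {a b : R} (hb : ∀ r : R, a ∣ r * b → a ∣ r) (m : ℕ) (r : R)
    (h : a ∣ r * b ^ m) : a ∣ r := by
  induction' m with m ih generalizing r
  · simpa using h
  · apply ih
    apply hb
    rwa [mul_assoc, ← pow_succ]

/-- **The kernel of the chart evaluation is `(aX - b)`** for `a` a non-zero-divisor and `b` a
non-zero-divisor modulo `a`. -/
theorem ker_chartEval (a b : R) (ha : a ∈ nonZeroDivisors R)
    (hb : ∀ r : R, a ∣ r * b → a ∣ r) :
    RingHom.ker (chartEval a b).toRingHom = Ideal.span {C a * X - C b} := by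
  classical
  set L := Localization.Away a
  have hinj : Function.Injective (algebraMap R L) :=
    IsLocalization.injective L ((Submonoid.powers_le (P := nonZeroDivisors R)).mpr ha)
  apply le_antisymm
  · suffices h : ∀ n : ℕ, ∀ P : R[X], P.natDegree ≤ n → chartEval a b P = 0 →
        P ∈ Ideal.span {C a * X - C b} by
      intro P hP
      exact h _ P le_rfl (by simpa [RingHom.mem_ker] using hP)
    intro n
    induction' n with n ih
    · intro P hdeg hP
      have hPC : P = C (P.coeff 0) := Polynomial.eq_C_of_natDegree_le_zero hdeg
      rw [hPC, chartEval_C] at hP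
      have hc : P.coeff 0 = 0 := hinj (by rw [hP, map_zero])
      rw [hPC, hc, map_zero]
      exact Ideal.zero_mem _
    · intro P hdeg hP
      -- clear denominators
      have hsum : ∑ i ∈ Finset.range (n + 2), P.coeff i * b ^ i * a ^ (n + 1 - i) = 0 := by
        apply hinj
        rw [map_zero, ← pow_mul_chartEval a b P (n + 1) hdeg, hP, mul_zero]
      -- modulo `a`: `a ∣ c_{n+1} b^{n+1}`
      have hdvd : a ∣ P.coeff (n + 1) * b ^ (n + 1) := by
        rw [Finset.sum_range_succ, Nat.sub_self, pow_zero, mul_one] at hsum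
        have e : P.coeff (n + 1) * b ^ (n + 1) =
            -∑ i ∈ Finset.range (n + 1), P.coeff i * b ^ i * a ^ (n + 1 - i) :=
          eq_neg_of_add_eq_zero_right hsum
        rw [e]
        refine (Finset.dvd_sum fun i hi => ?_).neg_right
        have hi' : i ≤ n := Nat.lt_succ_iff.mp (Finset.mem_range.mp hi)
        have : n + 1 - i = (n - i) + 1 := by omega
        rw [this, pow_succ]
        exact ⟨P.coeff i * b ^ i * a ^ (n - i), by ring⟩
      obtain ⟨c', hc'⟩ := dvd_of_dvd_mul_pow hb (n + 1) _ hdvd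
      -- subtract `c' X^n (aX - b)`
      set Q : R[X] := P - C c' * X ^ n * (C a * X - C b) with hQdef
      have hQ : chartEval a b Q = 0 := by
        rw [hQdef, map_sub, map_mul, chartEval_rel, mul_zero, sub_zero, hP]
      have hexp : C c' * X ^ n * (C a * X - C b) = C (c' * a) * X ^ (n + 1) - C (c' * b) * X ^ n := by
        simp only [map_mul, pow_succ]
        ring
      have hQdeg : Q.natDegree ≤ n := by
        rw [Polynomial.natDegree_le_iff_coeff_eq_zero]
        intro m hm
        rw [hQdef, hexp, coeff_sub, coeff_sub, coeff_C_mul_X_pow, coeff_C_mul_X_pow]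
        have hmn : m ≠ n := by omega
        rw [if_neg hmn, sub_zero]
        by_cases hm1 : m = n + 1
        · subst hm1
          rw [if_pos rfl, hc', mul_comm, sub_self]
        · rw [if_neg hm1, sub_zero]
          apply Polynomial.coeff_eq_zero_of_natDegree_lt
          omega
      have hQmem := ih Q hQdeg hQ
      have hmem : C c' * X ^ n * (C a * X - C b) ∈ Ideal.span {C a * X - C b} :=
        Ideal.mul_mem_left _ _ (Ideal.subset_span rfl)
      have hPQ : P = Q + C c' * X ^ n * (C a * X - C b) := by rw [hQdef]; ring
      rw [hPQ]
      exact Ideal.add_mem _ hQmem hmem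
  · rw [Ideal.span_le, Set.singleton_subset_iff, SetLike.mem_coe, RingHom.mem_ker]
    exact chartEval_rel a b






/-- `R[b/a] ≅ R[X]/(aX - b)` for a regular pair: the range of the chart evaluation is the quotient. -/
noncomputable def quotientEquivRange (a b : R) (ha : a ∈ nonZeroDivisors R)
    (hb : ∀ r : R, a ∣ r * b → a ∣ r) :
    (R[X] ⧸ Ideal.span {C a * X - C b}) ≃+* (chartEval a b).toRingHom.range :=
  (Ideal.quotEquivOfEq (ker_chartEval a b ha hb).symm).trans
    (RingHom.quotientKerEquivRange (chartEval a b).toRingHom)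

/-- In a polynomial ring `S[Y]` over a domain, `Y^p ∣ r · C g₀` with `g₀ ≠ 0` forces `Y^p ∣ r`. -/
theorem X_pow_dvd_of_dvd_mul_C {S : Type*} [CommRing S] [IsDomain S] {g₀ : S} (hg : g₀ ≠ 0)
    (p : ℕ) (r : S[X]) (h : (X : S[X]) ^ p ∣ r * C g₀) : (X : S[X]) ^ p ∣ r := by
  rw [Polynomial.X_pow_dvd_iff] at h ⊢
  intro d hd
  have := h d hd
  rw [Polynomial.coeff_mul_C] at this
  exact (mul_eq_zero.mp this).resolve_right hg

/-- **The twisted-pencil chart.** In `R = k[x₀, …, xₙ]` let `a` correspond to `Y ^ p` and `b` to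
`C g₀` under `R ≃ k[x₁, …, xₙ][Y]` (`MvPolynomial.finSuccEquiv`, `x₀ ↦ Y`), with `g₀ ≠ 0` — i.e.
`a = x₀ ^ p` and `b = g` a non-zero polynomial not involving `x₀`. Then `(a, b)` is a regular pair,
so `R[g/x₀ᵖ] ≅ R[T]/(x₀ᵖ T - g)`: the `x₀ᵖ`-chart of the blow-up of `𝔸ⁿ⁺¹` along `(x₀ᵖ, g)` is
the hypersurface `x₀ᵖ T = g(x₁, …, xₙ)`. -/
theorem ker_chartEval_twistedPencil (k : Type*) [Field k] (n p : ℕ) (g₀ : MvPolynomial (Fin n) k)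
    (hg : g₀ ≠ 0) (a b : MvPolynomial (Fin (n + 1)) k)
    (ha : MvPolynomial.finSuccEquiv k n a = Polynomial.X ^ p)
    (hb : MvPolynomial.finSuccEquiv k n b = Polynomial.C g₀) :
    RingHom.ker (chartEval a b).toRingHom = Ideal.span {C a * X - C b} := by
  apply ker_chartEval
  · apply mem_nonZeroDivisors_of_ne_zero
    intro h0
    have hX : (Polynomial.X : Polynomial (MvPolynomial (Fin n) k)) ^ p = 0 := by
      rw [← ha, h0, map_zero]
    exact pow_ne_zero p Polynomial.X_ne_zero hX
  · intro r h
    obtain ⟨c, hc⟩ := h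
    have h1 : (Polynomial.X : Polynomial (MvPolynomial (Fin n) k)) ^ p ∣
        MvPolynomial.finSuccEquiv k n r * Polynomial.C g₀ := by
      refine ⟨MvPolynomial.finSuccEquiv k n c, ?_⟩
      rw [← hb, ← map_mul, hc, map_mul, ha]
    obtain ⟨d, hd⟩ := X_pow_dvd_of_dvd_mul_C hg p _ h1
    refine ⟨(MvPolynomial.finSuccEquiv k n).symm d, ?_⟩
    apply (MvPolynomial.finSuccEquiv k n).injective
    rw [map_mul, ha, AlgEquiv.apply_symm_apply, ← hd]

/-- The hypotheses of `ker_chartEval_twistedPencil` are met by `a = x₀ ^ p`, `b = e⁻¹ (C g₀)`. -/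
theorem finSuccEquiv_X_zero_pow (k : Type*) [Field k] (n p : ℕ) :
    MvPolynomial.finSuccEquiv k n (MvPolynomial.X 0 ^ p) = Polynomial.X ^ p := by
  rw [map_pow, MvPolynomial.finSuccEquiv_X_zero]


end ChartPair


/-! ## §12 (gen 5) Piltant's axioms, the planner's embedded-LU question, regimes tried

* PILTANT 2013 READ AT PAGE LEVEL (held: `paper:piltant2012-axiomatic-version-zariskis-patching-theorem`
  = RACSAM 107 (2013), doi:10.1007/s13398-012-0090-6). p. 3: "we consider a field `k` of
  arbitrary characteristic `p ≥ 0` and a function field `K` of transcendence degree THREE over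
  `k`" — the whole axiomatic patching theorem (Thm. 2.4: axioms 1–5 ⇒ a projective model with
  `Reg_P(X') = X'`; Prop. 5.1 = two-model patching `πᵢ⁻¹(Reg_P Xᵢ) ⊆ Reg_P Y`) is a
  DIMENSION-THREE framework: Axiom 3 (permissibilizing curves by point blow-ups), Lemma 5.3
  (factorizability above points of dimension two, "by Zariski's theorem on resolution of surface
  singularities by successive normalized blowing ups and theorem 3 [Abhyankar 1956]") and Step 4
  (bad points) are surface theory. p. 1: "the Patching Theorem has never been extended to
  dimensions higher than three (without assuming beforehand the existence of nonsingular
  projective models)"; p. 2: "All of these problems are open in dimension four or more".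
* THE PLANNER'S STANDING QUESTION ("is weak-EMBEDDED LUrel what Piltant's axioms consume?"):
  NO. Axiom 5 (p. 5) is ABSOLUTE WEAK LU — "For each `k`-valuation ring `V/k` of `K`, there exists
  a proper model `X/k` of `K` such that the center `x_V ∈ X` of `V` satisfies `x_V ∈ Reg_P(X)`" —
  weaker than the crux's relative antecedent (relative ⇒ absolute, `patchingRel_of_patching`);
  embeddedness enters Piltant's proof only through Axiom 4 (principalization on normal models,
  RegLe, iso where already principal), discharged in dimension three for `P = P_reg` from
  Cossart–Piltant 2008 Prop. 4.2/4.3 (idealistic exponents with cosupport of dimension `≤ 1` on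
  regular threefolds), i.e. from EMBEDDED RESOLUTION IN THE REGULAR MODEL, not from embedded LU.
  So superseding the crux's antecedent by embedded/monomial LU (Novacoski–Spivakovsky 2014
  Thm. 1.2/1.3 shape) would WEAKEN the crux (stronger hypothesis) without touching its open
  core, which is on the patching side (§4, §8: two-model patching ⇔ RegLe-ification ⇐ the atom);
  and it would break faithfulness (`Res_p ⇒` embedded LU is not formal: it needs principalization
  on the regular model). Recommendation to the planner: keep `PatchingRel` as typed.
* THE LINE versus PILTANT: the machine-checked line (drefute g2 `LineCertificate.lean`; tree
  `SandwichedGluing.resolutionInChar_of_nagata_openGluing_sand`) replaces Piltant's Steps 3–4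
  (dimension three) by the atom SAND⁺ and keeps Step 5 (gluing `V₁ = η'⁻¹(U₁)` and `V₂ = ε⁻¹(U₂)`
  along `U`, p. 26) as `OpenGluing` + `LocalRegLeification`; Piltant's own Step 5 input `ε` is
  produced by Axiom 4 = (T5′)'s shape. So the line is exactly "Piltant in all dimensions with
  Axioms 3–4 replaced by strong resolution of the sandwiched piece" — consistent with §8 (no
  slack above the atom) and with (T5)/(T5′) (the atom dominates Axiom 4 on regular varieties).
* WHERE THE ATOM WOULD COME FROM. Any resolution procedure in characteristic `p` that is
  FUNCTORIAL for open immersions (and returns the identity on regular schemes) yields SAND⁺ at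
  once (restrict the resolution of `V` to the open `Reg V`: by functoriality it is the resolution
  of `Reg V`, the identity) — this is how the characteristic-zero atom follows from Hironaka /
  Bierstone–Milman / Włodarczyk / Kollár, and why Cossart–Piltant 2019 (existential, not
  functorial) had to prove the iso-over-`Reg` clause separately in dimension `3`. So the gap
  `Res_p ⇏ SAND⁺_p` of (N9) is exactly the gap between existential and functorial resolution;
  no counterexample to functoriality-in-char-`p` of this weak kind is known either.
* REGIMES TRIED THIS GENERATION. (H11) dimension slicing — equivalent crux, no refutation.
  (T5) test families for the atom in dimension 4: `uv = g(x,y,z)` (reduces to the marked ideal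
  `(g, 2)` on `𝔸³`: not a counterexample candidate) and `x₁ᵖ t = g(x,y,z)` (beyond the
  literature; no counterexample to strong resolution is known for any of them — none CAN be
  certified short of exhibiting a variety without strong resolution, which would be a
  sensation in its own right). Iso-form two-model patching ("`N → Mᵢ` iso over `Reg Mᵢ` for both
  `i`") is FALSE (two distinct regular models), but nobody's statement asserts it: the tree's
  `TwoModelPatching` is Piltant's RegLe form. Literature: `lit search` (searchd) rc 75 again at
  02:10Z; `lit galaxy search` (pdf corpus, intelligent mode, 2 queries: LU ⇒ resolution in
  dimension ≥ 4 / obstructions to strong resolution of sandwiched or blown-up regular varieties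
  in characteristic `p`) — 45 rows, none bearing (Cutkosky 2006 dim-3 `p > 5`, Kawanoue–Matsuki
  IFP, ATW relative principalization in char 0, Belotto–Bierstone partial desingularization in
  char 0, surveys); OpenAlex/S2 HTTP 429; zbMATH "local uniformization" 2020–2026 (30 rows):
  the two bearing items CONFIRM the record — Teissier 2023 (arXiv:2311.12456, p. 6, Problem C:
  "Prove that those torific embeddings can be combined into one embedding for Spec R where a
  toric birational map will simultaneously uniformize all valuations and thus provide a local
  embedded resolution of singularities for R" — the patching step is the named OPEN problem of
  his programme, after quasi-compactness of the Riemann–Zariski space gives finitely many local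
  uniformizations) and Temkin 2024 (J. Algebra 646 = arXiv:2301.09160, p. 2: "for threefolds this
  implies global resolution [Zar44] … The case of dim(X) = 3 is the deepest case established so
  far, and global resolution of qe threefolds was deduced from it"; Cutkosky 2022 (Abhyankar
  valuations) and Knaf–Kuhlmann 2026 (arXiv:2606.01310) concern LU, not patching). Standing
  record unchanged: no printed obstruction to patching or to strong resolution in any
  dimension/characteristic; the implication LU ⇒ resolution in dimension `≥ 4` is recorded as
  OPEN by every source (Piltant 2013 p. 1–2, Cutkosky–Mourtada 2019 p. 3, Temkin 2013 §1.2,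
  Teissier 2023 Problem C, Temkin 2024 p. 2).
-/


/-! ## §13 (gen 5) The role of LU, given patching: one regular model per function field

(N10) Replacing the LU conjunct of (N8) `Res_p ⟺ TwoModelPatching_p ∧ LUrel_p` by the weakest
GLOBAL statement — Zariski's 1944 "existence of a nonsingular model", `OneRegModel_p`: every
function field of characteristic `p` with a proper model has a REGULAR proper model (Piltant
2013, Thm. 2.4) — gives `Res_p ⟺ TwoModelPatching_p ∧ OneRegModel_p`
(`res_iff_tmp_and_oneRegModel`, no local uniformization anywhere: patch any model with the
regular one). With (N5) (`PatchingRel ⟺ ∀ p, LUrel_p → TwoModelPatching_p`) and Zariski's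
resolving-system theorem (`oneRegModel_of_lurel_of_tmp`) this pins the division of labour in
the crux: GIVEN two-model patching, the hypothesis `LUrel_p` is consumed exactly once, to
manufacture one regular proper model per function field; everything else is patching. For a
refutation nothing changes (all three statements are implied by `Res_p`). Landing as
`Literature/…/ProperModelsRegModel.lean` (names `ProperModel.RegModel`, `…_regModel`).

Remark (not formalised: `ℙⁿ` as a `ProperModel` of `k(x₁,…,xₙ)` is chart bookkeeping). For a
PURELY TRANSCENDENTAL `K` the regular model exists for free (`ℙⁿ_k`, `isRegular_projectiveSpace`),
so `TwoModelPatching_p` ALONE — hence, through the line, the atom SAND⁺ with Nagata and open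
gluing — yields weak resolution of EVERY RATIONAL variety of characteristic `p` in every
dimension, with no local uniformization at all: a class containing every hypersurface
`B(x)·t = A(x)` linear in one variable (the sandwiched charts of §11 and their degenerations with
`(B, A)` not a regular sequence). This is the cleanest statement of how much the "soft" global
crux's atom carries: resolution of all rational fourfolds in characteristic `p` is not in print.
-/

section OneRegModel

open AlgebraicGeometry Literature.AlgebraicGeometry.Resolution.ProperModel

/-- `RegModel_p`: every function field (essentially of finite type) over a field of characteristic
`p` which has a proper model has a REGULAR proper model — Zariski's 1944 formulation "existence of
a nonsingular model" (Piltant 2013, Thm. 2.4: conclusion `Reg_P(X') = X'`), the weakest global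
statement; implied by `ResolutionInChar p`. -/
def OneRegModel (p : ℕ) : Prop :=
  ∀ (k : Type u) [Field k] [CharP k p] (K : Type u) [Field K] [Algebra k K]
    [Algebra.EssFiniteType k K], Nonempty (ProperModel k K) →
      ∃ N : ProperModel k K, Scheme.IsRegular N.X

/-- (N10) **Two-model patching reduces resolution of ALL proper models to the existence of ONE
regular model**: `TwoModelPatching p → OneRegModel p → ∀ M, HasResolution M.X` (patch `M` with the regular
model; the patch is regular because it is `RegLe` over a regular model). [folklore] -/
theorem hasResolution_of_tmp_of_oneRegModel {p : ℕ} (hT : TwoModelPatching.{u} p)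
    (hR : OneRegModel.{u} p) {k : Type u} [Field k] [CharP k p] {K : Type u} [Field K] [Algebra k K]
    [Algebra.EssFiniteType k K] (M : ProperModel k K) : Scheme.HasResolution M.X := by
  obtain ⟨U, hU⟩ := hR k K ⟨M⟩
  obtain ⟨N, φ₁, φ₂, -, h₂⟩ := hT k K M U
  have hN : Scheme.IsRegular N.X := fun n => h₂ n (hU _)
  exact φ₁.hasResolution hN

/-- (N10) `ResolutionInChar p ⇒ OneRegModel p` (resolve any proper model). [folklore] -/
theorem oneRegModel_of_res {p : ℕ} (h : ResolutionInChar.{u} p) : OneRegModel.{u} p := by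
  intro k _ _ K _ _ _ hM
  obtain ⟨M⟩ := hM
  obtain ⟨N, -, hN⟩ := exists_hom_isRegular_of_hasResolution' M
    (h k M.X M.π inferInstance inferInstance inferInstance inferInstance)
  exact ⟨N, hN⟩

/-- (N10) **Resolution of an integral projective variety from two-model patching and ONE regular model
of its function field** (no local uniformization): the variety is a proper model of its function
field (`ProjModel.ofChart`), patched with the regular model. [folklore] -/
theorem hasResolution_of_tmp_of_oneRegModel_projective {p : ℕ} {k : Type u} [Field k]
    [CharP k p] (hT : TwoModelPatching.{u} p) (hR : OneRegModel.{u} p)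
    {n : ℕ} (X : Scheme.{u}) [IsIntegral X]
    (ι : X ⟶ (Literature.AlgebraicGeometry.Motives.projectiveSpace n k).left) [IsClosedImmersion ι] :
    Scheme.HasResolution X := by
  classical
  haveI : IsProper (Literature.AlgebraicGeometry.Motives.projectiveSpace n k).hom := Literature.AlgebraicGeometry.Motives.isProper_projectiveSpace n k
  let πX : X ⟶ Spec (.of k) := ι ≫ (Literature.AlgebraicGeometry.Motives.projectiveSpace n k).hom
  have hproj : Literature.AlgebraicGeometry.Motives.IsProjectiveOver (Over.mk πX) := ⟨n, Over.homMk ι rfl, ‹_›⟩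
  haveI : LocallyOfFiniteType πX := inferInstance
  obtain ⟨_, ⟨U', hU', rfl⟩, hηU, -⟩ := X.isBasis_affineOpens.exists_subset_of_mem_open
    (Set.mem_univ (genericPoint X)) isOpen_univ
  let U : X.Opens := U'
  have hU : IsAffineOpen U := hU'
  haveI : IsAffine U := hU
  haveI : Nonempty U := ⟨⟨_, hηU⟩⟩
  let A : Type u := Γ(U, ⊤)
  let g : (U : Scheme.{u}) ⟶ Spec (.of k) := U.ι ≫ πX
  let ψ : k →+* A := g.appTop.hom.comp (Scheme.ΓSpecIso (.of k)).inv.hom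
  have hψ : ψ.FiniteType := by
    have h1 : g.appTop.hom.FiniteType :=
      (HasRingHomProperty.iff_of_isAffine (P := @LocallyOfFiniteType)).mp inferInstance
    exact h1.comp (RingHom.FiniteType.of_surjective _
      (Scheme.ΓSpecIso (.of k)).symm.commRingCatIsoToRingEquiv.surjective)
  letI : Algebra k A := ψ.toAlgebra
  haveI hft : Algebra.FiniteType k A := hψ
  let K : Type u := FractionRing A
  let j : Spec (.of A) ⟶ X := U.toScheme.isoSpec.inv ≫ U.ι
  have hj : j ≫ πX = Spec.map (CommRingCat.ofHom (algebraMap k A)) := by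
    change (U.toScheme.isoSpec.inv ≫ U.ι) ≫ πX = Spec.map (CommRingCat.ofHom ψ)
    rw [Category.assoc, isoSpec_inv_comp]
    rfl
  let M₀ : ProjModel k K := ProjModel.ofChart (K := K) X πX hproj A j hj
  haveI : Algebra.EssFiniteType k K := inferInstance
  exact hasResolution_of_tmp_of_oneRegModel hT hR M₀.toProperModel

/-- (N10) **Resolution in characteristic `p` from two-model patching and the existence of regular
models** (no local uniformization hypothesis): reduction to the integral projective case by
`ResolutionOverUpToDim.of_projective`. [folklore] -/
theorem res_of_tmp_of_oneRegModel {p : ℕ} (hT : TwoModelPatching.{u} p)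
    (hR : OneRegModel.{u} p) : ResolutionInChar.{u} p := by
  intro k _ _ X f hs hl hq hr
  haveI : QuasiCompact f := hq
  haveI : LocallyOfFiniteType f := hl
  haveI : CompactSpace X := QuasiCompact.compactSpace_of_compactSpace f
  obtain ⟨d, hd⟩ := exists_topologicalKrullDim_le_of_locallyOfFiniteType f
  refine (ResolutionOverUpToDim.of_projective (k := k) (d := d) fun m Y ι hι hY _ => ?_)
    X f hs hl hq hr hd
  haveI := hι
  haveI := hY
  exact hasResolution_of_tmp_of_oneRegModel_projective hT hR Y ι

/-- (N10) **`ResolutionInChar p ⟺ TwoModelPatching p ∧ OneRegModel p`**: under two-model patching,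
resolution of singularities in characteristic `p` is EQUIVALENT to Zariski's "every function
field has a nonsingular proper model" — so in the crux `PatchingRel` (`LUrel_p → Res_p`, whose
open core is `TwoModelPatching`, `resolutionInChar_iff_twoModelPatching_and_relLU`) local
uniformization is needed only to manufacture ONE regular model per function field
(Zariski 1944 / Piltant 2013, Thm. 2.4). [folklore] -/
theorem res_iff_tmp_and_oneRegModel (p : ℕ) :
    ResolutionInChar.{u} p ↔ TwoModelPatching.{u} p ∧ OneRegModel.{u} p :=
  ⟨fun h => ⟨twoModelPatching_of_res h, oneRegModel_of_res h⟩,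
    fun h => res_of_tmp_of_oneRegModel h.1 h.2⟩


/-- (N11) **Given two-model patching, LU manufactures the regular model** (Zariski 1944 /
Piltant 2013, Thm. 2.4, via the tree's resolving-system theorem
`resolutionInChar_of_properTwoModelPatching_of_relLU` and (N10)). -/
theorem oneRegModel_of_lurel_of_tmp {p : ℕ} (hT : TwoModelPatching.{0} p) (hLU : LUrel p) :
    OneRegModel.{0} p :=
  oneRegModel_of_res (resolutionInChar_of_properTwoModelPatching_of_relLU hT hLU)

end OneRegModel


/-! ## §14 (gen 6) The RESHAPED atom SANDʷ is two-model patching in a costume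

The gen-1 lead (PICKED.md 2026-08-16T03:47Z) reshapes the line: S3+S4+S7 are replaced by
S3′ `∀ p, SANDʷ p → LocalRegLeification p` ("apply the atom to `O := Reg M ∪ φ⁻¹(Reg Y)`
itself, no gluing") and S7′ `∀ p prime, SANDʷ p`, where SANDʷ(p) — his
`SandwichedSingularitiesResolution p`, not yet in the tree at 04:25Z; transcribed below as
`SandwichedWeakResolution p` with every hypothesis spelled out — says: an integral separated
finite-type `X/k`, `char k = p`, regular outside an open `V` that is proper and birational over
a REGULAR integral separated finite-type `U`, has a WEAK resolution. This section settles the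
position of the new atom (all kernel-checked; the Literature copy is
`Literature/AlgebraicGeometry/Resolution/SandwichedWeakPatching.lean`, the mutations
`Theorems/PatchingRel/Negative/SandwichedWeakMutations.lean`, both proposed this generation):

* (W1) `sandwichedWeak_of_res` — `Res_p ⇒ SANDʷ_p`: the new atom is implied by the summit
  slice, hence IRREFUTABLE short of a counterexample to resolution (as SAND⁺ was short of one
  to strong resolution); none of its hypotheses is load-bearing for truth.
* (W2a–c) `sandwichedWeakNoRegU_iff_res`, `sandwichedWeakNoBir_iff_res`,
  `sandwichedWeakNoOutside_iff_res` — but EACH of the three structural hypotheses ("`U`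
  regular", "`η` birational", "`X` regular outside `V`"), dropped ALONE, turns SANDʷ into
  `Res_p` VERBATIM: the sandwiched class is carved by all three jointly; relaxing any one of
  them asks for the summit slice itself.
* (W3) `sandwichedWeak_of_twoModelPatching` — **THE COSTUME THEOREM: `Nagata → TMP_p →
  SANDʷ_p`**, with NO local uniformization: compactify `X` and `U` to proper models of the
  common function field (common chart in the iso-locus of `η`), patch them (Piltant's
  two-model patching, `N → P_X`, `N → P_U` both `RegLe`), restrict `N → P_X` over `X`; points
  over `X ∖ V ⊆ Reg X` are regular by the first `RegLe`, points over `V` go to `U ⊆ Reg P_U`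
  under the second projection (two morphisms `N|_V → P_U` agreeing on the dominant `K`-point
  are equal: reduced source, separated target), hence are regular by the second `RegLe`.
* (N12) `localRegLeification_of_regLeification`, `localRegLeification_iff_twoModelPatching` —
  modulo Nagata the line's three upper statements COINCIDE:
  `LocalRegLeification_p ↔ TwoModelPatching_p ↔ RegLeification_p`.
* (W4) Hence, modulo Nagata and the lead's S3′: `sandwichedWeak_iff_twoModelPatching` —
  **SANDʷ_p ↔ TMP_p** (the reshaped atom IS Piltant's two-model patching problem, Piltant
  2013 Prop. 5.1 / p. 2, open in dimension `≥ 4` since Zariski 1944 — a costume, not a new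
  statement); `sandwichedWeak_of_sand` — SAND⁺_p ⇒ SANDʷ_p (nothing built is lost);
  `patchingRel_iff_lurel_imp_sandwichedWeak`, `res_iff_sandwichedWeak_and_lurel` — the
  reshaped line has NO SLACK (crux ⇔ `∀ p prime, LUrel_p → SANDʷ_p`;
  `Res_p ⇔ SANDʷ_p ∧ LUrel_p`), exactly as §8 for the old cut;
  `res_iff_sandwichedWeak_and_regModel` — and NO GAIN over §13: `Res_p ⇔ SANDʷ_p ∧ RegModel_p`,
  so SANDʷ alone (like TMP alone) resolves every variety whose function field has a regular
  proper model, e.g. every rational variety, and needs LU only to manufacture that model.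
* (W5) `sandwichedWeak_dimLe3` — the dimension-`≤ 3` case of SANDʷ is the WEAK named fact
  `CossartPiltant2019` verbatim (the lead's (iii) confirmed): the residual open content of the
  reshaped atom is "weak resolution of sandwiched-singularity varieties of dimension `≥ 4` in
  characteristic `p`" = "two-model patching of proper fourfold-and-up models".
* (W6) `localRegLeification_of_sandwichedWeak` — THE LEAD'S STUB S3′ ITSELF, PROVED (~60 lines:
  `O := Reg M ∪ φ⁻¹(Reg Y)` IS a sandwiched-singularity variety; its weak resolution is regular
  everywhere; no gluing), so (W6′) `sandwichedWeak_iff_twoModelPatching'` — **`SANDʷ_p ↔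
  TwoModelPatching_p` modulo Nagata ALONE**, and the reshaped line is closed modulo
  {Nagata, ∀ p prime SANDʷ_p} exactly as the old one was modulo {Nagata, ∀ p prime SAND⁺_p}.

RECOMMENDATION (to lead/planner, recorded here and in the evidence note): S3′ needs no prover
time (W6; Literature copy `ProperModel.localRegLeification_of_sandwichedWeakResolution`). If S7′
is promoted to a crux, the honest residual is Piltant's two-model patching of proper models in
characteristic `p` — `∀ p prime, ProperModel.TwoModelPatching.{0} p` (literature-anchored:
Piltant 2013 Prop. 5.1 with `P = P_reg`; open in dimension `≥ 4` since Zariski 1944) — of which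
SANDʷ is an EQUIVALENT geometric dress (W6′) and `LUrel_p → TwoModelPatching_p` the faithful
(crux-equivalent, (N5)) form; the geometric form is the one to attack by resolution methods, the
model form the one to cite.
-/

noncomputable section SandwichedWeak

open AlgebraicGeometry TopologicalSpace IsLocalRing
open Literature.AlgebraicGeometry.Morphisms Literature.AlgebraicGeometry.Resolution.ProperModel


/-- **SANDʷ(p)** — weak resolution of varieties with SANDWICHED singular locus (transcription of
the gen-1 lead's `SandwichedSingularitiesResolution`, PICKED.md 2026-08-16T03:47Z, with every
hypothesis spelled out): `X` integral separated of finite type over a field `k` of characteristic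
`p`, regular outside an open `V ⊆ X` which is proper and birational, over `k`, onto a REGULAR
integral separated finite-type `U`; then `X` has a (weak) resolution. -/
def SandwichedWeakResolution (p : ℕ) : Prop :=
  ∀ (k : Type u) [Field k] [CharP k p] (X U : Scheme.{u}) (f : X ⟶ Spec (.of k))
    (g : U ⟶ Spec (.of k)) (V : X.Opens) (η : (V : Scheme.{u}) ⟶ U),
    IsSeparated f → LocallyOfFiniteType f → QuasiCompact f → IsIntegral X →
    IsSeparated g → LocallyOfFiniteType g → QuasiCompact g → IsIntegral U →
    Scheme.IsRegular U → IsProper η → IsBirational η → η ≫ g = V.ι ≫ f →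
    (∀ x : X, x ∉ V → IsRegularLocalRing (X.presheaf.stalk x)) →
      Scheme.HasResolution X

/-- (W1) `Res_p ⇒ SANDʷ_p` (a sandwiched variety is a variety). -/
theorem sandwichedWeak_of_res {p : ℕ} (h : ResolutionInChar.{u} p) :
    SandwichedWeakResolution.{u} p := by
  intro k _ _ X U f g V η hfs hfl hfq hX _ _ _ _ _ _ _ _ _
  exact h k X f hfs hfl hfq inferInstance

/-! ### (W2) Each structural hypothesis, dropped alone, turns SANDʷ into `Res_p` verbatim -/

/-- SANDʷ without `Scheme.IsRegular U`. -/
def SandwichedWeakNoRegU (p : ℕ) : Prop :=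
  ∀ (k : Type u) [Field k] [CharP k p] (X U : Scheme.{u}) (f : X ⟶ Spec (.of k))
    (g : U ⟶ Spec (.of k)) (V : X.Opens) (η : (V : Scheme.{u}) ⟶ U),
    IsSeparated f → LocallyOfFiniteType f → QuasiCompact f → IsIntegral X →
    IsSeparated g → LocallyOfFiniteType g → QuasiCompact g → IsIntegral U →
    IsProper η → IsBirational η → η ≫ g = V.ι ≫ f →
    (∀ x : X, x ∉ V → IsRegularLocalRing (X.presheaf.stalk x)) →
      Scheme.HasResolution X

/-- SANDʷ without `IsBirational η`. -/
def SandwichedWeakNoBir (p : ℕ) : Prop :=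
  ∀ (k : Type u) [Field k] [CharP k p] (X U : Scheme.{u}) (f : X ⟶ Spec (.of k))
    (g : U ⟶ Spec (.of k)) (V : X.Opens) (η : (V : Scheme.{u}) ⟶ U),
    IsSeparated f → LocallyOfFiniteType f → QuasiCompact f → IsIntegral X →
    IsSeparated g → LocallyOfFiniteType g → QuasiCompact g → IsIntegral U →
    Scheme.IsRegular U → IsProper η → η ≫ g = V.ι ≫ f →
    (∀ x : X, x ∉ V → IsRegularLocalRing (X.presheaf.stalk x)) →
      Scheme.HasResolution X

/-- SANDʷ without "`X` is regular outside `V`". -/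
def SandwichedWeakNoOutside (p : ℕ) : Prop :=
  ∀ (k : Type u) [Field k] [CharP k p] (X U : Scheme.{u}) (f : X ⟶ Spec (.of k))
    (g : U ⟶ Spec (.of k)) (V : X.Opens) (η : (V : Scheme.{u}) ⟶ U),
    IsSeparated f → LocallyOfFiniteType f → QuasiCompact f → IsIntegral X →
    IsSeparated g → LocallyOfFiniteType g → QuasiCompact g → IsIntegral U →
    Scheme.IsRegular U → IsProper η → IsBirational η → η ≫ g = V.ι ≫ f →
      Scheme.HasResolution X

/-- The identity of `X`, read as `(⊤ : X.Opens) → X`, is birational. -/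
theorem isBirational_topι (X : Scheme.{u}) : IsBirational (⊤ : X.Opens).ι := by
  have e : (⊤ : X.Opens).ι = (Scheme.topIso X).hom := rfl
  refine ⟨⊤, by simp, ?_, ?_⟩
  · simp
  · rw [e]; infer_instance

/-- Resolution of PROPER integral schemes of finite type in characteristic `p` suffices for
`Res_p` (Chow + projective closure, tree `ResolutionOverUpToDim.of_projective`). -/
theorem res_of_proper {p : ℕ}
    (h : ∀ (k : Type u) [Field k] [CharP k p] (X : Scheme.{u}) (f : X ⟶ Spec (.of k)),
      IsProper f → IsIntegral X → Scheme.HasResolution X) :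
    ResolutionInChar.{u} p := by
  intro k _ _ X f hs hl hq hr
  haveI : QuasiCompact f := hq
  haveI : LocallyOfFiniteType f := hl
  haveI : CompactSpace X := QuasiCompact.compactSpace_of_compactSpace f
  obtain ⟨d, hd⟩ := exists_topologicalKrullDim_le_of_locallyOfFiniteType f
  refine (ResolutionOverUpToDim.of_projective (k := k) (d := d) fun n Y ι hι hY _ => ?_)
    X f hs hl hq hr hd
  haveI := hι
  haveI := hY
  haveI : IsProper (Literature.AlgebraicGeometry.Motives.projectiveSpace n k).hom :=
    Literature.AlgebraicGeometry.Motives.isProper_projectiveSpace n k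
  exact h k Y (ι ≫ (Literature.AlgebraicGeometry.Motives.projectiveSpace n k).hom)
    inferInstance hY

/-- (W2a) Dropping regularity of the base `U`: take `U := X`, `V := ⊤`, `η := id`. So
`SANDʷ` without `IsRegular U` IS `Res_p` (integral form ⇔ `Res_p`, tree
`resolutionInChar_iff_integral`). -/
theorem sandwichedWeakNoRegU_iff_res (p : ℕ) :
    SandwichedWeakNoRegU.{u} p ↔ ResolutionInChar.{u} p := by
  constructor
  · intro h
    rw [resolutionInChar_iff_integral]
    intro k _ _ X f hfs hfl hfq hX
    haveI := hfs; haveI := hfl; haveI := hfq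
    have e : (⊤ : X.Opens).ι = (Scheme.topIso X).hom := rfl
    haveI : IsIso (⊤ : X.Opens).ι := by rw [e]; infer_instance
    refine h k X X f f ⊤ (⊤ : X.Opens).ι hfs hfl hfq hX hfs hfl hfq hX inferInstance
      (isBirational_topι X) rfl ?_
    intro x hx
    exact absurd (Set.mem_univ x) hx
  · intro h k _ _ X U f g V η hfs hfl hfq hX _ _ _ _ _ _ _ _
    exact h k X f hfs hfl hfq inferInstance

/-- (W2b) Dropping birationality of `η`: take `U := Spec k`, `V := ⊤`, `η := f` for PROPER `X`.
So `SANDʷ` without `IsBirational η` IS `Res_p`. -/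
theorem sandwichedWeakNoBir_iff_res (p : ℕ) :
    SandwichedWeakNoBir.{u} p ↔ ResolutionInChar.{u} p := by
  constructor
  · intro h
    refine res_of_proper fun k _ _ X f hf hX => ?_
    haveI := hf
    haveI : IsRegularRing k := inferInstance
    have e : (⊤ : X.Opens).ι = (Scheme.topIso X).hom := rfl
    haveI : IsIso (⊤ : X.Opens).ι := by rw [e]; infer_instance
    refine h k X (Spec (.of k)) f (𝟙 _) ⊤ ((⊤ : X.Opens).ι ≫ f) inferInstance inferInstance
      inferInstance hX inferInstance inferInstance inferInstance inferInstance
      (Scheme.isRegular_Spec (.of k)) inferInstance (by simp) ?_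
    intro x hx
    exact absurd (Set.mem_univ x) hx
  · intro h k _ _ X U f g V η hfs hfl hfq hX _ _ _ _ _ _ _ _
    exact h k X f hfs hfl hfq inferInstance

/-- (W2c) Dropping "`X` regular outside `V`": take `V := U :=` the regular locus of `X` (open —
tree `isOpen_regularLocus_of_locallyOfFiniteType_field` — and non-empty: the generic stalk is a
field), `η := id`. So `SANDʷ` without that clause IS `Res_p`. -/
theorem sandwichedWeakNoOutside_iff_res (p : ℕ) :
    SandwichedWeakNoOutside.{u} p ↔ ResolutionInChar.{u} p := by
  constructor
  · intro h
    rw [resolutionInChar_iff_integral]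
    intro k _ _ X f hfs hfl hfq hX
    haveI := hfs; haveI := hfl; haveI := hfq
    haveI : IsLocallyNoetherian X := LocallyOfFiniteType.isLocallyNoetherian f
    haveI : CompactSpace X := QuasiCompact.compactSpace_of_compactSpace f
    haveI : IsNoetherian X := {}
    let R : X.Opens := ⟨Scheme.regularLocus X, isOpen_regularLocus_of_locallyOfFiniteType_field f⟩
    have hRreg : Scheme.IsRegular (R : Scheme.{u}) := by
      intro x
      rw [SandwichedGluing.mem_regularLocus_opens_iff]
      exact x.2
    -- the generic point is regular, so `R` is non-empty
    have hgen : genericPoint X ∈ R := by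
      change IsRegularLocalRing X.functionField
      infer_instance
    haveI : Nonempty (R : Scheme.{u}) := ⟨⟨_, hgen⟩⟩
    haveI : IsIntegral (R : Scheme.{u}) := isIntegral_of_isOpenImmersion R.ι
    refine h k X R f (R.ι ≫ f) R (𝟙 _) hfs hfl hfq hX inferInstance inferInstance inferInstance
      inferInstance hRreg inferInstance ⟨⊤, by simp, by simp, inferInstance⟩ (by simp)
  · intro h k _ _ X U f g V η hfs hfl hfq hX _ _ _ _ _ _ _ _
    exact h k X f hfs hfl hfq inferInstance


/-! ### (W3) The costume theorem: two-model patching + Nagata ⇒ SANDʷ -/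

section Costume

variable {k : Type u} [Field k] {K : Type u} [Field K] [Algebra k K]

/-- A PROPER integral `k`-scheme with an affine chart `Spec A ↪ X`, `Frac A = K`, is a proper
model of `K/k` (the proper twin of the tree's `ProjModel.ofChart`, same proof). -/
abbrev properModelOfChart (X : Scheme.{u}) [IsIntegral X] (πX : X ⟶ Spec (.of k)) [IsProper πX]
    (A : Type u) [CommRing A] [IsDomain A] [Algebra k A] [Algebra A K] [IsScalarTower k A K]
    [IsFractionRing A K] (j : Spec (.of A) ⟶ X) [IsOpenImmersion j]
    (hj : j ≫ πX = Spec.map (CommRingCat.ofHom (algebraMap k A))) : ProperModel k K where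
  X := X
  π := πX
  gen := Spec.map (CommRingCat.ofHom (algebraMap A K)) ≫ j
  gen_π := by
    rw [Category.assoc, hj, ← Spec.map_comp, ← CommRingCat.ofHom_comp,
      ← IsScalarTower.algebraMap_eq]
  isIntegral := ‹_›
  isProper := ‹_›
  genericPt_eq := by
    rw [Scheme.Hom.comp_apply, specMap_closedPoint_eq_genericPoint A K
      (IsFractionRing.injective A K)]
    exact genericPoint_eq_of_isOpenImmersion j
  isIso_stalkClosedPointTo := by
    rw [Scheme.stalkClosedPointTo_comp]
    have h : ∀ x, IsIso (j.stalkMap x) := fun x => inferInstance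
    exact IsIso.comp_isIso' (h _) (isIso_stalkClosedPointTo_of_isFractionRing A K)

/-- An integral separated finite-type `k`-scheme is a dense open of an integral PROPER
`k`-scheme (Nagata + scheme-theoretic closure). -/
theorem exists_integral_compactification (hN : NagataCompactification.{u}) (X : Scheme.{u})
    [IsIntegral X] (f : X ⟶ Spec (.of k)) [IsSeparated f] [LocallyOfFiniteType f]
    [QuasiCompact f] :
    ∃ (Xb : Scheme.{u}) (s : X ⟶ Xb) (π : Xb ⟶ Spec (.of k)), IsIntegral Xb ∧
      IsOpenImmersion s ∧ IsProper π ∧ s ≫ π = f := by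
  obtain ⟨Xc, jc, fc, hjc, hfc, hfac⟩ := hN X (Spec (.of k)) f
  haveI := hjc
  haveI := hfc
  haveI : IsLocallyNoetherian X := LocallyOfFiniteType.isLocallyNoetherian f
  haveI : CompactSpace X := QuasiCompact.compactSpace_of_compactSpace f
  haveI : IsNoetherian X := {}
  obtain ⟨Xb, c, s, hXb, hc, hsc, hs, -, -⟩ :=
    exists_graphClosure_compactification jc (𝟙 Xc) jc (Category.comp_id jc)
  haveI : IsProper (c ≫ 𝟙 Xc) := inferInstance
  haveI := hXb
  haveI := hc
  haveI := hs
  refine ⟨Xb, s, c ≫ fc, hXb, hs, inferInstance, ?_⟩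
  rw [← Category.assoc, hsc, hfac]

set_option maxHeartbeats 1600000 in
/-- **(W3) The costume theorem.** Two-model patching of proper models (Piltant 2013, Prop. 5.1
shape, `ProperModel.TwoModelPatching`) and Nagata compactification imply SANDʷ: compactify `X`
and `U` to proper models `P_X ⊇ X`, `P_U ⊇ U` of the common function field (common affine chart
inside the iso-locus of `η`), patch them (`N → P_X`, `N → P_U` both `RegLe`), and restrict
`N → P_X` over `X`: a point over `X ∖ V ⊆ Reg X` is regular by `RegLe` of the first projection; a
point over `V` maps to `U ⊆ Reg P_U` under the second projection (the two maps
`N|_V → P_U` agree generically, hence everywhere: reduced source, separated target), so it is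
regular by `RegLe` of the second. No local uniformization is used. -/
theorem sandwichedWeak_of_twoModelPatching {p : ℕ} (hN : NagataCompactification.{u})
    (hT : TwoModelPatching.{u} p) : SandwichedWeakResolution.{u} p := by
  intro k _ _ X U f g V η hfs hfl hfq hX hgs hgl hgq hU hUreg hηp hbir hcomm hreg
  haveI := hfs; haveI := hfl; haveI := hfq; haveI := hX
  haveI := hgs; haveI := hgl; haveI := hgq; haveI := hU; haveI := hηp
  classical
  by_cases hV : (V : Set X).Nonempty
  swap
  · -- `V = ∅`: `X` is regular, hence its own resolution
    exact Scheme.IsRegular.hasResolution fun x => hreg x fun hx => hV ⟨x, hx⟩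
  /- Step 1: an affine chart `Spec A` of `U` inside the iso-locus `Oη` of `η`. -/
  obtain ⟨Oη, hOηd, -, hOηiso⟩ := hbir
  haveI := hOηiso
  obtain ⟨x₀, hx₀⟩ := hV
  haveI : Nonempty U := ⟨η ⟨x₀, hx₀⟩⟩
  obtain ⟨u₀, hu₀⟩ := hOηd.nonempty
  obtain ⟨_, ⟨W', hW, rfl⟩, hu₀W, hWO⟩ :=
    U.isBasis_affineOpens.exists_subset_of_mem_open hu₀ Oη.isOpen
  let W : U.Opens := W'
  haveI : IsAffine W := hW
  haveI : Nonempty W := ⟨⟨u₀, hu₀W⟩⟩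
  have hWO' : W ≤ Oη := hWO
  let A : Type u := Γ(W, ⊤)
  let gW : (W : Scheme.{u}) ⟶ Spec (.of k) := W.ι ≫ g
  let ψ : k →+* A := gW.appTop.hom.comp (Scheme.ΓSpecIso (.of k)).inv.hom
  have hψ : ψ.FiniteType := by
    have h1 : gW.appTop.hom.FiniteType :=
      (HasRingHomProperty.iff_of_isAffine (P := @LocallyOfFiniteType)).mp inferInstance
    exact h1.comp (RingHom.FiniteType.of_surjective _
      (Scheme.ΓSpecIso (.of k)).symm.commRingCatIsoToRingEquiv.surjective)
  letI : Algebra k A := ψ.toAlgebra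
  haveI hft : Algebra.FiniteType k A := hψ
  let K : Type u := FractionRing A
  haveI : Algebra.EssFiniteType k K := inferInstance
  -- the chart of `U` (an opaque name `jU` for `Spec A ≅ W ⊆ U`)
  obtain ⟨jU, hjUdef⟩ : ∃ jU : Spec (.of A) ⟶ U, jU = W.toScheme.isoSpec.inv ≫ W.ι := ⟨_, rfl⟩
  haveI : IsOpenImmersion jU := by rw [hjUdef]; infer_instance
  have hjU : jU ≫ g = Spec.map (CommRingCat.ofHom (algebraMap k A)) := by
    rw [hjUdef, Category.assoc, isoSpec_inv_comp]
    rfl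
  -- the chart of `X`: `Spec A ≅ W ≅ η⁻¹ W ⊆ V ⊆ X`
  haveI hηW : IsIso (η ∣_ W) := isIso_morphismRestrict_of_le η hOηiso hWO'
  let jV : Spec (.of A) ⟶ (V : Scheme.{u}) :=
    W.toScheme.isoSpec.inv ≫ inv (η ∣_ W) ≫ (η ⁻¹ᵁ W).ι
  have hjVη : jV ≫ η = jU := by
    rw [hjUdef]
    change (W.toScheme.isoSpec.inv ≫ inv (η ∣_ W) ≫ (η ⁻¹ᵁ W).ι) ≫ η =
      W.toScheme.isoSpec.inv ≫ W.ι
    rw [Category.assoc, Category.assoc, ← morphismRestrict_ι, IsIso.inv_hom_id_assoc]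
  obtain ⟨jX, hjXdef⟩ : ∃ jX : Spec (.of A) ⟶ X, jX = jV ≫ V.ι := ⟨_, rfl⟩
  haveI : IsOpenImmersion jX := by rw [hjXdef]; infer_instance
  have hjX : jX ≫ f = Spec.map (CommRingCat.ofHom (algebraMap k A)) := by
    rw [hjXdef, Category.assoc, ← hcomm, ← Category.assoc, hjVη, hjU]
  /- Step 2: integral proper compactifications and the two proper models of `K`. -/
  obtain ⟨Ub, sU, πU, hUb, hsU, hπU, hsUπ⟩ := exists_integral_compactification hN U g
  obtain ⟨Xb, sX, πX, hXb, hsX, hπX, hsXπ⟩ := exists_integral_compactification hN X f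
  haveI := hUb; haveI := hsU; haveI := hπU; haveI := hXb; haveI := hsX; haveI := hπX
  have hcU : (jU ≫ sU) ≫ πU = Spec.map (CommRingCat.ofHom (algebraMap k A)) := by
    rw [Category.assoc, hsUπ, hjU]
  have hcX : (jX ≫ sX) ≫ πX = Spec.map (CommRingCat.ofHom (algebraMap k A)) := by
    rw [Category.assoc, hsXπ, hjX]
  /- Step 3: patch. -/
  obtain ⟨N, φ₁, φ₂, h₁, h₂⟩ :=
    hT k K (properModelOfChart Xb πX A (jX ≫ sX) hcX) (properModelOfChart Ub πU A (jU ≫ sU) hcU)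
  -- abbreviations (term-mode use only)
  let PX : ProperModel k K := properModelOfChart Xb πX A (jX ≫ sX) hcX
  let PU : ProperModel k K := properModelOfChart Ub πU A (jU ≫ sU) hcU
  /- Step 4: the second projection maps `N|_V` into `U`. -/
  have hφ₁gen : φ₁.f (genericPoint N.X) = genericPoint Xb := by
    rw [← N.genericPt_eq']
    change (N.gen ≫ φ₁.f) (closedPoint K) = genericPoint Xb
    rw [φ₁.gen_f]
    exact PX.genericPt_eq
  have hOne : ((sX ''ᵁ V : Xb.Opens) : Set Xb).Nonempty := ⟨sX x₀, ⟨x₀, hx₀, rfl⟩⟩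
  have hWn : ((φ₁.f ⁻¹ᵁ (sX ''ᵁ V) : N.X.Opens) : Set N.X).Nonempty := by
    refine ⟨genericPoint N.X, ?_⟩
    change φ₁.f (genericPoint N.X) ∈ (sX ''ᵁ V : Xb.Opens)
    rw [hφ₁gen]
    exact PX.genericPoint_mem hOne
  haveI : Nonempty ((φ₁.f ⁻¹ᵁ (sX ''ᵁ V) : N.X.Opens) : Scheme.{u}) := ⟨⟨_, hWn.some_mem⟩⟩
  haveI : IsIntegral ((φ₁.f ⁻¹ᵁ (sX ''ᵁ V) : N.X.Opens) : Scheme.{u}) :=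
    isIntegral_of_isOpenImmersion (φ₁.f ⁻¹ᵁ (sX ''ᵁ V)).ι
  -- the two morphisms `φ₁⁻¹(sX V) → Ub` (second projection; first projection then `η`) agree
  have hab : (φ₁.f ⁻¹ᵁ (sX ''ᵁ V)).ι ≫ φ₂.f =
      (φ₁.f ∣_ (sX ''ᵁ V)) ≫ (sX.isoImage V).inv ≫ η ≫ sU := by
    -- the dominant `K`-point
    let γ : Spec (.of K) ⟶ ((φ₁.f ⁻¹ᵁ (sX ''ᵁ V) : N.X.Opens) : Scheme.{u}) := N.genLift hWn
    have hγ : γ ≫ (φ₁.f ⁻¹ᵁ (sX ''ᵁ V)).ι = N.gen := N.genLift_ι hWn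
    haveI : IsDominant γ := by
      have hpt : (φ₁.f ⁻¹ᵁ (sX ''ᵁ V)).ι (γ (closedPoint K)) =
          (φ₁.f ⁻¹ᵁ (sX ''ᵁ V)).ι
            (genericPoint ((φ₁.f ⁻¹ᵁ (sX ''ᵁ V) : N.X.Opens) : Scheme.{u})) := by
        rw [← Scheme.Hom.comp_apply, hγ, genericPoint_eq_of_isOpenImmersion]
        exact N.genericPt_eq
      have hpt' : γ (closedPoint K) =
          genericPoint ((φ₁.f ⁻¹ᵁ (sX ''ᵁ V) : N.X.Opens) : Scheme.{u}) :=
        (φ₁.f ⁻¹ᵁ (sX ''ᵁ V)).ι.isOpenEmbedding.injective hpt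
      refine ⟨dense_iff_closure_eq.mpr (Set.eq_univ_of_univ_subset ?_)⟩
      have hcl := (genericPoint_spec ((φ₁.f ⁻¹ᵁ (sX ''ᵁ V) : N.X.Opens) : Scheme.{u})).def
      rw [← hpt'] at hcl
      calc (Set.univ : Set ((φ₁.f ⁻¹ᵁ (sX ''ᵁ V) : N.X.Opens) : Scheme.{u}))
          = closure {γ (closedPoint K)} := hcl.symm
        _ ⊆ closure (Set.range γ) := closure_mono (Set.singleton_subset_iff.mpr ⟨_, rfl⟩)
    refine ext_of_isDominant_of_isSeparated (Y := Ub) πU ?_ γ ?_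
    · -- both are morphisms over `k`
      have ha : ((φ₁.f ⁻¹ᵁ (sX ''ᵁ V)).ι ≫ φ₂.f) ≫ πU = (φ₁.f ⁻¹ᵁ (sX ''ᵁ V)).ι ≫ N.π := by
        rw [Category.assoc, φ₂.f_π]
      have e1 : (sX.isoImage V).inv ≫ V.ι ≫ f = (sX ''ᵁ V).ι ≫ πX := by
        rw [← hsXπ, Scheme.Hom.isoImage_inv_ι_assoc]
      have hb : ((φ₁.f ∣_ (sX ''ᵁ V)) ≫ (sX.isoImage V).inv ≫ η ≫ sU) ≫ πU =
          (φ₁.f ⁻¹ᵁ (sX ''ᵁ V)).ι ≫ N.π := by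
        rw [Category.assoc, Category.assoc, Category.assoc, hsUπ, hcomm, e1, ← Category.assoc,
          morphismRestrict_ι, Category.assoc, φ₁.f_π]
      rw [ha, hb]
    · -- both restrict to the `K`-point of `PU`
      have ha : γ ≫ (φ₁.f ⁻¹ᵁ (sX ''ᵁ V)).ι ≫ φ₂.f =
          Spec.map (CommRingCat.ofHom (algebraMap A K)) ≫ jU ≫ sU := by
        rw [← Category.assoc, hγ, φ₂.gen_f]
      have h3 : (γ ≫ (φ₁.f ∣_ (sX ''ᵁ V))) ≫ (sX ''ᵁ V).ι =
          (Spec.map (CommRingCat.ofHom (algebraMap A K)) ≫ jV ≫ (sX.isoImage V).hom) ≫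
            (sX ''ᵁ V).ι := by
        rw [Category.assoc, morphismRestrict_ι, ← Category.assoc, hγ, φ₁.gen_f,
          Category.assoc, Category.assoc, Scheme.Hom.isoImage_hom_ι, ← Category.assoc jV, ← hjXdef]
      have h3' : γ ≫ (φ₁.f ∣_ (sX ''ᵁ V)) =
          Spec.map (CommRingCat.ofHom (algebraMap A K)) ≫ jV ≫ (sX.isoImage V).hom :=
        (cancel_mono (sX ''ᵁ V).ι).mp h3
      have hb : γ ≫ (φ₁.f ∣_ (sX ''ᵁ V)) ≫ (sX.isoImage V).inv ≫ η ≫ sU =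
          Spec.map (CommRingCat.ofHom (algebraMap A K)) ≫ jU ≫ sU := by
        rw [← Category.assoc, h3', Category.assoc, Category.assoc, Iso.hom_inv_id_assoc,
          ← Category.assoc jV, hjVη]
      rw [ha, hb]
  -- consequence at points: the second projection maps points over `V` into `sU(U)`
  have hover : ∀ (n : N.X) (x : X), x ∈ V → φ₁.f n = sX x → ∃ u : U, φ₂.f n = sU u := by
    intro n x hxV hn
    have hnO : n ∈ (φ₁.f ⁻¹ᵁ (sX ''ᵁ V) : N.X.Opens) := by
      change φ₁.f n ∈ (sX ''ᵁ V : Xb.Opens)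
      rw [hn]
      exact ⟨x, hxV, rfl⟩
    refine ⟨η ((sX.isoImage V).inv ((φ₁.f ∣_ (sX ''ᵁ V)) ⟨n, hnO⟩)), ?_⟩
    have := congrArg
      (fun φ : ((φ₁.f ⁻¹ᵁ (sX ''ᵁ V) : N.X.Opens) : Scheme.{u}) ⟶ Ub => φ ⟨n, hnO⟩) hab
    simp only [Scheme.Hom.comp_apply] at this
    exact this
  /- Step 5: the resolution of `X`: the first projection restricted over `X ≅ sX(X)`. -/
  let ρ : ((φ₁.f ⁻¹ᵁ sX.opensRange : N.X.Opens) : Scheme.{u}) ⟶ X :=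
    (φ₁.f ∣_ sX.opensRange) ≫ sX.isoOpensRange.inv
  refine ⟨_, ρ, ⟨inferInstance, (φ₁.isBirational.morphismRestrict sX.opensRange).comp_iso _, ?_⟩⟩
  intro y
  rw [SandwichedGluing.mem_regularLocus_opens_iff]
  obtain ⟨x, hx⟩ : ∃ x : X, sX x = φ₁.f y.1 := y.2
  by_cases hxV : x ∈ V
  · -- over `V`: regular because `PU` is regular on `U`
    obtain ⟨u, hu⟩ := hover y.1 x hxV hx.symm
    refine h₂ y.1 ?_
    change IsRegularLocalRing (Ub.presheaf.stalk (φ₂.f y.1))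
    rw [hu]
    haveI := hUreg u
    exact IsRegularLocalRing.of_ringEquiv (asIso (sU.stalkMap u)).commRingCatIsoToRingEquiv.symm
  · -- off `V`: regular because `X` is regular there
    refine h₁ y.1 ?_
    change IsRegularLocalRing (Xb.presheaf.stalk (φ₁.f y.1))
    rw [← hx]
    haveI := hreg x hxV
    exact IsRegularLocalRing.of_ringEquiv (asIso (sX.stalkMap x)).commRingCatIsoToRingEquiv.symm

end Costume


/-! ### (N12) Model level: local RegLe-ification ⇔ RegLe-ification ⇔ two-model patching -/

/-- (N12a) `RegLeification_p ⇒ LocalRegLeification_p` (take `O = M`, `N = M'`): the local form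
is formally WEAKER. -/
theorem localRegLeification_of_regLeification {p : ℕ} (h : RegLeification.{u} p) :
    LocalRegLeification.{u} p := by
  intro k _ _ K _ _ _ M Y φ
  obtain ⟨M', ψ, hψ, hψφ⟩ := h k K M Y φ
  let e : M.X ⟶ ((⊤ : M.X.Opens) : Scheme.{u}) := (Scheme.topIso M.X).inv
  have hval : ∀ x, ((ψ.f ≫ e) x).1 = ψ.f x := fun x => by
    have h1 : ((ψ.f ≫ e) ≫ (⊤ : M.X.Opens).ι) x = ψ.f x := by
      rw [Category.assoc]
      change (ψ.f ≫ (Scheme.topIso M.X).inv ≫ (Scheme.topIso M.X).hom) x = _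
      rw [Iso.inv_hom_id, Category.comp_id]
    simpa [Scheme.Hom.comp_apply] using h1
  refine ⟨⊤, M'.X, ψ.f ≫ e, inferInstance, inferInstance, ψ.isBirational.comp_iso e,
    fun _ _ => trivial, fun _ _ => trivial, fun n hn => hψ n ?_, fun n hn => hψφ n ?_⟩
  · rwa [hval n] at hn
  · rw [hval n] at hn
    rwa [ProperModel.Hom.comp_f, Scheme.Hom.comp_apply]

/-- (N12b) Modulo Nagata (through the line's landed S2 `ProperModel.regLeification_of_local` and
`SandwichedGluing.extension_of_nagata`, and the join glue), the three upper statements of the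
line coincide: `LocalRegLeification_p ↔ TwoModelPatching_p` (`↔ RegLeification_p`). -/
theorem localRegLeification_iff_twoModelPatching {p : ℕ} (hN : NagataCompactification.{u}) :
    LocalRegLeification.{u} p ↔ TwoModelPatching.{u} p :=
  ⟨fun h => SandwichedGluing.twoModelPatching_of_regLeification p
      (regLeification_of_local p (SandwichedGluing.extension_of_nagata hN) h),
    fun h => localRegLeification_of_regLeification (regLeification_of_twoModelPatching' h)⟩

/-! ### (W4) Consequences for the reshaped line -/

/-- (W4a) **SANDʷ ⇔ two-model patching, modulo Nagata and the lead's stub S3′**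
(`SANDʷ_p ⇒ LocalRegLeification_p`, "apply the atom to `Reg M ∪ φ⁻¹ Reg Y`"): the reshaped atom
is Piltant's two-model patching problem in a geometric costume. -/
theorem sandwichedWeak_iff_twoModelPatching {p : ℕ} (hN : NagataCompactification.{u})
    (hS3 : SandwichedWeakResolution.{u} p → LocalRegLeification.{u} p) :
    SandwichedWeakResolution.{u} p ↔ TwoModelPatching.{u} p :=
  ⟨fun h => (localRegLeification_iff_twoModelPatching hN).mp (hS3 h),
    fun h => sandwichedWeak_of_twoModelPatching hN h⟩

/-- (W4b) The OLD atom implies the NEW one (modulo Nagata): `SAND⁺_p ⇒ SANDʷ_p`, through the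
landed gluing S3, (N12b) and (W3) — nothing built is lost by the reshaping. -/
theorem sandwichedWeak_of_sand {p : ℕ} (hN : NagataCompactification.{u}) (hOG : OpenGluing.{u})
    (hS : SandwichedStrongResolution.{u} p) : SandwichedWeakResolution.{u} p :=
  sandwichedWeak_of_twoModelPatching hN ((localRegLeification_iff_twoModelPatching hN).mp
    (SandwichedGluing.localRegLeification_of_openGluing_of_sandwiched p hOG hS))

/-- (W4c) The reshaped line has NO SLACK (modulo Nagata + S3′): the crux is
`∀ p prime, LUrel_p → SANDʷ_p` … -/
theorem patchingRel_iff_lurel_imp_sandwichedWeak (hN : NagataCompactification.{0})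
    (hS3 : ∀ p : ℕ, SandwichedWeakResolution.{0} p → LocalRegLeification.{0} p) :
    Valuative.PatchingRel ↔ ∀ p : ℕ, p.Prime → LUrel p → SandwichedWeakResolution.{0} p :=
  ⟨fun h p hp hLU => sandwichedWeak_of_res (h p hp hLU),
    fun h p hp hLU => resolutionInChar_of_properTwoModelPatching_of_relLU
      ((sandwichedWeak_iff_twoModelPatching hN (hS3 p)).mp (h p hp hLU)) hLU⟩

/-- (W4d) … and `Res_p ↔ SANDʷ_p ∧ LUrel_p`. -/
theorem res_iff_sandwichedWeak_and_lurel (hN : NagataCompactification.{0})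
    (hS3 : ∀ p : ℕ, SandwichedWeakResolution.{0} p → LocalRegLeification.{0} p)
    (p : ℕ) (hp : p.Prime) :
    ResolutionInChar.{0} p ↔ SandwichedWeakResolution.{0} p ∧ LUrel p :=
  ⟨fun h => ⟨sandwichedWeak_of_res h, lurel_of_resolutionInChar p hp h⟩,
    fun h => resolutionInChar_of_properTwoModelPatching_of_relLU
      ((sandwichedWeak_iff_twoModelPatching hN (hS3 p)).mp h.1) h.2⟩

/-- (W4e) WITHOUT local uniformization, SANDʷ (≡ TMP) still resolves every variety whose function
field has SOME regular proper model (Disproof §13 (N10), tree `ProperModel.RegModel`): in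
particular every RATIONAL variety of characteristic `p`. -/
theorem res_iff_sandwichedWeak_and_regModel (hN : NagataCompactification.{u})
    (hS3 : ∀ p : ℕ, SandwichedWeakResolution.{u} p → LocalRegLeification.{u} p) (p : ℕ) :
    ResolutionInChar.{u} p ↔ SandwichedWeakResolution.{u} p ∧ ProperModel.RegModel.{u} p := by
  rw [ProperModel.resolutionInChar_iff_twoModelPatching_and_regModel,
    sandwichedWeak_iff_twoModelPatching hN (hS3 p)]

/-! ### (W5) The dimension-`≤ 3` case of SANDʷ is the WEAK named fact `CossartPiltant2019` -/

/-- SANDʷ for `dim X ≤ 3` holds modulo `CossartPiltant2019` alone (no `General`/strong form, no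
J-2 fact): the residual open content of the reshaped atom is literally "weak resolution of
sandwiched-singularity varieties of dimension `≥ 4` in characteristic `p`". -/
theorem sandwichedWeak_dimLe3 (h : CossartPiltant2019.{u}) {p : ℕ} (k : Type u) [Field k]
    [CharP k p] (X : Scheme.{u}) (f : X ⟶ Spec (.of k)) [IsSeparated f] [LocallyOfFiniteType f]
    [QuasiCompact f] [IsIntegral X] (hdim : topologicalKrullDim X ≤ 3) :
    Scheme.HasResolution X :=
  h k X f ‹_› ‹_› ‹_› inferInstance hdim


/-! ### (W6) The lead's stub S3′, proved: SANDʷ ⇒ local RegLe-ification (no gluing) -/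

/-- An isomorphism is birational. -/
theorem isBirational_of_isIso {X Y : Scheme.{u}} (e : X ⟶ Y) [IsIso e] : IsBirational e :=
  ⟨⊤, by simp, by simp, inferInstance⟩

set_option maxHeartbeats 800000 in
/-- (W6) **`SANDʷ_p ⇒ LocalRegLeification_p`** (the reshaped line's stub S3′, as announced by
the gen-1 lead: apply the weak atom to the open `O := Reg M ∪ φ⁻¹(Reg Y)` of `M`, which is a
sandwiched-singularity variety — regular outside `φ⁻¹(Reg Y)`, which is proper and birational
over the regular `Reg Y`; a weak resolution of `O` is regular everywhere, so both `RegLe`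
clauses hold; openness of the regular loci is the tree's
`isOpen_regularLocus_of_locallyOfFiniteType_field`). -/
theorem localRegLeification_of_sandwichedWeak {p : ℕ} (hS : SandwichedWeakResolution.{u} p) :
    LocalRegLeification.{u} p := by
  intro k _ _ K _ _ _ M Y φ
  -- the regular loci, as opens
  let RM : M.X.Opens := ⟨Scheme.regularLocus M.X, isOpen_regularLocus_of_locallyOfFiniteType_field M.π⟩
  let RY : Y.X.Opens := ⟨Scheme.regularLocus Y.X, isOpen_regularLocus_of_locallyOfFiniteType_field Y.π⟩
  let W' : M.X.Opens := φ.f ⁻¹ᵁ RY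
  let O : M.X.Opens := RM ⊔ W'
  have hW'O : W' ≤ O := le_sup_right
  -- `O` and `Reg Y` are integral (non-empty: generic stalks are fields)
  have hgenM : genericPoint M.X ∈ O := by
    refine Or.inl ?_
    change IsRegularLocalRing M.X.functionField
    infer_instance
  have hgenY : genericPoint Y.X ∈ RY := by
    change IsRegularLocalRing Y.X.functionField
    infer_instance
  haveI : Nonempty (O : Scheme.{u}) := ⟨⟨_, hgenM⟩⟩
  haveI : Nonempty (RY : Scheme.{u}) := ⟨⟨_, hgenY⟩⟩
  haveI : IsIntegral (O : Scheme.{u}) := isIntegral_of_isOpenImmersion O.ι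
  haveI : IsIntegral (RY : Scheme.{u}) := isIntegral_of_isOpenImmersion RY.ι
  have hRYreg : Scheme.IsRegular (RY : Scheme.{u}) := by
    intro y
    rw [SandwichedGluing.mem_regularLocus_opens_iff]
    exact y.2
  -- the sandwiched piece `V = O ∩ φ⁻¹(Reg Y) ≅ φ⁻¹(Reg Y) → Reg Y`
  let V : (O : Scheme.{u}).Opens := O.ι ⁻¹ᵁ W'
  have hrange : Set.range (V.ι ≫ O.ι) = Set.range W'.ι := by
    rw [Scheme.Hom.comp_base, TopCat.coe_comp, Set.range_comp, Scheme.Opens.range_ι,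
      Scheme.Opens.range_ι]
    ext m
    constructor
    · rintro ⟨x, hx, rfl⟩
      exact hx
    · intro hm
      exact ⟨⟨m, hW'O hm⟩, hm, rfl⟩
  let e : (V : Scheme.{u}) ≅ (W' : Scheme.{u}) :=
    IsOpenImmersion.isoOfRangeEq (V.ι ≫ O.ι) W'.ι hrange
  have he : e.hom ≫ W'.ι = V.ι ≫ O.ι := IsOpenImmersion.isoOfRangeEq_hom_fac _ _ _
  let η : (V : Scheme.{u}) ⟶ (RY : Scheme.{u}) := e.hom ≫ (φ.f ∣_ RY)
  have hηbir : IsBirational η := (isBirational_of_isIso e.hom).comp (φ.isBirational.morphismRestrict RY)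
  have hcomm : η ≫ (RY.ι ≫ Y.π) = V.ι ≫ (O.ι ≫ M.π) := by
    change (e.hom ≫ (φ.f ∣_ RY)) ≫ RY.ι ≫ Y.π = _
    rw [Category.assoc, ← Category.assoc (φ.f ∣_ RY), morphismRestrict_ι, Category.assoc, φ.f_π,
      ← Category.assoc, he, Category.assoc]
  have hreg : ∀ x : (O : Scheme.{u}), x ∉ V → IsRegularLocalRing ((O : Scheme.{u}).presheaf.stalk x) := by
    intro x hx
    rw [SandwichedGluing.mem_regularLocus_opens_iff]
    rcases x.2 with h | h
    · exact h
    · exact absurd h hx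
  -- apply the weak atom to `O`
  obtain ⟨N, π, hπ⟩ := hS k (O : Scheme.{u}) (RY : Scheme.{u}) (O.ι ≫ M.π) (RY.ι ≫ Y.π) V η
    inferInstance inferInstance inferInstance inferInstance inferInstance inferInstance
    inferInstance inferInstance hRYreg inferInstance hηbir hcomm hreg
  haveI := hπ.isProper
  haveI : IsReduced N := hπ.isRegular.isReduced
  haveI : IsIntegral N := hπ.isBirational.isIntegral
  refine ⟨O, N, π, inferInstance, inferInstance, hπ.isBirational, fun m hm => Or.inl hm,
    fun m hm => Or.inr hm, fun n _ => hπ.isRegular n, fun n _ => hπ.isRegular n⟩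

/-- (W6′) Hence, modulo Nagata ALONE: **`SANDʷ_p ↔ TwoModelPatching_p`**. -/
theorem sandwichedWeak_iff_twoModelPatching' {p : ℕ} (hN : NagataCompactification.{u}) :
    SandwichedWeakResolution.{u} p ↔ TwoModelPatching.{u} p :=
  sandwichedWeak_iff_twoModelPatching hN localRegLeification_of_sandwichedWeak


end SandwichedWeak

end Summit.ResolutionOfSingularities.ResolutionOfSingularities.Cruxes.PatchingRel.Disproof
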